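import Literature.Analysis.FluidPDE.Onsager
import Literature.Analysis.FluidPDE.OnsagerCCFSEnergyProofs
import Literature.Analysis.FunctionSpaces.TorusCommutatorEstimate
import Literature.Analysis.FunctionSpaces.TorusSpaceTimeLift
import Literature.Analysis.FunctionSpaces.TorusSpaceTimeAdjoint
import Literature.Analysis.FunctionSpaces.LpPairingLimits
import Literature.Analysis.FunctionSpaces.DistributionalConstancy
import Literature.Analysis.FunctionSpaces.FlatTorusProofs
import Mathlib.MeasureTheory.Integral.IntegralEqImproper
import HarnessLib

/-!
# Proof of Onsager rigidity (Constantin–E–Titi 1994)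

Analysis/FluidPDE proofs file: discharges the named fact `Literature.Analysis.FluidPDE.onsager_rigidity`
(`FluidPDE/Onsager`): a weak solution of incompressible Euler on `T³ × (0,T)` of class
`L³(0,T; B^α_{3,∞}(T³))` with `α > 1/3` conserves kinetic energy, `E(u(s)) = E(u(t))` for a.e.
`s, t ∈ (0,T)` (Constantin–E–Titi, Comm. Math. Phys. 165 (1994), Theorem p. 207, in the
a.e.-in-time form appropriate for `L²_{t,x}` weak solutions). The main result is
`Literature.Turb.onsager_rigidity_holds : onsager_rigidity` (Part 4).

## The argument (Constantin–E–Titi 1994, pp. 208–209, with the time regularisation carried out)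

1. *Representative.* A weak solution is an `L²_{t,x}` class; we pass to a strongly measurable
   representative `U` of `u · 1_{(0,T)}` on `ℝ × T³` (all hypotheses and the conclusion only see
   `u` through integrals, slice-wise a.e.).
2. *Mollified balance, CET (11).* For `0 < ε ≤ 1/4` and every test function `η` on `(0,T)`,
   `½ ∫ η'(s) ‖u^ε(s)‖²_{L²} ds = -∑ᵢⱼ ∫∫ η (uᵢuⱼ)^ε ∂ⱼuᵢ^ε` (`Torus.energy_balance_vecMollify`,
   Part 3): test the weak formulation with the space–time mollified, cut-off field
   `ψ = ρ ⋆ₜ (η (ρ ⋆ₜ u^ε))^ε` (Part 1: `ψ` is an admissible divergence-free test field), move the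
   mollifiers onto `u` (Part 2), and remove the time mollification `ρ → δ` (Part 3).
3. *Commutator estimate, CET (6)–(12).* At a.e. time the flux is
   `|∫ ∑ᵢⱼ (uᵢuⱼ)^ε ∂ⱼuᵢ^ε| ≤ C [u(t)]³_{B^α_{3,∞}} ε^{3α-1}`
   (`Torus.abs_integral_flux_vecMollify_le_of_memBesovSup`, `TorusCommutatorEstimate`: the identity
   `(u⊗u)^ε = u^ε⊗u^ε + r_ε(u,u) - (u-u^ε)⊗(u-u^ε)` and incompressibility of `u^ε`), and
   `t ↦ [u(t)]³` is integrable on `(0,T)` by hypothesis; hence the right-hand side of (11) is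
   `O(ε^{3α-1}) → 0`.
4. *`ε → 0`.* `u^ε(t) → u(t)` in `L²(T³)` at a.e. time with `‖u^ε(t)‖₂ ≤ ‖u(t)‖₂`, so
   `∫ η' ‖u^ε‖²₂ → ∫ η' ‖u‖²₂ = 2 ∫ η' E` (dominated convergence); therefore `∫_{(0,T)} η' E = 0`
   for every test function `η`.
5. *Conclusion.* A locally integrable function with vanishing distributional derivative on an
   interval is a.e. constant (`Literature.Analysis.FunctionSpaces.ae_eq_const_of_forall_setIntegral_deriv_mul_eq_zero`,
   `DistributionalConstancy`), which is `Turb.ConservesEnergyAEOn`.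

## Contents

* Part 1 — the test field: for `U : ℝ → T^d → ℝ^d` strongly measurable and integrable on
  `ℝ × T^d`, a normalised time bump `ρ = φ.normed volume`, `0 < ε ≤ 1/4` and a smooth cut-off `η`,
  the space–time mollification `w = Torus.mollifiedField φ ε U` and the test field
  `ψ = Torus.cetTestField φ ε η U` (`TorusMollifiedFields`) are jointly smooth with the expected
  time supports, every slice is divergence free, `Torus.isSpaceTimeTestIoo_cetTestField`,
  `Torus.isDivFreeTest_cetTestField`, and the derivative formulas
  `∂ₜψᵢ = timeAvgWith ρ' (s ↦ (η wᵢ)(s) ⋆ k_ε)`, `∂ⱼψᵢ = timeAvgWith ρ (s ↦ (η wᵢ)(s) ⋆ ∂ⱼk_ε)`.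
* Part 2 — the mollified balance: `Torus.integral_inner_timeDeriv_cetTestField`
  (`∫∫ ⟪U, ∂ₜψ⟫ = ½ ∫ η' ‖w‖²_{L²}`), `Torus.integral_inner_convect_cetTestField`
  (`∫∫ ⟪U, (U·∇)ψ⟫ = ∑ᵢⱼ ∫∫ η 𝒯ᵢⱼ ∂ⱼwᵢ`, `𝒯ᵢⱼ = (ρ ⋆ₜ UᵢUⱼ) ⋆ k_ε`) and
  `Torus.mollified_energy_balance` (`½ ∫ η' ‖w‖²_{L²} + ∑ᵢⱼ ∫∫ η 𝒯ᵢⱼ ∂ⱼwᵢ = 0`).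
* Part 3 — CET (11), distributional in time: `Torus.eLpNorm_uncurry_convolution_le` (space–time
  Young inequality for slice-wise mollification) and `Torus.energy_balance_vecMollify`
  (`½ ∫ η' ‖u^ε‖²_{L²} + ∑ᵢⱼ ∫∫ η (UᵢUⱼ ⋆ k_ε) (Uᵢ ⋆ ∂ⱼk_ε) = 0`, by letting the time radius of
  `ρ` tend to `0` with `LpPairingLimits`).
* Part 4 — the representative of an `L²_{t,x}` weak solution, the limit `ε → 0`
  (`Torus.integral_deriv_mul_energy_eq_zero`) and `Turb.onsager_rigidity_holds`.

## References

* P. Constantin, W. E, E. S. Titi, *Onsager's conjecture on the energy conservation for solutions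
  of Euler's equation*, Comm. Math. Phys. 165 (1994), 207–209, Theorem (p. 207) and its proof,
  pp. 208–209, in particular (6)–(12).
-/

noncomputable section

open MeasureTheory TopologicalSpace Set Function Filter Topology Metric ContinuousLinearMap
open scoped ENNReal NNReal Convolution InnerProductSpace ContDiff

/-! ## Part 1. The Constantin–E–Titi test field: admissibility, derivatives and bounds

(Constantin–E–Titi 1994, proof, pp. 208–209).
Let `U : ℝ → T^d → ℝ^d` be a velocity field with `uncurry U` strongly measurable and integrable
on `ℝ × T^d`, vanishing outside the time interval `(0, T₀)`, let `ρ = φ.normed volume` be a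
normalised bump in time, `0 < ε ≤ 1/4`, `w = Torus.mollifiedField φ ε U` the space–time
mollification and `ψ = Torus.cetTestField φ ε η U` the test field built with a smooth time
cut-off `η` supported in `(0, T₀)` (`TorusMollifiedFields`). We prove:

* `w`: componentwise formulas, joint smoothness of `stLift w`, compact time support,
  incompressibility of every slice (from a.e. weak incompressibility of `U`), the time derivative
  `∂ₜwᵢ = timeAvgWith ρ' (s ↦ Uᵢ s ⋆ k_ε)`, and uniform bounds;
* `ψ`: joint smoothness, time support, hence `Torus.IsSpaceTimeTestIoo T₀ ψ` and
  `Torus.IsDivFreeTest ψ` — `ψ` is an admissible test field for the weak Euler formulation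
  `Torus.IsWeakNSSolutionOn T₀ 0` — together with the formulas
  `∂ₜψᵢ = timeAvgWith ρ' (s ↦ (η wᵢ)(s) ⋆ k_ε)`, `∂ⱼψᵢ = timeAvgWith ρ (s ↦ (η wᵢ)(s) ⋆ ∂ⱼk_ε)` and
  `⟪U, (U·∇)ψ⟫ = ∑ᵢⱼ UᵢUⱼ ∂ⱼψᵢ`.
-/

namespace Literature.Analysis.FluidPDE

namespace Torus

variable {d : Type*} [Fintype d]

/-! ## General glue -/

section Glue

/-- A vector-valued function of time is differentiable with the derivative assembled from the
derivatives of its coordinates. [folklore] -/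
theorem hasDerivAt_of_apply {v : ℝ → EuclideanSpace ℝ d} {v' : d → ℝ} {t : ℝ}
    (h : ∀ i, HasDerivAt (fun τ => v τ i) (v' i) t) : HasDerivAt v (WithLp.toLp 2 v') t := by
  have hpi : HasDerivAt (fun τ i => v τ i) v' t := hasDerivAt_pi.2 h
  exact ((PiLp.continuousLinearEquiv 2 ℝ (fun _ : d => ℝ)).symm :
    (d → ℝ) →L[ℝ] EuclideanSpace ℝ d).hasFDerivAt.comp_hasDerivAt t hpi

/-- Coordinates of the torus derivative of a smooth vector field:
`(Dv(x) w)ᵢ = D(vᵢ)(x) w`. [folklore] -/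
theorem fderiv_apply_apply {v : UnitAddTorus d → EuclideanSpace ℝ d} (hv : FunctionSpaces.Torus.IsSmooth v)
    (x : UnitAddTorus d) (w : EuclideanSpace ℝ d) (i : d) :
    (FunctionSpaces.Torus.fderiv v x w) i = FunctionSpaces.Torus.fderiv (fun y => v y i) x w := by
  have hd : HasFDerivAt (FunctionSpaces.Torus.liftAt v x) (FunctionSpaces.Torus.fderiv v x) 0 :=
    (((hv.liftAt x).differentiable (by simp)).differentiableAt).hasFDerivAt
  have h2 := ((EuclideanSpace.proj i).hasFDerivAt.comp (0 : EuclideanSpace ℝ d) hd).fderiv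
  have h3 : FunctionSpaces.Torus.fderiv (fun y => v y i) x = (EuclideanSpace.proj i).comp (FunctionSpaces.Torus.fderiv v x) := by
    rw [FunctionSpaces.Torus.fderiv, ← h2]
    rfl
  rw [h3]
  rfl

variable [DecidableEq d] in
/-- The convective pairing in coordinates: `⟪a, Dψ(x) a⟫ = ∑ᵢⱼ aᵢ aⱼ ∂ⱼψᵢ(x)` for smooth `ψ`. [folklore] -/
theorem inner_fderiv_apply_eq_sum {ψ : UnitAddTorus d → EuclideanSpace ℝ d} (hψ : FunctionSpaces.Torus.IsSmooth ψ)
    (x : UnitAddTorus d) (a : EuclideanSpace ℝ d) :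
    ⟪a, FunctionSpaces.Torus.fderiv ψ x a⟫_ℝ = ∑ i, ∑ j, a i * a j * FunctionSpaces.Torus.partialDeriv j (fun y => ψ y i) x := by
  rw [PiLp.inner_apply]
  refine Finset.sum_congr rfl fun i _ => ?_
  rw [fderiv_apply_apply hψ, FunctionSpaces.Torus.fderiv_apply_eq_sum_partialDeriv ((hψ.apply i).isContDiff (by simp))]
  simp only [RCLike.inner_apply, conj_trivial, smul_eq_mul]
  rw [Finset.sum_mul]
  refine Finset.sum_congr rfl fun j _ => ?_
  ring

omit [Fintype d] in
/-- A jointly continuous space–time field vanishing outside a compact time interval is bounded. [folklore] -/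
theorem exists_forall_norm_le_of_tsupport {X : Type*} [NormedAddCommGroup X] [Fintype d]
    {F : ℝ → UnitAddTorus d → X} (hF : Continuous (uncurry F)) {a b : ℝ}
    (h0 : ∀ t, t ∉ Icc a b → F t = 0) : ∃ C, 0 ≤ C ∧ ∀ t x, ‖F t x‖ ≤ C := by
  obtain ⟨C, hC⟩ := (isCompact_Icc.prod isCompact_univ :
    IsCompact (Icc a b ×ˢ (univ : Set (UnitAddTorus d)))).exists_bound_of_continuousOn
    hF.continuousOn
  refine ⟨max C 0, le_max_right _ _, fun t x => ?_⟩
  by_cases ht : t ∈ Icc a b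
  · exact (hC (t, x) (mk_mem_prod ht (mem_univ x))).trans (le_max_left _ _)
  · rw [h0 t ht]
    simp

omit [Fintype d] in
/-- A space–time field with smooth lift is jointly continuous on `ℝ × T^d`. [folklore] -/
theorem continuous_uncurry_of_contDiff_stLift {X : Type*} [NormedAddCommGroup X] [NormedSpace ℝ X]
    [Fintype d] {F : ℝ → UnitAddTorus d → X} (hF : ContDiff ℝ ∞ (FunctionSpaces.Torus.stLift F)) :
    Continuous (uncurry F) :=
  FunctionSpaces.Torus.continuous_uncurry_of_continuous_stLift hF.continuous

omit [Fintype d] in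
/-- A jointly continuous space–time field vanishing outside a compact time interval is
integrable on `ℝ × T^d`. [folklore] -/
theorem integrable_uncurry_of_tsupport {X : Type*} [NormedAddCommGroup X] [Fintype d]
    {F : ℝ → UnitAddTorus d → X} (hF : Continuous (uncurry F)) {a b : ℝ}
    (h0 : ∀ t, t ∉ Icc a b → F t = 0) :
    Integrable (uncurry F) (Measure.prod (volume : Measure ℝ) (volume : Measure (UnitAddTorus d))) := by
  obtain ⟨C, -, hC⟩ := exists_forall_norm_le_of_tsupport hF h0
  have hdom : Integrable (fun p : ℝ × UnitAddTorus d => (Icc a b).indicator (fun _ => C) p.1)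
      (Measure.prod (volume : Measure ℝ) (volume : Measure (UnitAddTorus d))) :=
    ((integrable_indicator_iff measurableSet_Icc).2
      (integrableOn_const (by rw [Real.volume_Icc]; exact ENNReal.ofReal_ne_top))).comp_fst volume
  refine hdom.mono' hF.aestronglyMeasurable (Eventually.of_forall fun p => ?_)
  by_cases hp : p.1 ∈ Icc a b
  · simp only [indicator_of_mem hp, uncurry]
    exact hC p.1 p.2
  · simp only [indicator_of_notMem hp, uncurry]
    rw [h0 p.1 hp, Pi.zero_apply, norm_zero]

variable [DecidableEq d] in
/-- Constant multiples of divergence-free fields are divergence free. [folklore] -/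
theorem _root_.Literature.Analysis.FunctionSpaces.Torus.IsDivFree.const_smul {v : UnitAddTorus d → EuclideanSpace ℝ d} (hv : FunctionSpaces.Torus.IsSmooth v)
    (hdiv : FunctionSpaces.Torus.IsDivFree v) (c : ℝ) : FunctionSpaces.Torus.IsDivFree (fun y => c • v y) := by
  intro x
  have h : ∀ i, (fun y => (c • v y) i) = c • fun y => v y i := fun i => by
    funext y; simp
  simp only [FunctionSpaces.Torus.divergence, h, FunctionSpaces.Torus.partialDeriv_const_smul ((hv.apply _).isContDiff (by simp)),
    Pi.smul_apply, smul_eq_mul, ← Finset.mul_sum]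
  rw [show ∑ i, FunctionSpaces.Torus.partialDeriv i (fun y => v y i) x = FunctionSpaces.Torus.divergence v x from rfl, hdiv x, mul_zero]

/-- **Sup bound for time averages**: if `‖H s x‖ ≤ C` for all `s` then
`‖timeAvgWith r H t x‖ ≤ (∫ |r|) C`. [folklore] -/
theorem norm_timeAvgWith_le {X : Type*} {F' : Type*} [NormedAddCommGroup F'] [NormedSpace ℝ F']
    {r : ℝ → ℝ} (hr : Integrable r volume) {H : ℝ → X → F'} {C : ℝ} (hC : ∀ s x, ‖H s x‖ ≤ C)
    (t : ℝ) (x : X) : ‖FunctionSpaces.timeAvgWith r H t x‖ ≤ (∫ s, ‖r s‖) * C := by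
  rw [FunctionSpaces.timeAvgWith_apply, ← integral_mul_const]
  refine norm_integral_le_of_norm_le (hr.norm.mul_const C) (Eventually.of_forall fun s => ?_)
  rw [norm_smul]
  exact mul_le_mul_of_nonneg_left (hC _ _) (norm_nonneg _)

/-- **Sup bound for mollifications of bounded functions**: if `‖θ y‖ ≤ C` for all `y` and `κ` is
continuous then `‖(θ ⋆ κ)(x)‖ ≤ C ∫ ‖κ‖`. [folklore] -/
theorem norm_convolution_le_of_bound {F' : Type*} [NormedAddCommGroup F'] [NormedSpace ℝ F']
    {θ : UnitAddTorus d → ℝ} {C : ℝ} (hC : ∀ y, ‖θ y‖ ≤ C) {κ : UnitAddTorus d → F'}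
    (hκ : Continuous κ) (x : UnitAddTorus d) : ‖(θ ⋆ κ) x‖ ≤ C * ∫ y, ‖κ y‖ := by
  have hC0 : 0 ≤ C := (norm_nonneg _).trans (hC 0)
  rw [convolution_lsmul, ← integral_sub_left_eq_self (fun y => ‖κ y‖) volume x, ← integral_const_mul]
  refine norm_integral_le_of_norm_le ((hκ.comp (continuous_const.sub continuous_id)).norm
    |>.integrable_unitAddTorus.const_mul C) (Eventually.of_forall fun y => ?_)
  rw [norm_smul]
  exact mul_le_mul (hC y) le_rfl (norm_nonneg _) hC0

/-- Mollifications of a jointly continuous field are continuous in time at each point: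
`s ↦ (H s ⋆ κ)(x)` is continuous. [folklore] -/
theorem continuous_convolution_apply_of_continuous {F' : Type*} [NormedAddCommGroup F']
    [NormedSpace ℝ F'] {H : ℝ → UnitAddTorus d → ℝ} (hH : Continuous (uncurry H))
    {κ : UnitAddTorus d → F'} (hκ : Continuous κ) (x : UnitAddTorus d) :
    Continuous fun s => (H s ⋆ κ) x := by
  have hc : Continuous (uncurry fun (s : ℝ) (y : UnitAddTorus d) => H s y • κ (x - y)) :=
    hH.smul (hκ.comp (continuous_const.sub continuous_snd))
  have h := continuous_parametric_integral_of_continuous hc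
    (isCompact_univ : IsCompact (univ : Set (UnitAddTorus d)))
    (μ := (volume : Measure (UnitAddTorus d)))
  simp only [Measure.restrict_univ] at h
  simpa only [convolution_lsmul] using h

end Glue

/-! ## The space–time mollified field `w = mollifiedField φ ε U` -/

section W

variable {U : ℝ → UnitAddTorus d → EuclideanSpace ℝ d} {φ : ContDiffBump (0 : ℝ)} {ε : ℝ}

omit [Fintype d] in
/-- Coordinates of a strongly measurable space–time vector field are strongly measurable. [folklore] -/
theorem stronglyMeasurable_uncurry_apply [Fintype d] (hUm : StronglyMeasurable (uncurry U)) (i : d) :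
    StronglyMeasurable (uncurry fun s y => U s y i) :=
  (EuclideanSpace.proj i : EuclideanSpace ℝ d →L[ℝ] ℝ).continuous.comp_stronglyMeasurable hUm

/-- **Components of `w` as time averages of the spatially mollified field**:
`wᵢ(t, x) = timeAvgWith ρ (s ↦ Uᵢ s ⋆ k_ε) t x` (time averaging commutes with spatial
mollification). [folklore] -/
theorem mollifiedField_apply_eq_timeAvgWith (hUi : Integrable (uncurry U) (volume.prod volume)) (hε : 0 < ε)
    (hε' : ε ≤ 1 / 4) (t : ℝ) (x : UnitAddTorus d) (i : d) :
    FunctionSpaces.Torus.mollifiedField φ ε U t x i =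
      FunctionSpaces.timeAvgWith (φ.normed volume) (fun s => (fun y => U s y i) ⋆ FunctionSpaces.Torus.kernel ε) t x := by
  rw [FunctionSpaces.Torus.mollifiedField_apply, FunctionSpaces.Torus.timeAvgWith_convolution (FunctionSpaces.Torus.integrable_uncurry_apply hUi i)
    φ.continuous_normed φ.hasCompactSupport_normed (FunctionSpaces.Torus.continuous_kernel hε hε') t]

/-- **Joint smoothness of `w`**: the space–time lift of each coordinate of
`mollifiedField φ ε U` is `C^∞` for `uncurry U ∈ L¹(ℝ × T^d)`; hence so is `stLift w`. [folklore] -/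
theorem contDiff_stLift_mollifiedField (hUi : Integrable (uncurry U) (volume.prod volume)) (hε : 0 < ε)
    (hε' : ε ≤ 1 / 4) : ContDiff ℝ ∞ (FunctionSpaces.Torus.stLift (FunctionSpaces.Torus.mollifiedField φ ε U)) := by
  rw [contDiff_euclidean]
  intro i
  have h := FunctionSpaces.Torus.contDiff_stLift_convolution_timeAvgWith (FunctionSpaces.Torus.integrable_uncurry_apply hUi i)
    (φ.contDiff_normed (μ := volume)) φ.hasCompactSupport_normed hε hε'
  exact h

/-- Slices of `w` are smooth on the torus. [folklore] -/
theorem isSmooth_mollifiedField (hUi : Integrable (uncurry U) (volume.prod volume)) (hε : 0 < ε)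
    (hε' : ε ≤ 1 / 4) (t : ℝ) : FunctionSpaces.Torus.IsSmooth (FunctionSpaces.Torus.mollifiedField φ ε U t) :=
  (FunctionSpaces.Torus.isSmoothSpaceTimeOn_of_contDiff (contDiff_stLift_mollifiedField hUi hε hε') univ).isSmooth_slice
    (mem_univ t)

/-- `w` is jointly continuous on `ℝ × T^d`. [folklore] -/
theorem continuous_uncurry_mollifiedField (hUi : Integrable (uncurry U) (volume.prod volume)) (hε : 0 < ε)
    (hε' : ε ≤ 1 / 4) : Continuous (uncurry (FunctionSpaces.Torus.mollifiedField φ ε U)) :=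
  continuous_uncurry_of_contDiff_stLift (contDiff_stLift_mollifiedField hUi hε hε')

variable [DecidableEq d] in
/-- **Every slice of `w` is divergence free** when `U` is weakly divergence free at a.e. time
(time averages preserve weak incompressibility, and mollification of a weakly divergence-free
field is divergence free). [folklore] -/
theorem isDivFree_mollifiedField (hUi : Integrable (uncurry U) (volume.prod volume))
    (hdiv : ∀ᵐ s, FunctionSpaces.Torus.IsWeaklyDivFree (U s)) (hε : 0 < ε) (hε' : ε ≤ 1 / 4) (t : ℝ) :
    FunctionSpaces.Torus.IsDivFree (FunctionSpaces.Torus.mollifiedField φ ε U t) :=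
  FunctionSpaces.Torus.isDivFree_vecMollify (FunctionSpaces.Torus.integrable_timeAvgVec hUi φ.continuous_normed φ.hasCompactSupport_normed t)
    (FunctionSpaces.Torus.isWeaklyDivFree_timeAvgVec hUi hdiv φ.continuous_normed φ.hasCompactSupport_normed t) hε hε'

/-- **Time support of `w`**: if `U t = 0` off `[0, T₀]` then `w t = 0` for `t + rOut ≤ 0` and for
`T₀ ≤ t - rOut`. [folklore] -/
theorem mollifiedField_eq_zero {T₀ : ℝ} (hU0 : ∀ t, t ∉ Icc 0 T₀ → U t = 0) {t : ℝ}
    (ht : t + φ.rOut ≤ 0 ∨ T₀ ≤ t - φ.rOut) : FunctionSpaces.Torus.mollifiedField φ ε U t = 0 := by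
  have hV : FunctionSpaces.Torus.timeAvgVec (φ.normed volume) U t = 0 := by
    funext y
    ext i
    rw [FunctionSpaces.Torus.timeAvgVec_apply]
    have h := FunctionSpaces.timeAvgWith_eq_zero_of_forall (X := UnitAddTorus d) (F := ℝ)
      (fun s hs => FunctionSpaces.normed_eq_zero_of_rOut_le_abs φ hs) (G := fun s y => U s y i) (a := 0) (b := T₀)
      (fun s hs => by funext y; simp [hU0 s hs]) ht
    rw [h]
    rfl
  unfold FunctionSpaces.Torus.mollifiedField
  rw [hV, FunctionSpaces.Torus.vecMollify_zero]

/-- **Joint strong measurability of parametrised mollifications** (strongly measurable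
version of the tree's `Torus.aestronglyMeasurable_uncurry_convolution`): for
`uncurry θ` strongly measurable on `ℝ × T^d` and a continuous kernel `k`,
`(s, x) ↦ (θ s ⋆ k)(x)` is strongly measurable. [folklore] -/
theorem stronglyMeasurable_uncurry_convolution {F' : Type*} [NormedAddCommGroup F']
    [NormedSpace ℝ F'] {θ : ℝ → UnitAddTorus d → ℝ} (hθ : StronglyMeasurable (uncurry θ))
    {k : UnitAddTorus d → F'} (hk : Continuous k) :
    StronglyMeasurable (uncurry fun s x => (θ s ⋆ k) x) := by
  have hθ' : StronglyMeasurable fun q : (ℝ × UnitAddTorus d) × UnitAddTorus d => θ q.1.1 q.2 :=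
    hθ.comp_measurable (measurable_fst.fst.prodMk measurable_snd)
  have hk' : StronglyMeasurable fun q : (ℝ × UnitAddTorus d) × UnitAddTorus d => k (q.1.2 - q.2) :=
    (hk.comp (continuous_fst.snd.sub continuous_snd)).stronglyMeasurable
  have h1 : StronglyMeasurable fun q : (ℝ × UnitAddTorus d) × UnitAddTorus d =>
      (lsmul ℝ ℝ) (θ q.1.1 q.2) (k (q.1.2 - q.2)) :=
    (lsmul ℝ ℝ : ℝ →L[ℝ] F' →L[ℝ] F').continuous₂.comp_stronglyMeasurable (hθ'.prodMk hk')
  have h2 := h1.integral_prod_right' (ν := (volume : Measure (UnitAddTorus d)))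
  have heq : uncurry (fun s x => (θ s ⋆ k) x) =
      fun p : ℝ × UnitAddTorus d => ∫ y, (lsmul ℝ ℝ) (θ p.1 y) (k (p.2 - y)) := by
    funext p
    simp only [uncurry, convolution_def]
  rw [heq]
  exact h2

/-- **The fibres of the spatially mollified field are integrable in time**: for
`uncurry U` strongly measurable and integrable on `ℝ × T^d`, `s ↦ (Uᵢ s ⋆ k_ε)(x)` is integrable
on `ℝ` for every `x` (dominated by `‖k_ε‖_∞ ‖Uᵢ s‖_{L¹}`). [folklore] -/
theorem integrable_convolution_apply_fibre (hUm : StronglyMeasurable (uncurry U))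
    (hUi : Integrable (uncurry U) (volume.prod volume)) (hε : 0 < ε) (hε' : ε ≤ 1 / 4) (x : UnitAddTorus d) (i : d) :
    Integrable (fun s => ((fun y => U s y i) ⋆ FunctionSpaces.Torus.kernel ε) x) volume := by
  obtain ⟨Ck, hCk⟩ := FunctionSpaces.Torus.exists_forall_norm_le_of_continuous (FunctionSpaces.Torus.continuous_kernel (d := d) hε hε')
  have hUi' := FunctionSpaces.Torus.integrable_uncurry_apply hUi i
  have hmeas : AEStronglyMeasurable (fun s => ((fun y => U s y i) ⋆ FunctionSpaces.Torus.kernel ε) x) volume :=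
    ((stronglyMeasurable_uncurry_convolution (stronglyMeasurable_uncurry_apply hUm i)
      (FunctionSpaces.Torus.continuous_kernel (d := d) hε hε')).comp_measurable
      (measurable_id.prodMk measurable_const)).aestronglyMeasurable
  refine Integrable.mono' ((hUi'.norm.integral_prod_left).const_mul Ck) hmeas ?_
  filter_upwards [hUi'.prod_right_ae] with s hs
  exact FunctionSpaces.Torus.norm_convolution_le hs hCk x

/-- **The time derivative of `w`**: `∂ₜwᵢ(t, x) = timeAvgWith ρ' (s ↦ Uᵢ s ⋆ k_ε) t x`, for
`uncurry U ∈ L¹(ℝ × T^d)` (every fibre `s ↦ (Uᵢ s ⋆ k_ε)(x)` is dominated by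
`‖k_ε‖_∞ ‖Uᵢ s‖_{L¹}`, an integrable function of `s`). [folklore] -/
theorem hasDerivAt_mollifiedField_apply (hUm : StronglyMeasurable (uncurry U))
    (hUi : Integrable (uncurry U) (volume.prod volume)) (hε : 0 < ε) (hε' : ε ≤ 1 / 4) (t : ℝ)
    (x : UnitAddTorus d) (i : d) :
    HasDerivAt (fun τ => FunctionSpaces.Torus.mollifiedField φ ε U τ x i)
      (FunctionSpaces.timeAvgWith (deriv (φ.normed volume)) (fun s => (fun y => U s y i) ⋆ FunctionSpaces.Torus.kernel ε) t x) t := by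
  have hfun : (fun τ => FunctionSpaces.Torus.mollifiedField φ ε U τ x i) =
      fun τ => FunctionSpaces.timeAvgWith (φ.normed volume) (fun s => (fun y => U s y i) ⋆ FunctionSpaces.Torus.kernel ε) τ x :=
    funext fun τ => mollifiedField_apply_eq_timeAvgWith hUi hε hε' τ x i
  rw [hfun]
  refine FunctionSpaces.Torus.hasDerivAt_timeAvgWith (φ.contDiff_normed (μ := volume) (n := 1)) φ.hasCompactSupport_normed ?_ t
  exact (integrable_convolution_apply_fibre hUm hUi hε hε' x i).locallyIntegrable

/-- **The vector time derivative of `w`**: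
`∂ₜw(t, x) = (timeAvgWith ρ' (s ↦ Uᵢ s ⋆ k_ε) t x)ᵢ`. [folklore] -/
theorem hasDerivAt_mollifiedField (hUm : StronglyMeasurable (uncurry U))
    (hUi : Integrable (uncurry U) (volume.prod volume)) (hε : 0 < ε) (hε' : ε ≤ 1 / 4) (t : ℝ) (x : UnitAddTorus d) :
    HasDerivAt (fun τ => FunctionSpaces.Torus.mollifiedField φ ε U τ x)
      (WithLp.toLp 2 fun i =>
        FunctionSpaces.timeAvgWith (deriv (φ.normed volume)) (fun s => (fun y => U s y i) ⋆ FunctionSpaces.Torus.kernel ε) t x) t :=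
  hasDerivAt_of_apply fun i => hasDerivAt_mollifiedField_apply hUm hUi hε hε' t x i

/-- The time derivative of `w` in coordinates. [folklore] -/
theorem timeDeriv_mollifiedField_apply (hUm : StronglyMeasurable (uncurry U))
    (hUi : Integrable (uncurry U) (volume.prod volume)) (hε : 0 < ε) (hε' : ε ≤ 1 / 4) (t : ℝ) (x : UnitAddTorus d)
    (i : d) : FunctionSpaces.Torus.timeDeriv (FunctionSpaces.Torus.mollifiedField φ ε U) t x i =
      FunctionSpaces.timeAvgWith (deriv (φ.normed volume)) (fun s => (fun y => U s y i) ⋆ FunctionSpaces.Torus.kernel ε) t x := by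
  rw [FunctionSpaces.Torus.timeDeriv, (hasDerivAt_mollifiedField hUm hUi hε hε' t x).deriv]

/-- `w` is a space–time test field on `[0, T₀ + rOut + 1)` (smooth lift, compact time support)
when `U` vanishes off `[0, T₀]`; in particular its time derivative has smooth lift. [folklore] -/
theorem isSpaceTimeTest_mollifiedField (hUi : Integrable (uncurry U) (volume.prod volume)) (hε : 0 < ε)
    (hε' : ε ≤ 1 / 4) {T₀ : ℝ} (hU0 : ∀ t, t ∉ Icc 0 T₀ → U t = 0) :
    FunctionSpaces.Torus.IsSpaceTimeTest (T₀ + φ.rOut + 1) (FunctionSpaces.Torus.mollifiedField φ ε U) :=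
  ⟨contDiff_stLift_mollifiedField hUi hε hε', T₀ + φ.rOut, by linarith, fun t ht =>
    mollifiedField_eq_zero hU0 (Or.inr (by linarith))⟩

/-- The time derivative of `w` is jointly continuous. [folklore] -/
theorem continuous_uncurry_timeDeriv_mollifiedField (hUi : Integrable (uncurry U) (volume.prod volume))
    (hε : 0 < ε) (hε' : ε ≤ 1 / 4) {T₀ : ℝ} (hU0 : ∀ t, t ∉ Icc 0 T₀ → U t = 0) :
    Continuous (uncurry (FunctionSpaces.Torus.timeDeriv (FunctionSpaces.Torus.mollifiedField φ ε U))) :=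
  continuous_uncurry_of_contDiff_stLift (isSpaceTimeTest_mollifiedField hUi hε hε' hU0).timeDeriv.1

/-- The time derivative of `w` vanishes off `[-rOut - 1, T₀ + rOut + 1]`. [folklore] -/
theorem timeDeriv_mollifiedField_eq_zero {T₀ : ℝ} (hU0 : ∀ t, t ∉ Icc 0 T₀ → U t = 0) (t : ℝ)
    (ht : t ∉ Icc (-φ.rOut - 1) (T₀ + φ.rOut + 1)) : FunctionSpaces.Torus.timeDeriv (FunctionSpaces.Torus.mollifiedField φ ε U) t = 0 := by
  funext x
  simp only [mem_Icc, not_and_or, not_le] at ht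
  have hev : (fun τ => FunctionSpaces.Torus.mollifiedField φ ε U τ x) =ᶠ[𝓝 t] fun _ => (0 : EuclideanSpace ℝ d) := by
    rcases ht with ht | ht
    · filter_upwards [Iio_mem_nhds (show t < -φ.rOut by linarith)] with τ hτ
      rw [mollifiedField_eq_zero hU0 (Or.inl (by simpa using (le_of_lt (by linarith [mem_Iio.1 hτ] :
        τ + φ.rOut < 0))))]
      rfl
    · filter_upwards [Ioi_mem_nhds (show T₀ + φ.rOut < t by linarith)] with τ hτ
      rw [mollifiedField_eq_zero hU0 (Or.inr (by linarith [mem_Ioi.1 hτ]))]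
      rfl
  change deriv (fun τ => FunctionSpaces.Torus.mollifiedField φ ε U τ x) t = 0
  rw [hev.deriv_eq, deriv_const]

end W

/-! ## The test field `ψ = cetTestField φ ε η U` -/

section Psi

variable {U : ℝ → UnitAddTorus d → EuclideanSpace ℝ d} {φ : ContDiffBump (0 : ℝ)} {ε : ℝ}
  {η : ℝ → ℝ} {T₀ : ℝ}

/-- The cut-off field `(s, y) ↦ η(s) wᵢ(s, y)` is jointly continuous. [folklore] -/
theorem continuous_uncurry_eta_mul (hUi : Integrable (uncurry U) (volume.prod volume)) (hε : 0 < ε)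
    (hε' : ε ≤ 1 / 4) (hη : Continuous η) (i : d) :
    Continuous (uncurry fun s y => η s * FunctionSpaces.Torus.mollifiedField φ ε U s y i) :=
  (hη.comp continuous_fst).mul
    ((EuclideanSpace.proj i : EuclideanSpace ℝ d →L[ℝ] ℝ).continuous.comp
      (continuous_uncurry_mollifiedField hUi hε hε'))

/-- The cut-off field `η wᵢ` vanishes off the time support `[a, b]` of `η`. [folklore] -/
theorem eta_mul_eq_zero {a b : ℝ} (hη0 : ∀ s, s ∉ Icc a b → η s = 0) (i : d) :
    ∀ s, s ∉ Icc a b → (fun y => η s * FunctionSpaces.Torus.mollifiedField φ ε U s y i) = 0 := fun s hs => by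
  funext y
  simp [hη0 s hs]

/-- **The cut-off field `η wᵢ` is bounded.** [folklore] -/
theorem exists_bound_eta_mul (hUi : Integrable (uncurry U) (volume.prod volume)) (hε : 0 < ε) (hε' : ε ≤ 1 / 4)
    (hη : Continuous η) {a b : ℝ} (hη0 : ∀ s, s ∉ Icc a b → η s = 0) (i : d) :
    ∃ C, 0 ≤ C ∧ ∀ s y, ‖η s * FunctionSpaces.Torus.mollifiedField φ ε U s y i‖ ≤ C :=
  exists_forall_norm_le_of_tsupport (continuous_uncurry_eta_mul hUi hε hε' hη i) (eta_mul_eq_zero hη0 i)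

/-- **The cut-off field `η wᵢ` is integrable on `ℝ × T^d`** (bounded, jointly continuous,
compactly supported in time). [folklore] -/
theorem integrable_uncurry_eta_mul (hUi : Integrable (uncurry U) (volume.prod volume)) (hε : 0 < ε)
    (hε' : ε ≤ 1 / 4) (hη : Continuous η) {a b : ℝ} (hη0 : ∀ s, s ∉ Icc a b → η s = 0) (i : d) :
    Integrable (uncurry fun s y => η s * FunctionSpaces.Torus.mollifiedField φ ε U s y i) (volume.prod volume) :=
  integrable_uncurry_of_tsupport (continuous_uncurry_eta_mul hUi hε hε' hη i) (eta_mul_eq_zero hη0 i)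

/-- The vector cut-off field `η • w` is jointly continuous. [folklore] -/
theorem continuous_uncurry_eta_smul (hUi : Integrable (uncurry U) (volume.prod volume)) (hε : 0 < ε)
    (hε' : ε ≤ 1 / 4) (hη : Continuous η) :
    Continuous (uncurry fun s y => η s • FunctionSpaces.Torus.mollifiedField φ ε U s y) :=
  (hη.comp continuous_fst).smul (continuous_uncurry_mollifiedField hUi hε hε')

/-- The vector cut-off field `η • w` is integrable on `ℝ × T^d`. [folklore] -/
theorem integrable_uncurry_eta_smul (hUi : Integrable (uncurry U) (volume.prod volume)) (hε : 0 < ε)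
    (hε' : ε ≤ 1 / 4) (hη : Continuous η) {a b : ℝ} (hη0 : ∀ s, s ∉ Icc a b → η s = 0) :
    Integrable (uncurry fun s y => η s • FunctionSpaces.Torus.mollifiedField φ ε U s y) (volume.prod volume) :=
  integrable_uncurry_of_tsupport (a := a) (b := b) (continuous_uncurry_eta_smul hUi hε hε' hη)
    fun s hs => by
      funext y
      simp [hη0 s hs]

/-- **Joint smoothness of the test field**: `stLift (cetTestField φ ε η U)` is `C^∞`. [folklore] -/
theorem contDiff_stLift_cetTestField (hUi : Integrable (uncurry U) (volume.prod volume)) (hε : 0 < ε)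
    (hε' : ε ≤ 1 / 4) (hη : Continuous η) {a b : ℝ} (hη0 : ∀ s, s ∉ Icc a b → η s = 0) :
    ContDiff ℝ ∞ (FunctionSpaces.Torus.stLift (FunctionSpaces.Torus.cetTestField φ ε η U)) := by
  rw [contDiff_euclidean]
  intro i
  have hfun : (fun p : ℝ × EuclideanSpace ℝ d => (FunctionSpaces.Torus.stLift (FunctionSpaces.Torus.cetTestField φ ε η U) p) i) =
      FunctionSpaces.Torus.stLift (fun t => (FunctionSpaces.timeAvgWith (φ.normed volume)
        (fun s y => η s * FunctionSpaces.Torus.mollifiedField φ ε U s y i) t) ⋆ FunctionSpaces.Torus.kernel ε) := by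
    funext p
    obtain ⟨t, v⟩ := p
    rw [FunctionSpaces.Torus.stLift_apply, FunctionSpaces.Torus.stLift_apply, FunctionSpaces.Torus.cetTestField_apply]
  rw [hfun]
  exact FunctionSpaces.Torus.contDiff_stLift_convolution_timeAvgWith (integrable_uncurry_eta_mul hUi hε hε' hη hη0 i)
    (φ.contDiff_normed (μ := volume)) φ.hasCompactSupport_normed hε hε'

/-- Slices of the test field are smooth. [folklore] -/
theorem isSmooth_cetTestField (hUi : Integrable (uncurry U) (volume.prod volume)) (hε : 0 < ε)
    (hε' : ε ≤ 1 / 4) (hη : Continuous η) {a b : ℝ} (hη0 : ∀ s, s ∉ Icc a b → η s = 0) (t : ℝ) :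
    FunctionSpaces.Torus.IsSmooth (FunctionSpaces.Torus.cetTestField φ ε η U t) :=
  (FunctionSpaces.Torus.isSmoothSpaceTimeOn_of_contDiff (contDiff_stLift_cetTestField hUi hε hε' hη hη0) univ).isSmooth_slice
    (mem_univ t)

/-- **Time support of the test field**: with `η` vanishing off `[a, b]`, `ψ t = 0` for
`t + rOut ≤ a` and for `b ≤ t - rOut`. [folklore] -/
theorem cetTestField_eq_zero {a b : ℝ} (hη0 : ∀ s, s ∉ Icc a b → η s = 0) {t : ℝ}
    (ht : t + φ.rOut ≤ a ∨ b ≤ t - φ.rOut) : FunctionSpaces.Torus.cetTestField φ ε η U t = 0 := by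
  have hV : FunctionSpaces.Torus.timeAvgVec (φ.normed volume) (fun s y => η s • FunctionSpaces.Torus.mollifiedField φ ε U s y) t = 0 := by
    funext y
    ext i
    rw [FunctionSpaces.Torus.timeAvgVec_apply]
    have h := FunctionSpaces.timeAvgWith_eq_zero_of_forall (X := UnitAddTorus d) (F := ℝ)
      (fun s hs => FunctionSpaces.normed_eq_zero_of_rOut_le_abs φ hs)
      (G := fun s y => (η s • FunctionSpaces.Torus.mollifiedField φ ε U s y) i) (a := a) (b := b)
      (fun s hs => by funext y; simp [hη0 s hs]) ht
    rw [h]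
    rfl
  unfold FunctionSpaces.Torus.cetTestField
  rw [hV, FunctionSpaces.Torus.vecMollify_zero]

/-- **The test field is an admissible space–time test field on `(0, T₀)`**: if `η` vanishes off
`[a, b]` with `rOut < a` and `b + rOut < T₀`, then
`Torus.IsSpaceTimeTestIoo T₀ (cetTestField φ ε η U)`. [folklore] -/
theorem isSpaceTimeTestIoo_cetTestField (hUi : Integrable (uncurry U) (volume.prod volume)) (hε : 0 < ε)
    (hε' : ε ≤ 1 / 4) (hη : Continuous η) {a b : ℝ} (hη0 : ∀ s, s ∉ Icc a b → η s = 0)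
    (ha : φ.rOut < a) (hb : b + φ.rOut < T₀) :
    FunctionSpaces.Torus.IsSpaceTimeTestIoo T₀ (FunctionSpaces.Torus.cetTestField φ ε η U) := by
  refine ⟨⟨contDiff_stLift_cetTestField hUi hε hε' hη hη0, b + φ.rOut, hb, fun t ht => ?_⟩,
    a - φ.rOut, by linarith, fun t ht => ?_⟩
  · exact cetTestField_eq_zero hη0 (Or.inr (by linarith))
  · exact cetTestField_eq_zero hη0 (Or.inl (by linarith))

variable [DecidableEq d] in
/-- **The test field is divergence free at every time** (its slices are mollifications of the
time averages of the divergence-free smooth fields `η(s) w(s)`), given the integration-by-parts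
identity on the torus for the passage from classical to weak incompressibility. [folklore] -/
theorem isDivFreeTest_cetTestField (hUi : Integrable (uncurry U) (volume.prod volume))
    (hdiv : ∀ᵐ s, FunctionSpaces.Torus.IsWeaklyDivFree (U s)) (hε : 0 < ε) (hε' : ε ≤ 1 / 4) (hη : Continuous η)
    {a b : ℝ} (hη0 : ∀ s, s ∉ Icc a b → η s = 0) :
    FunctionSpaces.Torus.IsDivFreeTest (FunctionSpaces.Torus.cetTestField φ ε η U) := by
  intro t
  have hGi := integrable_uncurry_eta_smul (φ := φ) hUi hε hε' hη hη0
  have hGdiv : ∀ᵐ s ∂(volume : Measure ℝ), FunctionSpaces.Torus.IsWeaklyDivFree (fun y => η s • FunctionSpaces.Torus.mollifiedField φ ε U s y) :=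
    Eventually.of_forall fun s =>
      FunctionSpaces.Torus.IsDivFree.isWeaklyDivFree FunctionSpaces.Torus.integral_inner_gradient_eq_neg_integral_mul_divergence_holds
        ((isSmooth_mollifiedField hUi hε hε' s).smul (η s))
        ((isDivFree_mollifiedField hUi hdiv hε hε' s).const_smul (isSmooth_mollifiedField hUi hε hε' s)
          (η s))
  exact FunctionSpaces.Torus.isDivFree_vecMollify
    (FunctionSpaces.Torus.integrable_timeAvgVec hGi φ.continuous_normed φ.hasCompactSupport_normed t)
    (FunctionSpaces.Torus.isWeaklyDivFree_timeAvgVec hGi hGdiv φ.continuous_normed φ.hasCompactSupport_normed t) hε hε'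

/-- **Components of `ψ` as time averages of spatial mollifications**:
`ψᵢ(t, x) = timeAvgWith ρ (s ↦ (η wᵢ)(s) ⋆ k_ε) t x`. [folklore] -/
theorem cetTestField_apply_eq_timeAvgWith (hUi : Integrable (uncurry U) (volume.prod volume)) (hε : 0 < ε)
    (hε' : ε ≤ 1 / 4) (hη : Continuous η) {a b : ℝ} (hη0 : ∀ s, s ∉ Icc a b → η s = 0) (t : ℝ)
    (x : UnitAddTorus d) (i : d) :
    FunctionSpaces.Torus.cetTestField φ ε η U t x i = FunctionSpaces.timeAvgWith (φ.normed volume)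
      (fun s => (fun y => η s * FunctionSpaces.Torus.mollifiedField φ ε U s y i) ⋆ FunctionSpaces.Torus.kernel ε) t x := by
  rw [FunctionSpaces.Torus.cetTestField_apply, FunctionSpaces.Torus.timeAvgWith_convolution (integrable_uncurry_eta_mul hUi hε hε' hη hη0 i)
    φ.continuous_normed φ.hasCompactSupport_normed (FunctionSpaces.Torus.continuous_kernel hε hε') t]

/-- **The time derivative of the test field**, coordinatewise:
`∂ₜψᵢ(t, x) = timeAvgWith ρ' (s ↦ (η wᵢ)(s) ⋆ k_ε) t x`. [folklore] -/
theorem hasDerivAt_cetTestField_apply (hUi : Integrable (uncurry U) (volume.prod volume)) (hε : 0 < ε)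
    (hε' : ε ≤ 1 / 4) (hη : Continuous η) {a b : ℝ} (hη0 : ∀ s, s ∉ Icc a b → η s = 0) (t : ℝ)
    (x : UnitAddTorus d) (i : d) :
    HasDerivAt (fun τ => FunctionSpaces.Torus.cetTestField φ ε η U τ x i)
      (FunctionSpaces.timeAvgWith (deriv (φ.normed volume))
        (fun s => (fun y => η s * FunctionSpaces.Torus.mollifiedField φ ε U s y i) ⋆ FunctionSpaces.Torus.kernel ε) t x) t := by
  have hfun : (fun τ => FunctionSpaces.Torus.cetTestField φ ε η U τ x i) = fun τ => FunctionSpaces.timeAvgWith (φ.normed volume)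
      (fun s => (fun y => η s * FunctionSpaces.Torus.mollifiedField φ ε U s y i) ⋆ FunctionSpaces.Torus.kernel ε) τ x :=
    funext fun τ => cetTestField_apply_eq_timeAvgWith hUi hε hε' hη hη0 τ x i
  rw [hfun]
  exact FunctionSpaces.Torus.hasDerivAt_timeAvgWith (φ.contDiff_normed (μ := volume) (n := 1)) φ.hasCompactSupport_normed
    ((continuous_convolution_apply_of_continuous (continuous_uncurry_eta_mul hUi hε hε' hη i)
      (FunctionSpaces.Torus.continuous_kernel hε hε') x).locallyIntegrable) t

/-- The time derivative of the test field in coordinates. [folklore] -/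
theorem timeDeriv_cetTestField_apply (hUi : Integrable (uncurry U) (volume.prod volume)) (hε : 0 < ε)
    (hε' : ε ≤ 1 / 4) (hη : Continuous η) {a b : ℝ} (hη0 : ∀ s, s ∉ Icc a b → η s = 0) (t : ℝ)
    (x : UnitAddTorus d) (i : d) :
    FunctionSpaces.Torus.timeDeriv (FunctionSpaces.Torus.cetTestField φ ε η U) t x i = FunctionSpaces.timeAvgWith (deriv (φ.normed volume))
      (fun s => (fun y => η s * FunctionSpaces.Torus.mollifiedField φ ε U s y i) ⋆ FunctionSpaces.Torus.kernel ε) t x := by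
  have h := hasDerivAt_of_apply fun i => hasDerivAt_cetTestField_apply (φ := φ) hUi hε hε' hη hη0 t x i
  rw [FunctionSpaces.Torus.timeDeriv, h.deriv]

variable [DecidableEq d] in
/-- **Space derivatives of the test field**, coordinatewise:
`∂ⱼψᵢ(t, x) = timeAvgWith ρ (s ↦ (η wᵢ)(s) ⋆ ∂ⱼk_ε) t x`. [folklore] -/
theorem partialDeriv_cetTestField_apply (hUi : Integrable (uncurry U) (volume.prod volume)) (hε : 0 < ε)
    (hε' : ε ≤ 1 / 4) (hη : Continuous η) {a b : ℝ} (hη0 : ∀ s, s ∉ Icc a b → η s = 0) (t : ℝ)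
    (x : UnitAddTorus d) (i j : d) :
    FunctionSpaces.Torus.partialDeriv j (fun y => FunctionSpaces.Torus.cetTestField φ ε η U t y i) x = FunctionSpaces.timeAvgWith (φ.normed volume)
      (fun s => (fun y => η s * FunctionSpaces.Torus.mollifiedField φ ε U s y i) ⋆ FunctionSpaces.Torus.partialDeriv j (FunctionSpaces.Torus.kernel ε)) t x := by
  have hfun : (fun y => FunctionSpaces.Torus.cetTestField φ ε η U t y i) = (FunctionSpaces.timeAvgWith (φ.normed volume)
      (fun s y => η s * FunctionSpaces.Torus.mollifiedField φ ε U s y i) t) ⋆ FunctionSpaces.Torus.kernel ε :=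
    funext fun y => FunctionSpaces.Torus.cetTestField_apply φ ε η U t y i
  rw [hfun, FunctionSpaces.Torus.partialDeriv_convolution_timeAvgWith (integrable_uncurry_eta_mul hUi hε hε' hη hη0 i)
    φ.continuous_normed φ.hasCompactSupport_normed (FunctionSpaces.Torus.isSmooth_kernel hε hε') t j]

/-- **Uniform bound for the time derivative of the test field.** [folklore] -/
theorem exists_bound_timeDeriv_cetTestField (hUi : Integrable (uncurry U) (volume.prod volume)) (hε : 0 < ε)
    (hε' : ε ≤ 1 / 4) (hη : Continuous η) {a b : ℝ} (hη0 : ∀ s, s ∉ Icc a b → η s = 0) (i : d) :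
    ∃ C, ∀ t x, ‖FunctionSpaces.Torus.timeDeriv (FunctionSpaces.Torus.cetTestField φ ε η U) t x i‖ ≤ C := by
  obtain ⟨Cg, -, hCg⟩ := exists_bound_eta_mul hUi hε hε' hη hη0 i
  refine ⟨(∫ s, ‖deriv (φ.normed volume) s‖) * (Cg * ∫ y, ‖FunctionSpaces.Torus.kernel (d := d) ε y‖), fun t x => ?_⟩
  rw [timeDeriv_cetTestField_apply hUi hε hε' hη hη0]
  exact norm_timeAvgWith_le (((φ.contDiff_normed (μ := volume) (n := 1)).continuous_deriv le_rfl
    ).integrable_of_hasCompactSupport φ.hasCompactSupport_normed.deriv)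
    (fun s y => norm_convolution_le_of_bound (hCg s) (FunctionSpaces.Torus.continuous_kernel hε hε') y) t x

variable [DecidableEq d] in
/-- **Uniform bound for the space derivatives of the test field.** [folklore] -/
theorem exists_bound_partialDeriv_cetTestField (hUi : Integrable (uncurry U) (volume.prod volume)) (hε : 0 < ε)
    (hε' : ε ≤ 1 / 4) (hη : Continuous η) {a b : ℝ} (hη0 : ∀ s, s ∉ Icc a b → η s = 0) (i j : d) :
    ∃ C, ∀ t x, ‖FunctionSpaces.Torus.partialDeriv j (fun y => FunctionSpaces.Torus.cetTestField φ ε η U t y i) x‖ ≤ C := by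
  obtain ⟨Cg, -, hCg⟩ := exists_bound_eta_mul hUi hε hε' hη hη0 i
  refine ⟨(∫ s, ‖φ.normed volume s‖) * (Cg * ∫ y, ‖FunctionSpaces.Torus.partialDeriv j (FunctionSpaces.Torus.kernel (d := d) ε) y‖),
    fun t x => ?_⟩
  rw [partialDeriv_cetTestField_apply hUi hε hε' hη hη0]
  exact norm_timeAvgWith_le (φ.integrable_normed)
    (fun s y => norm_convolution_le_of_bound (hCg s)
      ((FunctionSpaces.Torus.isSmooth_kernel hε hε').partialDeriv j).continuous y) t x

end Psi




end Torus

end Literature.Analysis.FluidPDE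

/-! ## Part 2. The mollified energy balance of a weak Euler solution (time-regularised)

(Constantin–E–Titi 1994, p. 209: from the weak
formulation (1) to
`∫|u^ε(t)|² - ∫|u^ε(0)|² = 2∫₀ᵗ∫ Tr((u⊗u)^ε ∇u^ε)`, here in the distributional-in-time form
appropriate for `L²_{t,x}` weak solutions and with the "straightforward" time mollification
carried out).

Let `U : ℝ → T^d → ℝ^d` be strongly measurable and square integrable on `ℝ × T^d`, vanishing off
the time interval `(0, T₀)`, weakly divergence free at a.e. time, and satisfying the pressure-free
weak Euler identity against every admissible divergence-free test field (the data of
`Torus.IsWeakNSSolutionOn T₀ 0`, transported to a strongly measurable representative). For the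
space–time mollification `w = Torus.mollifiedField φ ε U` (time bump `ρ`, space kernel `k_ε`) and
a smooth cut-off `η` supported in `(0, T₀)` we test the weak identity with
`ψ = Torus.cetTestField φ ε η U` (Part 1) and move the mollifiers onto `U`
(`TorusSpaceTimeAdjoint`):

* `Torus.integral_inner_timeDeriv_cetTestField` — the time-derivative pairing:
  `∫∫ ⟪U, ∂ₜψ⟫ = ½ ∫ η'(s) ‖w(s)‖²_{L²} ds`;
* `Torus.integral_inner_convect_cetTestField` — the nonlinear pairing:
  `∫∫ ⟪U, (U·∇)ψ⟫ = ∑ᵢⱼ ∫∫ η 𝒯ᵢⱼ ∂ⱼwᵢ` with `𝒯ᵢⱼ(s) = (ρ ⋆ₜ (UᵢUⱼ))(s) ⋆ k_ε`, the space–time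
  mollified momentum flux;
* `Torus.mollified_energy_balance` — **the mollified energy balance**:
  `½ ∫ η' ‖w‖²_{L²} + ∑ᵢⱼ ∫∫ η 𝒯ᵢⱼ ∂ⱼwᵢ = 0`.
-/

namespace Literature.Analysis.FluidPDE

namespace Torus

variable {d : Type*} [Fintype d] [DecidableEq d]

/-! ## Small algebra of time averages and mollifications -/

section Algebra

omit [DecidableEq d]

/-- Time averaging against `-r` is minus time averaging against `r`. [folklore] -/
theorem timeAvgWith_neg_kernel {X : Type*} {F' : Type*} [NormedAddCommGroup F'] [NormedSpace ℝ F']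
    (r : ℝ → ℝ) (H : ℝ → X → F') (t : ℝ) (x : X) :
    FunctionSpaces.timeAvgWith (fun σ => -r σ) H t x = -FunctionSpaces.timeAvgWith r H t x := by
  simp only [FunctionSpaces.timeAvgWith_apply, neg_smul, integral_neg]

/-- Time averaging of `-H` is minus time averaging of `H`. [folklore] -/
theorem timeAvgWith_neg_field {X : Type*} {F' : Type*} [NormedAddCommGroup F'] [NormedSpace ℝ F']
    (r : ℝ → ℝ) (H : ℝ → X → F') (t : ℝ) (x : X) :
    FunctionSpaces.timeAvgWith r (fun s y => -H s y) t x = -FunctionSpaces.timeAvgWith r H t x := by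
  simp only [FunctionSpaces.timeAvgWith_apply, smul_neg, integral_neg]

/-- Mollification by `-κ` is minus mollification by `κ`. [folklore] -/
theorem convolution_neg_right' {F' : Type*} [NormedAddCommGroup F'] [NormedSpace ℝ F']
    (θ : UnitAddTorus d → ℝ) (κ : UnitAddTorus d → F') (x : UnitAddTorus d) :
    (θ ⋆ fun z => -κ z) x = -(θ ⋆ κ) x := by
  simp only [convolution_lsmul, smul_neg, integral_neg]

/-- **Sup bound for time averages of time-integrable fibres**: if `|r| ≤ Cr` and
`t ↦ H t y` is integrable then `‖timeAvgWith r H s y‖ ≤ Cr ∫ ‖H t y‖ dt`. [folklore] -/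
theorem norm_timeAvgWith_le_of_integrable {X : Type*} {F' : Type*} [NormedAddCommGroup F']
    [NormedSpace ℝ F'] {r : ℝ → ℝ} {Cr : ℝ} (hr : ∀ s, ‖r s‖ ≤ Cr) {H : ℝ → X → F'} {y : X}
    (hH : Integrable (fun t => H t y) volume) (s : ℝ) :
    ‖FunctionSpaces.timeAvgWith r H s y‖ ≤ Cr * ∫ t, ‖H t y‖ := by
  have hCr : 0 ≤ Cr := (norm_nonneg _).trans (hr 0)
  rw [FunctionSpaces.timeAvgWith_eq_integral_sub, ← integral_const_mul]
  refine norm_integral_le_of_norm_le (hH.norm.const_mul Cr) (Eventually.of_forall fun t => ?_)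
  rw [norm_smul]
  exact mul_le_mul_of_nonneg_right (hr _) (norm_nonneg _)

end Algebra

/-! ## The time-derivative pairing -/

section TimePairing

variable {U : ℝ → UnitAddTorus d → EuclideanSpace ℝ d} {φ : ContDiffBump (0 : ℝ)} {ε : ℝ}
  {η : ℝ → ℝ} {T₀ : ℝ}

omit [DecidableEq d] in
/-- **The energy of the mollified field is differentiable in time** with
`d/ds ∫ ‖w(s, y)‖² dy = 2 ∫ ⟪w(s, y), ∂ₜw(s, y)⟫ dy` (differentiation under the integral over the
compact torus for the jointly smooth field `w`). [folklore] -/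
theorem hasDerivAt_integral_norm_sq_mollifiedField (hUi : Integrable (uncurry U) (volume.prod volume)) (hε : 0 < ε)
    (hε' : ε ≤ 1 / 4) (s : ℝ) :
    HasDerivAt (fun τ => ∫ y, ‖FunctionSpaces.Torus.mollifiedField φ ε U τ y‖ ^ 2)
      (∫ y, 2 * ⟪FunctionSpaces.Torus.mollifiedField φ ε U s y, FunctionSpaces.Torus.timeDeriv (FunctionSpaces.Torus.mollifiedField φ ε U) s y⟫_ℝ) s := by
  set w := FunctionSpaces.Torus.mollifiedField φ ε U with hw
  have hws : FunctionSpaces.Torus.IsSmoothSpaceTimeOn univ w :=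
    FunctionSpaces.Torus.isSmoothSpaceTimeOn_of_contDiff (contDiff_stLift_mollifiedField hUi hε hε') univ
  have hF : FunctionSpaces.Torus.IsSmoothSpaceTimeOn univ (fun τ y => ⟪w τ y, w τ y⟫_ℝ) := hws.inner hws
  have h := hF.hasDerivWithinAt_integral convex_univ (mem_univ s)
  have h' : HasDerivAt (fun τ => ∫ y, ⟪w τ y, w τ y⟫_ℝ)
      (∫ y, FunctionSpaces.Torus.timeDerivWithin univ (fun τ y => ⟪w τ y, w τ y⟫_ℝ) s y) s :=
    h.hasDerivAt univ_mem
  have hfun : (fun τ => ∫ y, ‖w τ y‖ ^ 2) = fun τ => ∫ y, ⟪w τ y, w τ y⟫_ℝ := by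
    funext τ
    simp_rw [real_inner_self_eq_norm_sq]
  rw [hfun]
  have hint : (fun y => FunctionSpaces.Torus.timeDerivWithin univ (fun τ y => ⟪w τ y, w τ y⟫_ℝ) s y) =
      fun y => 2 * ⟪w s y, FunctionSpaces.Torus.timeDeriv w s y⟫_ℝ := by
    funext y
    -- the slice derivative
    have hd : HasDerivAt (fun τ => w τ y) (FunctionSpaces.Torus.timeDeriv w s y) s := by
      have hdiff : DifferentiableAt ℝ (fun τ => w τ y) s := by
        obtain ⟨v, rfl⟩ := FunctionSpaces.Torus.proj_surjective y
        have hc : (fun τ => w τ (FunctionSpaces.Torus.proj v)) = FunctionSpaces.Torus.stLift w ∘ fun τ : ℝ => (τ, v) := by funext τ; rfl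
        rw [hc]
        exact (((contDiff_stLift_mollifiedField hUi hε hε').differentiable (by simp)).differentiableAt).comp
          s (differentiableAt_id.prodMk (differentiableAt_const _))
      exact hdiff.hasDerivAt
    change derivWithin (fun τ => ⟪w τ y, w τ y⟫_ℝ) univ s = 2 * ⟪w s y, FunctionSpaces.Torus.timeDeriv w s y⟫_ℝ
    rw [derivWithin_univ, (hd.inner ℝ hd).deriv, real_inner_comm]
    ring
  rw [hint] at h'
  exact h'

omit [DecidableEq d] in
/-- The test field is a space–time test field on `[0, b + rOut + 2)` (smooth lift and time
support), for `η` vanishing off `[a, b]`; used to differentiate it in time. [folklore] -/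
theorem isSpaceTimeTest_cetTestField (hUi : Integrable (uncurry U) (volume.prod volume)) (hε : 0 < ε)
    (hε' : ε ≤ 1 / 4) (hη : Continuous η) {a b : ℝ} (hη0 : ∀ s, s ∉ Icc a b → η s = 0) :
    FunctionSpaces.Torus.IsSpaceTimeTest (b + φ.rOut + 2) (FunctionSpaces.Torus.cetTestField φ ε η U) :=
  ⟨contDiff_stLift_cetTestField hUi hε hε' hη hη0, b + φ.rOut + 1, by linarith, fun t ht =>
    cetTestField_eq_zero hη0 (Or.inr (by linarith))⟩

omit [DecidableEq d] in
/-- A continuous function that is eventually zero at `±∞` (vanishing off `[a, b]`) tends to `0`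
at `±∞`. [folklore] -/
theorem tendsto_zero_of_eq_zero_off {f : ℝ → ℝ} {a b : ℝ} (hf : ∀ s, s ∉ Icc a b → f s = 0) :
    Tendsto f atBot (𝓝 0) ∧ Tendsto f atTop (𝓝 0) := by
  constructor
  · refine tendsto_const_nhds.congr' ?_
    filter_upwards [eventually_lt_atBot a] with s hs
    exact (hf s fun h => (not_le.2 hs) h.1).symm
  · refine tendsto_const_nhds.congr' ?_
    filter_upwards [eventually_gt_atTop b] with s hs
    exact (hf s fun h => (not_le.2 hs) h.2).symm

omit [DecidableEq d] in
/-- **The time-derivative pairing** (Constantin–E–Titi 1994, p. 209, left-hand side of the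
mollified balance, time-regularised): testing with `ψ = cetTestField φ ε η U`,
`∫∫ ⟪U, ∂ₜψ⟫ = ½ ∫ η'(s) ‖w(s)‖²_{L²(T^d)} ds`, `w = mollifiedField φ ε U`. The mollifiers are moved
onto `U` by space–time adjointness (the time kernel `ρ'` is odd, the space kernel even), which
turns `∂ₜψ` into `-η ∂ₜw`; then `⟪w, ∂ₜw⟫ = ½ ∂ₜ‖w‖²` is integrated over the torus and by parts in
time. [cite: ConstantinETiti1994, p. 209] -/
theorem integral_inner_timeDeriv_cetTestField (hUm : StronglyMeasurable (uncurry U))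
    (hUi : Integrable (uncurry U) (volume.prod volume)) (hε : 0 < ε) (hε' : ε ≤ 1 / 4)
    (hU0 : ∀ t, t ∉ Icc 0 T₀ → U t = 0) (hη : ContDiff ℝ ∞ η) {a b : ℝ}
    (hη0 : ∀ s, s ∉ Icc a b → η s = 0) :
    ∫ p : ℝ × UnitAddTorus d, ⟪U p.1 p.2, FunctionSpaces.Torus.timeDeriv (FunctionSpaces.Torus.cetTestField φ ε η U) p.1 p.2⟫_ℝ ∂(volume.prod volume) =
      (1 / 2) * ∫ s, deriv η s * ∫ y, ‖FunctionSpaces.Torus.mollifiedField φ ε U s y‖ ^ 2 := by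
  set w := FunctionSpaces.Torus.mollifiedField φ ε U with hw
  set ψ := FunctionSpaces.Torus.cetTestField φ ε η U with hψ
  have hηc : Continuous η := hη.continuous
  -- the kernels
  have hρ1 : ContDiff ℝ 1 (φ.normed volume) := φ.contDiff_normed (μ := volume) (n := 1)
  have hρ'c : Continuous (deriv (φ.normed volume)) := hρ1.continuous_deriv le_rfl
  have hρ'cs : HasCompactSupport (deriv (φ.normed volume)) := φ.hasCompactSupport_normed.deriv
  have hk : Continuous (FunctionSpaces.Torus.kernel (d := d) ε) := FunctionSpaces.Torus.continuous_kernel hε hε'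
  -- continuity of `w`, `∂ₜw`, `∂ₜψ`
  have hwc : Continuous (uncurry w) := continuous_uncurry_mollifiedField hUi hε hε'
  have hdwc : Continuous (uncurry (FunctionSpaces.Torus.timeDeriv w)) :=
    continuous_uncurry_timeDeriv_mollifiedField hUi hε hε' hU0
  have hdψc : Continuous (uncurry (FunctionSpaces.Torus.timeDeriv ψ)) :=
    continuous_uncurry_of_contDiff_stLift (isSpaceTimeTest_cetTestField hUi hε hε' hηc hη0).timeDeriv.1
  -- Step 1: expand the inner product in coordinates and split the integral
  have hcoord : ∀ p : ℝ × UnitAddTorus d, ⟪U p.1 p.2, FunctionSpaces.Torus.timeDeriv ψ p.1 p.2⟫_ℝ =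
      ∑ i, U p.1 p.2 i * FunctionSpaces.Torus.timeDeriv ψ p.1 p.2 i := fun p => by
    simp [PiLp.inner_apply, mul_comm]
  have hAi : ∀ i, Integrable (fun p : ℝ × UnitAddTorus d => U p.1 p.2 i * FunctionSpaces.Torus.timeDeriv ψ p.1 p.2 i) (volume.prod volume) := by
    intro i
    obtain ⟨C, hC⟩ := exists_bound_timeDeriv_cetTestField (φ := φ) hUi hε hε' hηc hη0 i
    exact (hUi.eval_piLp i).mul_bdd
      (((EuclideanSpace.proj i : EuclideanSpace ℝ d →L[ℝ] ℝ).continuous.comp hdψc).aestronglyMeasurable)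
      (Eventually.of_forall fun p => hC p.1 p.2)
  simp_rw [hcoord]
  rw [integral_finsetSum _ fun i _ => hAi i]
  -- Step 2: move the mollifiers onto `U`, coordinate by coordinate
  have hstep : ∀ i, ∫ p : ℝ × UnitAddTorus d, U p.1 p.2 i * FunctionSpaces.Torus.timeDeriv ψ p.1 p.2 i ∂(volume.prod volume) =
      -∫ q : ℝ × UnitAddTorus d, η q.1 * (w q.1 q.2 i * FunctionSpaces.Torus.timeDeriv w q.1 q.2 i) ∂(volume.prod volume) := by
    intro i
    obtain ⟨Cg, -, hCg⟩ := exists_bound_eta_mul hUi hε hε' hηc hη0 i (φ := φ)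
    have hGm : AEStronglyMeasurable (uncurry fun s y => η s * w s y i) (volume.prod volume) :=
      (continuous_uncurry_eta_mul hUi hε hε' hηc i).aestronglyMeasurable
    have hform : (fun p : ℝ × UnitAddTorus d => U p.1 p.2 i * FunctionSpaces.Torus.timeDeriv ψ p.1 p.2 i) =
        fun p => U p.1 p.2 i * FunctionSpaces.timeAvgWith (deriv (φ.normed volume))
          (fun s => (fun y => η s * w s y i) ⋆ FunctionSpaces.Torus.kernel ε) p.1 p.2 := by
      funext p
      rw [timeDeriv_cetTestField_apply hUi hε hε' hηc hη0]
    have hUii : Integrable (uncurry fun s y => U s y i) (volume.prod volume) := hUi.eval_piLp i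
    rw [hform, FunctionSpaces.Torus.integral_mul_timeAvgWith_convolution hUii hGm hCg hρ'c hρ'cs hk,
      ← integral_neg]
    refine integral_congr_ae (Eventually.of_forall fun q => ?_)
    dsimp only
    have hk' : (fun z : UnitAddTorus d => FunctionSpaces.Torus.kernel ε (-z)) = FunctionSpaces.Torus.kernel ε := funext (FunctionSpaces.Torus.kernel_neg hε hε')
    have hρ'' : (fun σ => deriv (φ.normed volume) (-σ)) = fun σ => -deriv (φ.normed volume) σ :=
      funext (FunctionSpaces.deriv_normed_neg φ)
    rw [hk', hρ'', timeAvgWith_neg_kernel, ← timeDeriv_mollifiedField_apply hUm hUi hε hε']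
    ring
  simp_rw [hstep]
  -- Step 3: recombine the coordinates into `η ⟪w, ∂ₜw⟫` and integrate over the torus first
  have hBi : ∀ i, Integrable (fun q : ℝ × UnitAddTorus d => η q.1 * (w q.1 q.2 i * FunctionSpaces.Torus.timeDeriv w q.1 q.2 i)) (volume.prod volume) := by
    intro i
    refine integrable_uncurry_of_tsupport (F := fun s y => η s * (w s y i * FunctionSpaces.Torus.timeDeriv w s y i))
      (a := a) (b := b) ?_ fun s hs => by funext y; simp [hη0 s hs]
    exact (hηc.comp continuous_fst).mul
      (((EuclideanSpace.proj i : EuclideanSpace ℝ d →L[ℝ] ℝ).continuous.comp hwc).mul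
        ((EuclideanSpace.proj i : EuclideanSpace ℝ d →L[ℝ] ℝ).continuous.comp hdwc))
  rw [Finset.sum_neg_distrib, ← integral_finsetSum _ fun i _ => hBi i]
  have hinner : ∀ q : ℝ × UnitAddTorus d, ∑ i, η q.1 * (w q.1 q.2 i * FunctionSpaces.Torus.timeDeriv w q.1 q.2 i) =
      η q.1 * ⟪w q.1 q.2, FunctionSpaces.Torus.timeDeriv w q.1 q.2⟫_ℝ := fun q => by
    rw [← Finset.mul_sum]
    congr 1
    simp [PiLp.inner_apply, mul_comm]
  simp_rw [hinner]
  have hIi : Integrable (fun q : ℝ × UnitAddTorus d => η q.1 * ⟪w q.1 q.2, FunctionSpaces.Torus.timeDeriv w q.1 q.2⟫_ℝ) (volume.prod volume) := by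
    refine integrable_uncurry_of_tsupport (F := fun s y => η s * ⟪w s y, FunctionSpaces.Torus.timeDeriv w s y⟫_ℝ)
      (a := a) (b := b) ?_ fun s hs => by funext y; simp [hη0 s hs]
    exact (hηc.comp continuous_fst).mul (hwc.inner hdwc)
  rw [integral_prod _ hIi]
  simp only
  simp_rw [integral_const_mul]
  -- Step 4: `∫ ⟪w, ∂ₜw⟫ = ½ E'(s)` and integration by parts in time
  set E : ℝ → ℝ := fun s => ∫ y, ‖w s y‖ ^ 2 with hE
  set E' : ℝ → ℝ := fun s => ∫ y, 2 * ⟪w s y, FunctionSpaces.Torus.timeDeriv w s y⟫_ℝ with hE'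
  have hEd : ∀ s, HasDerivAt E (E' s) s := fun s =>
    hasDerivAt_integral_norm_sq_mollifiedField hUi hε hε' s
  have hhalf : ∀ s, ∫ y, ⟪w s y, FunctionSpaces.Torus.timeDeriv w s y⟫_ℝ = (1 / 2) * E' s := fun s => by
    simp only [hE']
    rw [integral_const_mul]
    ring
  simp_rw [hhalf]
  have hEc : Continuous E := by
    have hF : Continuous (uncurry fun s (y : UnitAddTorus d) => ‖w s y‖ ^ 2) :=
      (continuous_pow 2).comp hwc.norm
    have h := continuous_parametric_integral_of_continuous hF
      (isCompact_univ : IsCompact (univ : Set (UnitAddTorus d))) (μ := (volume : Measure (UnitAddTorus d)))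
    simpa only [Measure.restrict_univ] using h
  have hE'c : Continuous E' := by
    have hF : Continuous (uncurry fun s (y : UnitAddTorus d) => 2 * ⟪w s y, FunctionSpaces.Torus.timeDeriv w s y⟫_ℝ) :=
      Continuous.mul continuous_const (hwc.inner hdwc)
    have h := continuous_parametric_integral_of_continuous hF
      (isCompact_univ : IsCompact (univ : Set (UnitAddTorus d))) (μ := (volume : Measure (UnitAddTorus d)))
    simpa only [Measure.restrict_univ] using h
  have hηE' : Integrable (fun s => η s * E' s) volume := by
    refine (hηc.mul hE'c).integrable_of_hasCompactSupport ?_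
    exact HasCompactSupport.intro (isCompact_Icc (a := a) (b := b)) fun s hs => by simp [hη0 s hs]
  have hη'E : Integrable (fun s => deriv η s * E s) volume := by
    refine ((hη.continuous_deriv (by simp)).mul hEc).integrable_of_hasCompactSupport ?_
    refine HasCompactSupport.intro (isCompact_Icc (a := a) (b := b)) fun s hs => ?_
    have : deriv η s = 0 := by
      have hev : η =ᶠ[𝓝 s] fun _ => 0 := by
        simp only [mem_Icc, not_and_or, not_le] at hs
        rcases hs with hs | hs
        · filter_upwards [Iio_mem_nhds hs] with τ hτ
          exact hη0 τ fun h => (not_le.2 (mem_Iio.1 hτ)) h.1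
        · filter_upwards [Ioi_mem_nhds hs] with τ hτ
          exact hη0 τ fun h => (not_le.2 (mem_Ioi.1 hτ)) h.2
      rw [hev.deriv_eq, deriv_const]
    simp [this]
  have hlim := tendsto_zero_of_eq_zero_off (f := fun s => η s * E s) (a := a) (b := b)
    fun s hs => by simp [hη0 s hs]
  have hibp := integral_mul_deriv_eq_deriv_mul (u := η) (v := E) (u' := deriv η) (v' := E')
    (fun s _ => (hη.differentiable (by simp) s).hasDerivAt) (fun s _ => hEd s)
    (hηE' : Integrable (η * E') volume) (hη'E : Integrable (deriv η * E) volume) hlim.1 hlim.2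
  have hcalc : ∫ s, η s * ((1 / 2) * E' s) = (1 / 2) * ∫ s, η s * E' s := by
    rw [← integral_const_mul]
    refine integral_congr_ae (Eventually.of_forall fun s => ?_)
    ring
  rw [hcalc, hibp]
  simp [hE]

end TimePairing

/-! ## The nonlinear pairing -/

section FluxPairing

variable {U : ℝ → UnitAddTorus d → EuclideanSpace ℝ d} {φ : ContDiffBump (0 : ℝ)} {ε : ℝ}
  {η : ℝ → ℝ} {T₀ : ℝ}

omit [DecidableEq d] in
/-- **Fibres of parametrised mollifications are integrable in time**: for `uncurry Θ` strongly
measurable and integrable on `ℝ × T^d` and a continuous kernel `κ`, `t ↦ (Θ t ⋆ κ)(y)` is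
integrable with `∫ ‖(Θ t ⋆ κ)(y)‖ dt ≤ ‖κ‖_∞ ‖Θ‖_{L¹}`. [folklore] -/
theorem integrable_convolution_fibre {F' : Type*} [NormedAddCommGroup F'] [NormedSpace ℝ F']
    {Θ : ℝ → UnitAddTorus d → ℝ} (hΘm : StronglyMeasurable (uncurry Θ))
    (hΘi : Integrable (uncurry Θ) (volume.prod volume)) {κ : UnitAddTorus d → F'} (hκ : Continuous κ) {Cκ : ℝ}
    (hCκ : ∀ z, ‖κ z‖ ≤ Cκ) (y : UnitAddTorus d) :
    Integrable (fun t => (Θ t ⋆ κ) y) volume ∧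
      ∫ t, ‖(Θ t ⋆ κ) y‖ ≤ Cκ * ∫ p : ℝ × UnitAddTorus d, ‖uncurry Θ p‖ ∂(volume.prod volume) := by
  have hmeas : AEStronglyMeasurable (fun t => (Θ t ⋆ κ) y) volume :=
    ((stronglyMeasurable_uncurry_convolution hΘm hκ).comp_measurable
      (measurable_id.prodMk measurable_const)).aestronglyMeasurable
  have hbound : ∀ᵐ t ∂(volume : Measure ℝ), ‖(Θ t ⋆ κ) y‖ ≤ Cκ * ∫ z, ‖Θ t z‖ := by
    filter_upwards [hΘi.prod_right_ae] with t ht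
    exact FunctionSpaces.Torus.norm_convolution_le ht hCκ y
  have hdom : Integrable (fun t => Cκ * ∫ z, ‖Θ t z‖) volume :=
    (hΘi.norm.integral_prod_left).const_mul Cκ
  have hint : Integrable (fun t => (Θ t ⋆ κ) y) volume := hdom.mono' hmeas hbound
  refine ⟨hint, ?_⟩
  calc ∫ t, ‖(Θ t ⋆ κ) y‖ ≤ ∫ t, Cκ * ∫ z, ‖Θ t z‖ := integral_mono_ae hint.norm hdom hbound
    _ = Cκ * ∫ p : ℝ × UnitAddTorus d, ‖uncurry Θ p‖ ∂(volume.prod volume) := by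
        rw [integral_const_mul, integral_prod _ hΘi.norm]
        rfl

omit [DecidableEq d] in
/-- **Space–time mollifications of an `L¹` field are bounded**: with a bounded time kernel,
`‖timeAvgWith r (t ↦ Θ t ⋆ κ) s y‖ ≤ ‖r‖_∞ ‖κ‖_∞ ‖Θ‖_{L¹(ℝ × T^d)}`. [folklore] -/
theorem norm_timeAvgWith_convolution_le {F' : Type*} [NormedAddCommGroup F'] [NormedSpace ℝ F']
    {Θ : ℝ → UnitAddTorus d → ℝ} (hΘm : StronglyMeasurable (uncurry Θ))
    (hΘi : Integrable (uncurry Θ) (volume.prod volume)) {κ : UnitAddTorus d → F'} (hκ : Continuous κ) {Cκ : ℝ}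
    (hCκ : ∀ z, ‖κ z‖ ≤ Cκ) {r : ℝ → ℝ} {Cr : ℝ} (hr : ∀ s, ‖r s‖ ≤ Cr) (s : ℝ)
    (y : UnitAddTorus d) :
    ‖FunctionSpaces.timeAvgWith r (fun t => Θ t ⋆ κ) s y‖ ≤ Cr * (Cκ * ∫ p : ℝ × UnitAddTorus d, ‖uncurry Θ p‖ ∂(volume.prod volume)) := by
  obtain ⟨hint, hle⟩ := integrable_convolution_fibre hΘm hΘi hκ hCκ y
  have hCr : 0 ≤ Cr := (norm_nonneg _).trans (hr 0)
  exact (norm_timeAvgWith_le_of_integrable hr hint s).trans (mul_le_mul_of_nonneg_left hle hCr)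

omit [DecidableEq d] in
/-- Joint measurability of space–time mollifications `timeAvgWith r (t ↦ Θ t ⋆ κ)`. [folklore] -/
theorem aestronglyMeasurable_uncurry_timeAvgWith_convolution {F' : Type*} [NormedAddCommGroup F']
    [NormedSpace ℝ F'] {Θ : ℝ → UnitAddTorus d → ℝ} (hΘm : StronglyMeasurable (uncurry Θ))
    {κ : UnitAddTorus d → F'} (hκ : Continuous κ) {r : ℝ → ℝ} (hr : Continuous r) :
    AEStronglyMeasurable (uncurry (FunctionSpaces.timeAvgWith r fun t => Θ t ⋆ κ)) (volume.prod volume) :=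
  (FunctionSpaces.stronglyMeasurable_uncurry_timeAvgWith' hr
    (stronglyMeasurable_uncurry_convolution hΘm hκ)).aestronglyMeasurable

/-- **Integration by parts on the torus** for smooth real functions:
`∫ ∂ⱼf · g = -∫ f · ∂ⱼg`. [folklore] -/
theorem integral_partialDeriv_mul_eq_neg {f g : UnitAddTorus d → ℝ} (hf : FunctionSpaces.Torus.IsSmooth f)
    (hg : FunctionSpaces.Torus.IsSmooth g) (j : d) :
    ∫ y, FunctionSpaces.Torus.partialDeriv j f y * g y = -∫ y, f y * FunctionSpaces.Torus.partialDeriv j g y := by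
  have hf1 : FunctionSpaces.Torus.IsContDiff 1 f := hf.isContDiff (by simp)
  have hg1 : FunctionSpaces.Torus.IsContDiff 1 g := hg.isContDiff (by simp)
  have hfg : FunctionSpaces.Torus.IsSmooth fun y => f y * g y := hf.smul' hg
  have h0 : ∫ x, FunctionSpaces.Torus.partialDeriv j (fun y => f y * g y) x = 0 := FunctionSpaces.Torus.integral_partialDeriv_eq_zero_holds hfg j
  have hpt : FunctionSpaces.Torus.partialDeriv j (fun y => f y * g y) =
      fun x => f x * FunctionSpaces.Torus.partialDeriv j g x + FunctionSpaces.Torus.partialDeriv j f x * g x :=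
    funext fun x => FunctionSpaces.Torus.partialDeriv_mul hf1 hg1 j x
  rw [hpt] at h0
  have h1 : Integrable (fun x => f x * FunctionSpaces.Torus.partialDeriv j g x) volume :=
    (hf.continuous.mul (hg.partialDeriv j).continuous).integrable_unitAddTorus
  have h2 : Integrable (fun x => FunctionSpaces.Torus.partialDeriv j f x * g x) volume :=
    ((hf.partialDeriv j).continuous.mul hg.continuous).integrable_unitAddTorus
  have h3 : (∫ x, f x * FunctionSpaces.Torus.partialDeriv j g x) + ∫ x, FunctionSpaces.Torus.partialDeriv j f x * g x = 0 := by
    rw [← integral_add h1 h2]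
    simpa using h0
  linarith

omit [DecidableEq d] in
/-- Products of coordinates of an `L²` vector field are integrable and strongly measurable on
`ℝ × T^d`. [folklore] -/
theorem integrable_uncurry_mul_apply (hUm : StronglyMeasurable (uncurry U))
    (hU2 : MemLp (uncurry U) 2 (volume.prod volume)) (i j : d) :
    StronglyMeasurable (uncurry fun t y => U t y i * U t y j) ∧
      Integrable (uncurry fun t y => U t y i * U t y j) (volume.prod volume) :=
  ⟨(stronglyMeasurable_uncurry_apply hUm i).mul (stronglyMeasurable_uncurry_apply hUm j),
    (hU2.continuousLinearMap_comp (EuclideanSpace.proj i : EuclideanSpace ℝ d →L[ℝ] ℝ)).integrable_mul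
      (hU2.continuousLinearMap_comp (EuclideanSpace.proj j : EuclideanSpace ℝ d →L[ℝ] ℝ))⟩

/-- Space derivatives of the test field are jointly continuous. [folklore] -/
theorem continuous_uncurry_partialDeriv_cetTestField (hUi : Integrable (uncurry U) (volume.prod volume))
    (hε : 0 < ε) (hε' : ε ≤ 1 / 4) (hη : Continuous η) {a b : ℝ}
    (hη0 : ∀ s, s ∉ Icc a b → η s = 0) (i j : d) :
    Continuous (uncurry fun t x => FunctionSpaces.Torus.partialDeriv j (fun y => FunctionSpaces.Torus.cetTestField φ ε η U t y i) x) := by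
  have h := ((FunctionSpaces.Torus.isSmoothSpaceTimeOn_of_contDiff (contDiff_stLift_cetTestField (φ := φ) hUi hε hε' hη hη0)
    univ).apply i).partialDeriv uniqueDiffOn_univ j
  have hc := h.continuousOn_stLift
  rw [univ_prod_univ, continuousOn_univ] at hc
  exact FunctionSpaces.Torus.continuous_uncurry_of_continuous_stLift hc

/-- Space derivatives of the mollified field are jointly continuous. [folklore] -/
theorem continuous_uncurry_partialDeriv_mollifiedField (hUi : Integrable (uncurry U) (volume.prod volume))
    (hε : 0 < ε) (hε' : ε ≤ 1 / 4) (i j : d) :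
    Continuous (uncurry fun t x => FunctionSpaces.Torus.partialDeriv j (fun y => FunctionSpaces.Torus.mollifiedField φ ε U t y i) x) := by
  have h := ((FunctionSpaces.Torus.isSmoothSpaceTimeOn_of_contDiff (contDiff_stLift_mollifiedField (φ := φ) hUi hε hε')
    univ).apply i).partialDeriv uniqueDiffOn_univ j
  have hc := h.continuousOn_stLift
  rw [univ_prod_univ, continuousOn_univ] at hc
  exact FunctionSpaces.Torus.continuous_uncurry_of_continuous_stLift hc

/-- **The nonlinear pairing** (Constantin–E–Titi 1994, p. 209, right-hand side of the mollified
balance, time-regularised): testing with `ψ = cetTestField φ ε η U`,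
`∫∫ ⟪U, (U·∇)ψ⟫ = ∑ᵢⱼ ∫∫ η(s) 𝒯ᵢⱼ(s,y) ∂ⱼwᵢ(s,y)` with the space–time mollified momentum flux
`𝒯ᵢⱼ(s) = (timeAvgWith ρ (UᵢUⱼ) s) ⋆ k_ε` ("`(u ⊗ u)^ε`") and `w = mollifiedField φ ε U`. The
mollifiers are moved onto `UᵢUⱼ` by space–time adjointness (even time kernel, odd space kernel
`∂ⱼk_ε`), giving `-η ∂ⱼ𝒯ᵢⱼ wᵢ`, and one integrates by parts on the torus.
[cite: ConstantinETiti1994, p. 209] -/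
theorem integral_inner_convect_cetTestField (hUm : StronglyMeasurable (uncurry U))
    (hUi : Integrable (uncurry U) (volume.prod volume)) (hU2 : MemLp (uncurry U) 2 (volume.prod volume)) (hε : 0 < ε)
    (hε' : ε ≤ 1 / 4) (hη : ContDiff ℝ ∞ η) {a b : ℝ} (hη0 : ∀ s, s ∉ Icc a b → η s = 0) :
    ∫ p : ℝ × UnitAddTorus d, ⟪U p.1 p.2, FunctionSpaces.Torus.convect (U p.1) (FunctionSpaces.Torus.cetTestField φ ε η U p.1) p.2⟫_ℝ ∂(volume.prod volume) =
      ∑ i, ∑ j, ∫ q : ℝ × UnitAddTorus d, η q.1 *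
        (((FunctionSpaces.timeAvgWith (φ.normed volume) (fun t y => U t y i * U t y j) q.1) ⋆ FunctionSpaces.Torus.kernel ε) q.2 *
          FunctionSpaces.Torus.partialDeriv j (fun y => FunctionSpaces.Torus.mollifiedField φ ε U q.1 y i) q.2) ∂(volume.prod volume) := by
  set w := FunctionSpaces.Torus.mollifiedField φ ε U with hw
  set ψ := FunctionSpaces.Torus.cetTestField φ ε η U with hψ
  have hηc : Continuous η := hη.continuous
  have hk : FunctionSpaces.Torus.IsSmooth (FunctionSpaces.Torus.kernel (d := d) ε) := FunctionSpaces.Torus.isSmooth_kernel hε hε'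
  have hkj : ∀ j, Continuous (FunctionSpaces.Torus.partialDeriv j (FunctionSpaces.Torus.kernel (d := d) ε)) := fun j => (hk.partialDeriv j).continuous
  obtain ⟨Cρ, -, hCρ⟩ := FunctionSpaces.Torus.exists_forall_abs_le_of_hasCompactSupport' (r := φ.normed volume)
    φ.continuous_normed φ.hasCompactSupport_normed
  have hwc : Continuous (uncurry w) := continuous_uncurry_mollifiedField hUi hε hε'
  -- Step 1: coordinates
  have hcoord : ∀ p : ℝ × UnitAddTorus d, ⟪U p.1 p.2, FunctionSpaces.Torus.convect (U p.1) (ψ p.1) p.2⟫_ℝ =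
      ∑ i, ∑ j, U p.1 p.2 i * U p.1 p.2 j * FunctionSpaces.Torus.partialDeriv j (fun y => ψ p.1 y i) p.2 := fun p =>
    inner_fderiv_apply_eq_sum (isSmooth_cetTestField hUi hε hε' hηc hη0 p.1) p.2 (U p.1 p.2)
  simp_rw [hcoord]
  -- integrability of each term
  have hUij := fun i j => integrable_uncurry_mul_apply hUm hU2 i j
  have hAij : ∀ i j, Integrable (fun p : ℝ × UnitAddTorus d =>
      U p.1 p.2 i * U p.1 p.2 j * FunctionSpaces.Torus.partialDeriv j (fun y => ψ p.1 y i) p.2) (volume.prod volume) := by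
    intro i j
    obtain ⟨C, hC⟩ := exists_bound_partialDeriv_cetTestField (φ := φ) hUi hε hε' hηc hη0 i j
    exact (hUij i j).2.mul_bdd
      (continuous_uncurry_partialDeriv_cetTestField hUi hε hε' hηc hη0 i j).aestronglyMeasurable
      (Eventually.of_forall fun p => hC p.1 p.2)
  rw [integral_finsetSum _ fun i _ => integrable_finsetSum _ fun j _ => hAij i j]
  refine Finset.sum_congr rfl fun i _ => ?_
  rw [integral_finsetSum _ fun j _ => hAij i j]
  refine Finset.sum_congr rfl fun j _ => ?_
  -- Step 2: fix `i j`; move the mollifiers onto `UᵢUⱼ`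
  obtain ⟨Cg, -, hCg⟩ := exists_bound_eta_mul hUi hε hε' hηc hη0 i (φ := φ)
  have hGm : AEStronglyMeasurable (uncurry fun s y => η s * w s y i) (volume.prod volume) :=
    (continuous_uncurry_eta_mul hUi hε hε' hηc i).aestronglyMeasurable
  set Θ : ℝ → UnitAddTorus d → ℝ := fun t y => U t y i * U t y j with hΘ
  set 𝒯 : ℝ → UnitAddTorus d → ℝ := fun s => (FunctionSpaces.timeAvgWith (φ.normed volume) Θ s) ⋆ FunctionSpaces.Torus.kernel ε with h𝒯
  have hform : (fun p : ℝ × UnitAddTorus d =>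
      U p.1 p.2 i * U p.1 p.2 j * FunctionSpaces.Torus.partialDeriv j (fun y => ψ p.1 y i) p.2) =
      fun p => Θ p.1 p.2 * FunctionSpaces.timeAvgWith (φ.normed volume)
        (fun s => (fun y => η s * w s y i) ⋆ FunctionSpaces.Torus.partialDeriv j (FunctionSpaces.Torus.kernel ε)) p.1 p.2 := by
    funext p
    rw [partialDeriv_cetTestField_apply hUi hε hε' hηc hη0]
  rw [hform, FunctionSpaces.Torus.integral_mul_timeAvgWith_convolution (hUij i j).2 hGm hCg φ.continuous_normed
    φ.hasCompactSupport_normed (hkj j)]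
  -- simplify the reflected kernels: `ρ` even, `∂ⱼk` odd
  have hρe : (fun σ => φ.normed volume (-σ)) = φ.normed volume := funext fun σ => φ.normed_neg σ
  have hko : (fun z : UnitAddTorus d => FunctionSpaces.Torus.partialDeriv j (FunctionSpaces.Torus.kernel ε) (-z)) =
      fun z => -FunctionSpaces.Torus.partialDeriv j (FunctionSpaces.Torus.kernel ε) z := funext (FunctionSpaces.Torus.partialDeriv_kernel_neg hε hε' j)
  have h𝒯d : ∀ s y, FunctionSpaces.timeAvgWith (φ.normed volume) (fun t => Θ t ⋆ FunctionSpaces.Torus.partialDeriv j (FunctionSpaces.Torus.kernel ε)) s y =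
      FunctionSpaces.Torus.partialDeriv j (𝒯 s) y := fun s y => by
    simp only [h𝒯]
    rw [FunctionSpaces.Torus.partialDeriv_convolution_timeAvgWith (hUij i j).2 φ.continuous_normed
      φ.hasCompactSupport_normed hk s j]
  have hred : ∀ q : ℝ × UnitAddTorus d,
      FunctionSpaces.timeAvgWith (fun σ => φ.normed volume (-σ))
          (fun t => Θ t ⋆ fun z => FunctionSpaces.Torus.partialDeriv j (FunctionSpaces.Torus.kernel ε) (-z)) q.1 q.2 * (η q.1 * w q.1 q.2 i) =
        -(η q.1 * (FunctionSpaces.Torus.partialDeriv j (𝒯 q.1) q.2 * w q.1 q.2 i)) := fun q => by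
    rw [hρe, hko]
    have h1 : (fun t => Θ t ⋆ fun z => -FunctionSpaces.Torus.partialDeriv j (FunctionSpaces.Torus.kernel ε) z) =
        fun t x => -(Θ t ⋆ FunctionSpaces.Torus.partialDeriv j (FunctionSpaces.Torus.kernel ε)) x :=
      funext fun t => funext fun x => convolution_neg_right' _ _ _
    rw [h1, timeAvgWith_neg_field, h𝒯d]
    ring
  refine Eq.trans (integral_congr_ae (Eventually.of_forall hred)) ?_
  rw [integral_neg]
  -- Step 3: bounds and measurability of `𝒯` and `∂ⱼ𝒯`
  obtain ⟨Ck, hCk⟩ := FunctionSpaces.Torus.exists_forall_norm_le_of_continuous (FunctionSpaces.Torus.continuous_kernel (d := d) hε hε')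
  obtain ⟨Ckj, hCkj⟩ := FunctionSpaces.Torus.exists_forall_norm_le_of_continuous (hkj j)
  have h𝒯b : ∀ s y, ‖𝒯 s y‖ ≤ Cρ * (Ck * ∫ p : ℝ × UnitAddTorus d, ‖uncurry Θ p‖ ∂(volume.prod volume)) := fun s y => by
    simp only [h𝒯]
    rw [FunctionSpaces.Torus.timeAvgWith_convolution (hUij i j).2 φ.continuous_normed φ.hasCompactSupport_normed
      (FunctionSpaces.Torus.continuous_kernel hε hε') s]
    exact norm_timeAvgWith_convolution_le (hUij i j).1 (hUij i j).2 (FunctionSpaces.Torus.continuous_kernel hε hε')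
      hCk hCρ s y
  have h𝒯db : ∀ s y, ‖FunctionSpaces.Torus.partialDeriv j (𝒯 s) y‖ ≤ Cρ * (Ckj * ∫ p : ℝ × UnitAddTorus d, ‖uncurry Θ p‖ ∂(volume.prod volume)) := fun s y => by
    rw [← h𝒯d]
    exact norm_timeAvgWith_convolution_le (hUij i j).1 (hUij i j).2 (hkj j) hCkj hCρ s y
  have h𝒯m : AEStronglyMeasurable (uncurry 𝒯) (volume.prod volume) := by
    have hfun : uncurry 𝒯 = uncurry (FunctionSpaces.timeAvgWith (φ.normed volume) fun t => Θ t ⋆ FunctionSpaces.Torus.kernel ε) := by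
      funext q
      simp only [uncurry, h𝒯]
      rw [FunctionSpaces.Torus.timeAvgWith_convolution (hUij i j).2 φ.continuous_normed φ.hasCompactSupport_normed
        (FunctionSpaces.Torus.continuous_kernel hε hε') q.1]
    rw [hfun]
    exact aestronglyMeasurable_uncurry_timeAvgWith_convolution (hUij i j).1
      (FunctionSpaces.Torus.continuous_kernel hε hε') φ.continuous_normed
  have h𝒯dm : AEStronglyMeasurable (uncurry fun s y => FunctionSpaces.Torus.partialDeriv j (𝒯 s) y) (volume.prod volume) := by
    have hfun : (uncurry fun s y => FunctionSpaces.Torus.partialDeriv j (𝒯 s) y) =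
        uncurry (FunctionSpaces.timeAvgWith (φ.normed volume) fun t => Θ t ⋆ FunctionSpaces.Torus.partialDeriv j (FunctionSpaces.Torus.kernel ε)) := by
      funext q
      simp only [uncurry]
      rw [← h𝒯d]
    rw [hfun]
    exact aestronglyMeasurable_uncurry_timeAvgWith_convolution (hUij i j).1 (hkj j)
      φ.continuous_normed
  -- smoothness of the slices
  have h𝒯s : ∀ s, FunctionSpaces.Torus.IsSmooth (𝒯 s) := fun s =>
    FunctionSpaces.Torus.isSmooth_convolution (FunctionSpaces.Torus.integrable_timeAvgWith (hUij i j).2 φ.continuous_normed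
      φ.hasCompactSupport_normed s) hk
  have hws : ∀ s, FunctionSpaces.Torus.IsSmooth fun y => w s y i := fun s => (isSmooth_mollifiedField hUi hε hε' s).apply i
  -- integrability of the two space–time integrands
  have hηw : Integrable (uncurry fun s y => η s * w s y i) (volume.prod volume) :=
    integrable_uncurry_eta_mul hUi hε hε' hηc hη0 i
  have hηdw : Integrable (uncurry fun s y => η s * FunctionSpaces.Torus.partialDeriv j (fun y => w s y i) y) (volume.prod volume) :=
    integrable_uncurry_of_tsupport (a := a) (b := b)
      ((hηc.comp continuous_fst).mul (continuous_uncurry_partialDeriv_mollifiedField hUi hε hε' i j))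
      fun s hs => by funext y; simp [hη0 s hs]
  have hI1 : Integrable (fun q : ℝ × UnitAddTorus d =>
      η q.1 * (FunctionSpaces.Torus.partialDeriv j (𝒯 q.1) q.2 * w q.1 q.2 i)) (volume.prod volume) := by
    have h := hηw.bdd_mul h𝒯dm (Eventually.of_forall fun q => h𝒯db q.1 q.2)
    refine h.congr (Eventually.of_forall fun q => ?_)
    simp only [uncurry]
    ring
  have hI2 : Integrable (fun q : ℝ × UnitAddTorus d =>
      η q.1 * (𝒯 q.1 q.2 * FunctionSpaces.Torus.partialDeriv j (fun y => w q.1 y i) q.2)) (volume.prod volume) := by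
    have h := hηdw.bdd_mul h𝒯m (Eventually.of_forall fun q => h𝒯b q.1 q.2)
    refine h.congr (Eventually.of_forall fun q => ?_)
    simp only [uncurry]
    ring
  -- Step 4: iterated integrals and integration by parts on the torus
  rw [integral_prod _ hI1, integral_prod _ hI2, ← integral_neg]
  refine integral_congr_ae (Eventually.of_forall fun s => ?_)
  dsimp only
  rw [integral_const_mul, integral_const_mul, ← mul_neg, integral_partialDeriv_mul_eq_neg (h𝒯s s) (hws s) j,
    neg_neg]

end FluxPairing

/-! ## The mollified energy balance -/

section Balance

variable {U : ℝ → UnitAddTorus d → EuclideanSpace ℝ d} {φ : ContDiffBump (0 : ℝ)} {ε : ℝ}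
  {η : ℝ → ℝ} {T₀ : ℝ}

omit [DecidableEq d] in
/-- The time-derivative pairing integrand `⟪U, ∂ₜψ⟫` is integrable on `ℝ × T^d`. [folklore] -/
theorem integrable_inner_timeDeriv_cetTestField (hUi : Integrable (uncurry U) (volume.prod volume)) (hε : 0 < ε) (hε' : ε ≤ 1 / 4) (hη : Continuous η)
    {a b : ℝ} (hη0 : ∀ s, s ∉ Icc a b → η s = 0) :
    Integrable (fun p : ℝ × UnitAddTorus d =>
      ⟪U p.1 p.2, FunctionSpaces.Torus.timeDeriv (FunctionSpaces.Torus.cetTestField φ ε η U) p.1 p.2⟫_ℝ) (volume.prod volume) := by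
  set ψ := FunctionSpaces.Torus.cetTestField φ ε η U with hψ
  have hdψc : Continuous (uncurry (FunctionSpaces.Torus.timeDeriv ψ)) :=
    continuous_uncurry_of_contDiff_stLift (isSpaceTimeTest_cetTestField hUi hε hε' hη hη0).timeDeriv.1
  have hcoord : (fun p : ℝ × UnitAddTorus d => ⟪U p.1 p.2, FunctionSpaces.Torus.timeDeriv ψ p.1 p.2⟫_ℝ) =
      fun p => ∑ i, U p.1 p.2 i * FunctionSpaces.Torus.timeDeriv ψ p.1 p.2 i := by
    funext p
    simp [PiLp.inner_apply, mul_comm]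
  rw [hcoord]
  refine integrable_finsetSum _ fun i _ => ?_
  obtain ⟨C, hC⟩ := exists_bound_timeDeriv_cetTestField (φ := φ) hUi hε hε' hη hη0 i
  exact (hUi.eval_piLp i).mul_bdd
    (((EuclideanSpace.proj i : EuclideanSpace ℝ d →L[ℝ] ℝ).continuous.comp hdψc).aestronglyMeasurable)
    (Eventually.of_forall fun p => hC p.1 p.2)

/-- The nonlinear pairing integrand `⟪U, (U·∇)ψ⟫` is integrable on `ℝ × T^d`. [folklore] -/
theorem integrable_inner_convect_cetTestField (hUm : StronglyMeasurable (uncurry U))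
    (hUi : Integrable (uncurry U) (volume.prod volume)) (hU2 : MemLp (uncurry U) 2 (volume.prod volume)) (hε : 0 < ε)
    (hε' : ε ≤ 1 / 4) (hη : Continuous η) {a b : ℝ} (hη0 : ∀ s, s ∉ Icc a b → η s = 0) :
    Integrable (fun p : ℝ × UnitAddTorus d =>
      ⟪U p.1 p.2, FunctionSpaces.Torus.convect (U p.1) (FunctionSpaces.Torus.cetTestField φ ε η U p.1) p.2⟫_ℝ) (volume.prod volume) := by
  set ψ := FunctionSpaces.Torus.cetTestField φ ε η U with hψ
  have hcoord : (fun p : ℝ × UnitAddTorus d => ⟪U p.1 p.2, FunctionSpaces.Torus.convect (U p.1) (ψ p.1) p.2⟫_ℝ) =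
      fun p => ∑ i, ∑ j, U p.1 p.2 i * U p.1 p.2 j * FunctionSpaces.Torus.partialDeriv j (fun y => ψ p.1 y i) p.2 := by
    funext p
    exact inner_fderiv_apply_eq_sum (isSmooth_cetTestField hUi hε hε' hη hη0 p.1) p.2 (U p.1 p.2)
  rw [hcoord]
  refine integrable_finsetSum _ fun i _ => integrable_finsetSum _ fun j _ => ?_
  obtain ⟨C, hC⟩ := exists_bound_partialDeriv_cetTestField (φ := φ) hUi hε hε' hη hη0 i j
  exact (integrable_uncurry_mul_apply hUm hU2 i j).2.mul_bdd
    (continuous_uncurry_partialDeriv_cetTestField hUi hε hε' hη hη0 i j).aestronglyMeasurable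
    (Eventually.of_forall fun p => hC p.1 p.2)

/-- **The mollified energy balance of a weak Euler solution** (Constantin–E–Titi 1994, p. 209,
the identity `∫|u^ε(t)|² - ∫|u^ε(0)|² = 2∫₀ᵗ∫ Tr((u⊗u)^ε ∇u^ε)`, in distributional-in-time form
and with the mollification in time carried out). Let `U` be a strongly measurable representative
of an `L²_{t,x}` weak Euler solution on `T^d × (0, T₀)` extended by zero in time (pressure-free
weak identity against admissible divergence-free test fields, a.e. weak incompressibility), let
`ρ` be a time bump of radius `rOut`, `0 < ε ≤ 1/4`, and `η` a smooth cut-off vanishing off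
`[a, b]` with `rOut < a`, `b + rOut < T₀`. Then, with `w = mollifiedField φ ε U` and
`𝒯ᵢⱼ(s) = (timeAvgWith ρ (UᵢUⱼ) s) ⋆ k_ε`,
`½ ∫ η'(s) ‖w(s)‖²_{L²} ds + ∑ᵢⱼ ∫∫ η 𝒯ᵢⱼ ∂ⱼwᵢ = 0`
(test the weak identity with `cetTestField φ ε η U` and use the two pairing identities).
[cite: ConstantinETiti1994, p. 209] -/
theorem mollified_energy_balance (hUm : StronglyMeasurable (uncurry U))
    (hUi : Integrable (uncurry U) (volume.prod volume)) (hU2 : MemLp (uncurry U) 2 (volume.prod volume)) (hε : 0 < ε)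
    (hε' : ε ≤ 1 / 4) (hU0 : ∀ t, t ∉ Ioo 0 T₀ → U t = 0)
    (hdiv : ∀ᵐ s, FunctionSpaces.Torus.IsWeaklyDivFree (U s))
    (hweak : ∀ ψ : ℝ → UnitAddTorus d → EuclideanSpace ℝ d, FunctionSpaces.Torus.IsSpaceTimeTestIoo T₀ ψ →
      FunctionSpaces.Torus.IsDivFreeTest ψ →
      ∫ t in Ioo 0 T₀, ∫ x, (⟪U t x, FunctionSpaces.Torus.timeDeriv ψ t x⟫_ℝ + ⟪U t x, FunctionSpaces.Torus.convect (U t) (ψ t) x⟫_ℝ) = 0)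
    (hη : ContDiff ℝ ∞ η) {a b : ℝ} (hη0 : ∀ s, s ∉ Icc a b → η s = 0) (ha : φ.rOut < a)
    (hb : b + φ.rOut < T₀) :
    (1 / 2) * (∫ s, deriv η s * ∫ y, ‖FunctionSpaces.Torus.mollifiedField φ ε U s y‖ ^ 2) +
      ∑ i, ∑ j, ∫ q : ℝ × UnitAddTorus d, η q.1 *
        (((FunctionSpaces.timeAvgWith (φ.normed volume) (fun t y => U t y i * U t y j) q.1) ⋆ FunctionSpaces.Torus.kernel ε) q.2 *
          FunctionSpaces.Torus.partialDeriv j (fun y => FunctionSpaces.Torus.mollifiedField φ ε U q.1 y i) q.2) ∂(volume.prod volume) = 0 := by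
  have hηc : Continuous η := hη.continuous
  have hU0' : ∀ t, t ∉ Icc 0 T₀ → U t = 0 := fun t ht => hU0 t fun h => ht (Ioo_subset_Icc_self h)
  set ψ := FunctionSpaces.Torus.cetTestField φ ε η U with hψ
  have hadm : FunctionSpaces.Torus.IsSpaceTimeTestIoo T₀ ψ := isSpaceTimeTestIoo_cetTestField hUi hε hε' hηc hη0 ha hb
  have hdf : FunctionSpaces.Torus.IsDivFreeTest ψ := isDivFreeTest_cetTestField hUi hdiv hε hε' hηc hη0
  have h := hweak ψ hadm hdf
  have hA := integrable_inner_timeDeriv_cetTestField (φ := φ) hUi hε hε' hηc hη0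
  have hB := integrable_inner_convect_cetTestField (φ := φ) hUm hUi hU2 hε hε' hηc hη0
  -- the weak identity as an integral over `ℝ × T^d`
  have hzero : ∀ t, t ∉ Ioo 0 T₀ →
      ∫ x, (⟪U t x, FunctionSpaces.Torus.timeDeriv ψ t x⟫_ℝ + ⟪U t x, FunctionSpaces.Torus.convect (U t) (ψ t) x⟫_ℝ) = 0 := fun t ht => by
    simp [hU0 t ht]
  rw [setIntegral_eq_integral_of_forall_compl_eq_zero hzero] at h
  have hAB : Integrable (fun p : ℝ × UnitAddTorus d =>
      ⟪U p.1 p.2, FunctionSpaces.Torus.timeDeriv ψ p.1 p.2⟫_ℝ + ⟪U p.1 p.2, FunctionSpaces.Torus.convect (U p.1) (ψ p.1) p.2⟫_ℝ) (volume.prod volume) := hA.add hB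
  have hprod := integral_prod _ hAB
  rw [integral_add hA hB, integral_inner_timeDeriv_cetTestField hUm hUi hε hε' hU0' hη hη0,
    integral_inner_convect_cetTestField hUm hUi hU2 hε hε' hη hη0] at hprod
  rw [hprod]
  exact h

end Balance





end Torus

end Literature.Analysis.FluidPDE

/-! ## Part 3. Removing the time mollification: the energy balance of `u^ε` (CET (11))

(Constantin–E–Titi 1994, p. 209, the identity
`∫|u^ε(x,t)|² - ∫|u^ε(x,0)|² = 2∫₀ᵗ∫ Tr((u⊗u)^ε ∇u^ε) dx dτ`, in its distributional-in-time form
`½ ∫ η'(s) ‖u^ε(s)‖²_{L²} ds = -∑ᵢⱼ ∫∫ η (uᵢuⱼ)^ε ∂ⱼuᵢ^ε`).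

Starting from the mollified balance of Part 2 (time bump `ρₙ` of radius `→ 0`)
we let `n → ∞`: the space–time mollified fields `wₙ = ρₙ ⋆ₜ u^ε` converge to `u^ε` in
`L²(ℝ × T^d)`, the mollified momentum fluxes `ρₙ ⋆ₜ (uᵢuⱼ)^ε` in `L^{3/2}` and the mollified
gradients `ρₙ ⋆ₜ ∂ⱼuᵢ^ε` in `L³` (the tree's `Literature.Analysis.FunctionSpaces.tendsto_eLpNorm_timeConv_sub`), so both terms of
the balance pass to the limit (`LpPairingLimits`).

* `Torus.eLpNorm_uncurry_convolution_le` — space–time Young inequality for slice-wise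
  mollification: `‖(s,y) ↦ (Θ s ⋆ κ)(y)‖_{Lᵖ(ℝ × T^d)} ≤ ‖κ‖_{L¹} ‖Θ‖_{Lᵖ(ℝ × T^d)}`;
* `Torus.energy_balance_vecMollify` — **CET (11), distributional in time**: for a strongly
  measurable representative `U` of an `L³_{t,x}` weak Euler solution on `T^d × (0, T₀)` extended by
  zero, `0 < ε ≤ 1/4` and a smooth cut-off `η` supported in `[a, b] ⊂ (0, T₀)`,
  `½ ∫ η'(s) ‖u^ε(s)‖²_{L²} ds + ∑ᵢⱼ ∫∫ η(s) ((UᵢUⱼ)(s) ⋆ k_ε)(y) ((Uᵢ s) ⋆ ∂ⱼk_ε)(y) = 0`.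
-/

namespace Literature.Analysis.FluidPDE

namespace Torus

variable {d : Type*} [Fintype d] [DecidableEq d]

/-! ## Space–time Young inequality for slice-wise mollification -/

section Young

omit [DecidableEq d]

/-- **Space–time Young inequality**, `lintegral` form: for `uncurry Θ` strongly measurable on
`ℝ × T^d`, a continuous real kernel `κ` and `1 ≤ p`,
`∫∫ |(Θ s ⋆ κ)(y)|^p ≤ (∫ |κ|)^p ∫∫ |Θ|^p` (slice-wise Young, the tree's
`Literature.Analysis.UnboundedOperators.lintegral_rpow_enorm_convolution_le`, and Tonelli). [folklore] -/
theorem lintegral_rpow_uncurry_convolution_le {Θ : ℝ → UnitAddTorus d → ℝ}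
    (hΘm : StronglyMeasurable (uncurry Θ)) {κ : UnitAddTorus d → ℝ} (hκ : Continuous κ) {p : ℝ}
    (hp : 1 ≤ p) :
    ∫⁻ q, ‖(Θ q.1 ⋆ κ) q.2‖ₑ ^ p ∂(volume.prod volume) ≤ (∫⁻ z, ‖κ z‖ₑ) ^ p * ∫⁻ q, ‖Θ q.1 q.2‖ₑ ^ p ∂(volume.prod volume) := by
  have hM : (∫⁻ z, ‖κ z‖ₑ) ≠ ⊤ := (hκ.integrable_unitAddTorus).2.ne
  have hCm : StronglyMeasurable (uncurry fun s x => (Θ s ⋆ κ) x) :=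
    stronglyMeasurable_uncurry_convolution hΘm hκ
  have h1 : AEMeasurable (fun q : ℝ × UnitAddTorus d => ‖(Θ q.1 ⋆ κ) q.2‖ₑ ^ p) (volume.prod volume) :=
    (hCm.measurable.enorm.pow_const _).aemeasurable
  have h2 : AEMeasurable (fun q : ℝ × UnitAddTorus d => ‖Θ q.1 q.2‖ₑ ^ p) (volume.prod volume) :=
    (hΘm.measurable.enorm.pow_const _).aemeasurable
  rw [lintegral_prod _ h1, lintegral_prod _ h2,
    ← lintegral_const_mul' _ _ (ENNReal.rpow_ne_top_of_nonneg (zero_le_one.trans hp) hM)]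
  refine lintegral_mono fun s => ?_
  have hΘs : AEStronglyMeasurable (Θ s) volume :=
    (hΘm.comp_measurable (measurable_const.prodMk measurable_id)).aestronglyMeasurable
  have h := Literature.Analysis.UnboundedOperators.lintegral_rpow_enorm_convolution_le (μ := (volume : Measure (UnitAddTorus d)))
    hκ.aestronglyMeasurable hΘs hp
  simp only
  rw [FunctionSpaces.Torus.convolution_comm_real]
  exact h

/-- **Space–time Young inequality**, `eLpNorm` form (`1 ≤ p < ∞`):
`‖(s, y) ↦ (Θ s ⋆ κ)(y)‖_{Lᵖ(ℝ × T^d)} ≤ ‖κ‖_{L¹(T^d)} ‖Θ‖_{Lᵖ(ℝ × T^d)}`. [folklore] -/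
theorem eLpNorm_uncurry_convolution_le {Θ : ℝ → UnitAddTorus d → ℝ}
    (hΘm : StronglyMeasurable (uncurry Θ)) {κ : UnitAddTorus d → ℝ} (hκ : Continuous κ)
    {p : ℝ≥0∞} (hp : 1 ≤ p) (hp' : p ≠ ⊤) :
    eLpNorm (uncurry fun s y => (Θ s ⋆ κ) y) p (volume.prod volume) ≤ (∫⁻ z, ‖κ z‖ₑ) * eLpNorm (uncurry Θ) p (volume.prod volume) := by
  have hp0 : p ≠ 0 := (zero_lt_one.trans_le hp).ne'
  have hpr : 1 ≤ p.toReal := by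
    simpa using (ENNReal.toReal_le_toReal ENNReal.one_ne_top hp').2 hp
  have hpr0 : 0 < p.toReal := one_pos.trans_le hpr
  rw [eLpNorm_eq_lintegral_rpow_enorm_toReal hp0 hp', eLpNorm_eq_lintegral_rpow_enorm_toReal hp0 hp']
  calc (∫⁻ q, ‖uncurry (fun s y => (Θ s ⋆ κ) y) q‖ₑ ^ p.toReal ∂(volume.prod volume)) ^ (1 / p.toReal)
      ≤ ((∫⁻ z, ‖κ z‖ₑ) ^ p.toReal * ∫⁻ q, ‖uncurry Θ q‖ₑ ^ p.toReal ∂(volume.prod volume)) ^ (1 / p.toReal) :=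
        ENNReal.rpow_le_rpow (lintegral_rpow_uncurry_convolution_le hΘm hκ hpr) (by positivity)
    _ = (∫⁻ z, ‖κ z‖ₑ) * (∫⁻ q, ‖uncurry Θ q‖ₑ ^ p.toReal ∂(volume.prod volume)) ^ (1 / p.toReal) := by
        rw [ENNReal.mul_rpow_of_nonneg _ _ (by positivity), ← ENNReal.rpow_mul,
          mul_one_div_cancel hpr0.ne', ENNReal.rpow_one]

end Young

/-! ## `Lᵖ` bounds for the spatially mollified fields -/

section LpBounds

variable {U : ℝ → UnitAddTorus d → EuclideanSpace ℝ d} {ε : ℝ}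

omit [DecidableEq d] in
/-- Coordinates: `‖Uᵢ‖_{Lᵖ(ℝ × T^d)} ≤ ‖U‖_{Lᵖ(ℝ × T^d)}`. [folklore] -/
theorem eLpNorm_uncurry_apply_le (U : ℝ → UnitAddTorus d → EuclideanSpace ℝ d) (i : d) (p : ℝ≥0∞) :
    eLpNorm (uncurry fun s y => U s y i) p (volume.prod volume) ≤
      eLpNorm (uncurry U) p (volume.prod volume) := by
  refine eLpNorm_mono fun q => ?_
  simpa [uncurry, Real.norm_eq_abs] using PiLp.norm_apply_le (U q.1 q.2) i

omit [DecidableEq d] in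
/-- Products of coordinates: `‖UᵢUⱼ‖_{L^{3/2}(ℝ × T^d)} ≤ ‖U‖²_{L³(ℝ × T^d)}`. [folklore] -/
theorem eLpNorm_uncurry_mul_apply_le (U : ℝ → UnitAddTorus d → EuclideanSpace ℝ d) (i j : d) :
    eLpNorm (uncurry fun s y => U s y i * U s y j) (3 / 2) (volume.prod volume) ≤
      eLpNorm (uncurry U) 3 (volume.prod volume) ^ (2 : ℝ) := by
  have h1 : eLpNorm (uncurry fun s y => U s y i * U s y j) (3 / 2) (volume.prod volume) ≤
      eLpNorm (fun q : ℝ × UnitAddTorus d => ‖uncurry U q‖ ^ (2 : ℝ)) (3 / 2) (volume.prod volume) := by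
    refine eLpNorm_mono fun q => ?_
    have hi : |U q.1 q.2 i| ≤ ‖U q.1 q.2‖ := by simpa using PiLp.norm_apply_le (U q.1 q.2) i
    have hj : |U q.1 q.2 j| ≤ ‖U q.1 q.2‖ := by simpa using PiLp.norm_apply_le (U q.1 q.2) j
    have h : ‖U q.1 q.2 i * U q.1 q.2 j‖ ≤ ‖U q.1 q.2‖ ^ (2 : ℝ) := by
      rw [norm_mul, Real.norm_eq_abs, Real.norm_eq_abs, Real.rpow_two, sq]
      exact mul_le_mul hi hj (abs_nonneg _) (norm_nonneg _)
    have h' : ‖‖uncurry U q‖ ^ (2 : ℝ)‖ = ‖U q.1 q.2‖ ^ (2 : ℝ) := by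
      rw [Real.norm_eq_abs, abs_of_nonneg (Real.rpow_nonneg (norm_nonneg _) _)]
      rfl
    rw [h']
    exact h
  refine h1.trans_eq ?_
  rw [eLpNorm_norm_rpow _ two_pos]
  congr 1
  rw [show ENNReal.ofReal (2 : ℝ) = 2 by simp]
  rw [ENNReal.div_mul_cancel (by norm_num) (by norm_num)]

end LpBounds

/-! ## Removing the time mollification: `L²` convergence of the mollified fields -/

section Limit

variable {U : ℝ → UnitAddTorus d → EuclideanSpace ℝ d} {ε : ℝ}

omit [DecidableEq d] in
/-- The spatially mollified coordinate fields `(s, y) ↦ (Uᵢ s ⋆ κ)(y)` are strongly measurable and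
in `Lᵖ(ℝ × T^d)` with `‖·‖_p ≤ ‖κ‖₁ ‖U‖_p`. [folklore] -/
theorem eLpNorm_uncurry_convolution_apply_le (hUm : StronglyMeasurable (uncurry U))
    {κ : UnitAddTorus d → ℝ} (hκ : Continuous κ) (i : d) {p : ℝ≥0∞} (hp : 1 ≤ p) (hp' : p ≠ ⊤) :
    eLpNorm (uncurry fun s y => ((fun z => U s z i) ⋆ κ) y) p (volume.prod volume) ≤
      (∫⁻ z, ‖κ z‖ₑ) * eLpNorm (uncurry U) p (volume.prod volume) :=
  (eLpNorm_uncurry_convolution_le (stronglyMeasurable_uncurry_apply hUm i) hκ hp hp').trans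
    (mul_le_mul_right (eLpNorm_uncurry_apply_le U i p) _)

/-- **The space–time mollified fields converge to `u^ε` in `L²(ℝ × T^d)`** as the time radius
tends to `0`: `‖wₙ - u^ε‖_{L²(ℝ × T^d)} → 0` for `wₙ = mollifiedField (φ n) ε U`,
`u^ε(s) = vecMollify ε (U s)` (coordinatewise `wₙ,ᵢ = ρₙ ⋆ₜ u^ε_ᵢ` and the tree's
`Literature.Analysis.FunctionSpaces.tendsto_eLpNorm_timeConv_sub`). [folklore] -/
theorem tendsto_eLpNorm_mollifiedField_sub (hUm : StronglyMeasurable (uncurry U))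
    (hUi : Integrable (uncurry U) (volume.prod volume)) (hU2 : MemLp (uncurry U) 2 (volume.prod volume))
    (hε : 0 < ε) (hε' : ε ≤ 1 / 4) {φ : ℕ → ContDiffBump (0 : ℝ)}
    (hφ : Tendsto (fun n => (φ n).rOut) atTop (𝓝 0)) :
    Tendsto (fun n => eLpNorm (fun q : ℝ × UnitAddTorus d =>
      FunctionSpaces.Torus.mollifiedField (φ n) ε U q.1 q.2 - FunctionSpaces.Torus.vecMollify ε (U q.1) q.2) 2 (volume.prod volume))
      atTop (𝓝 0) := by
  have hk := FunctionSpaces.Torus.continuous_kernel (d := d) hε hε'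
  set G : d → ℝ → UnitAddTorus d → ℝ := fun i s x => ((fun y => U s y i) ⋆ FunctionSpaces.Torus.kernel ε) x with hG
  have hGm : ∀ i, StronglyMeasurable (uncurry (G i)) := fun i =>
    stronglyMeasurable_uncurry_convolution (stronglyMeasurable_uncurry_apply hUm i) hk
  have hG2 : ∀ i, eLpNorm (uncurry (G i)) 2 ((volume : Measure ℝ).prod volume) < ⊤ := fun i => by
    refine (eLpNorm_uncurry_convolution_apply_le hUm hk i one_le_two ENNReal.ofNat_ne_top).trans_lt ?_
    rw [FunctionSpaces.Torus.lintegral_enorm_kernel hε hε', one_mul]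
    exact hU2.2
  -- coordinatewise convergence
  have hcomp : ∀ i, Tendsto (fun n => eLpNorm (fun z : ℝ × UnitAddTorus d =>
      FunctionSpaces.timeAvgWith ((φ n).normed volume) (G i) z.1 z.2 - G i z.1 z.2) 2 (volume.prod volume))
      atTop (𝓝 0) := fun i =>
    FunctionSpaces.tendsto_eLpNorm_timeConv_sub hφ (hGm i) one_le_two ENNReal.ofNat_ne_top (hG2 i)
  -- pointwise domination by the sum of the coordinates
  have hbound : ∀ n, eLpNorm (fun q : ℝ × UnitAddTorus d =>
      FunctionSpaces.Torus.mollifiedField (φ n) ε U q.1 q.2 - FunctionSpaces.Torus.vecMollify ε (U q.1) q.2) 2 (volume.prod volume) ≤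
      ∑ i, eLpNorm (fun z : ℝ × UnitAddTorus d =>
        FunctionSpaces.timeAvgWith ((φ n).normed volume) (G i) z.1 z.2 - G i z.1 z.2) 2 (volume.prod volume) := by
    intro n
    have hmeas : ∀ i ∈ Finset.univ, AEStronglyMeasurable (fun z : ℝ × UnitAddTorus d =>
        ‖FunctionSpaces.timeAvgWith ((φ n).normed volume) (G i) z.1 z.2 - G i z.1 z.2‖) (volume.prod volume) :=
      fun i _ => (((FunctionSpaces.stronglyMeasurable_uncurry_timeAvgWith (φ n) (hGm i)).sub (hGm i)).norm
        ).aestronglyMeasurable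
    calc eLpNorm (fun q : ℝ × UnitAddTorus d =>
          FunctionSpaces.Torus.mollifiedField (φ n) ε U q.1 q.2 - FunctionSpaces.Torus.vecMollify ε (U q.1) q.2) 2 (volume.prod volume)
        ≤ eLpNorm (∑ i, fun z : ℝ × UnitAddTorus d =>
            ‖FunctionSpaces.timeAvgWith ((φ n).normed volume) (G i) z.1 z.2 - G i z.1 z.2‖) 2 (volume.prod volume) := by
          refine eLpNorm_mono fun q => ?_
          rw [Finset.sum_apply, Real.norm_of_nonneg (Finset.sum_nonneg fun i _ => norm_nonneg _)]
          refine (norm_le_sum_norm_apply _).trans (le_of_eq (Finset.sum_congr rfl fun i _ => ?_))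
          rw [PiLp.sub_apply, mollifiedField_apply_eq_timeAvgWith hUi hε hε', FunctionSpaces.Torus.vecMollify_apply]
      _ ≤ ∑ i, eLpNorm (fun z : ℝ × UnitAddTorus d =>
            ‖FunctionSpaces.timeAvgWith ((φ n).normed volume) (G i) z.1 z.2 - G i z.1 z.2‖) 2 (volume.prod volume) :=
          eLpNorm_sum_le hmeas one_le_two
      _ = _ := Finset.sum_congr rfl fun i _ => eLpNorm_norm _
  have hsum : Tendsto (fun n => ∑ i, eLpNorm (fun z : ℝ × UnitAddTorus d =>
      FunctionSpaces.timeAvgWith ((φ n).normed volume) (G i) z.1 z.2 - G i z.1 z.2) 2 (volume.prod volume))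
      atTop (𝓝 0) := by
    have h := tendsto_finsetSum (Finset.univ : Finset d) fun i _ => hcomp i
    simpa using h
  exact tendsto_of_tendsto_of_tendsto_of_le_of_le tendsto_const_nhds hsum (fun n => zero_le) hbound

end Limit

/-! ## The energy balance of `u^ε` -/

section Balance

variable {U : ℝ → UnitAddTorus d → EuclideanSpace ℝ d} {ε : ℝ} {η : ℝ → ℝ} {T₀ : ℝ}

omit [DecidableEq d] in
/-- The derivative of a function vanishing off `[a, b]` vanishes off `[a, b]`. [folklore] -/
theorem deriv_eq_zero_of_eq_zero_off {η : ℝ → ℝ} {a b : ℝ} (hη0 : ∀ s, s ∉ Icc a b → η s = 0)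
    (s : ℝ) (hs : s ∉ Icc a b) : deriv η s = 0 := by
  have hev : η =ᶠ[𝓝 s] fun _ => 0 := by
    simp only [mem_Icc, not_and_or, not_le] at hs
    rcases hs with hs | hs
    · filter_upwards [Iio_mem_nhds hs] with τ hτ
      exact hη0 τ fun h => (not_le.2 (mem_Iio.1 hτ)) h.1
    · filter_upwards [Ioi_mem_nhds hs] with τ hτ
      exact hη0 τ fun h => (not_le.2 (mem_Ioi.1 hτ)) h.2
  rw [hev.deriv_eq, deriv_const]

omit [DecidableEq d] in
/-- A sequence of time bumps of radius `δ₀/(n+1)`. [folklore] -/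
theorem exists_contDiffBump_seq_rOut {δ₀ : ℝ} (hδ₀ : 0 < δ₀) :
    ∃ φ : ℕ → ContDiffBump (0 : ℝ), (∀ n, (φ n).rOut = δ₀ / (n + 1)) ∧
      Tendsto (fun n => (φ n).rOut) atTop (𝓝 0) := by
  refine ⟨fun n => ⟨δ₀ / (n + 2), δ₀ / (n + 1), by positivity,
    div_lt_div_of_pos_left hδ₀ (by positivity) (by linarith)⟩, fun n => rfl, ?_⟩
  have h : Tendsto (fun n : ℕ => δ₀ / ((n : ℝ) + 1)) atTop (𝓝 0) := by
    have h1 := tendsto_const_div_atTop_nhds_zero_nat δ₀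
    have h2 := (tendsto_add_atTop_iff_nat 1).2 h1
    refine h2.congr fun n => ?_
    push_cast
    ring_nf
  exact h

/-- **CET (11), distributional in time.** Let `U : ℝ → T^d → ℝ^d` be strongly measurable,
integrable, in `L²` and `L³` on `ℝ × T^d`, vanishing off the time interval `(0, T₀)`, weakly
divergence free at a.e. time, and satisfying the pressure-free weak Euler identity against every
admissible divergence-free test field on `(0, T₀)`. Then for `0 < ε ≤ 1/4` and every smooth
cut-off `η` vanishing off `[a, b] ⊂ (0, T₀)`:
`½ ∫ η'(s) ‖u^ε(s)‖²_{L²} ds + ∑ᵢⱼ ∫∫ η(s) ((UᵢUⱼ)(s) ⋆ k_ε)(y) ((Uᵢ s) ⋆ ∂ⱼk_ε)(y) dy ds = 0`,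
`u^ε(s) = vecMollify ε (U s)` — the identity
"`∫|u^ε(x,t)|² - ∫|u^ε(x,0)|² = 2∫₀ᵗ∫ Tr((u⊗u)^ε ∇u^ε)`" of Constantin–E–Titi 1994, p. 209 for
`L²_{t,x}` weak solutions (pass to the limit of vanishing time radius in
`Torus.mollified_energy_balance`: the mollified fields converge in `L²`, the mollified fluxes in
`L^{3/2}`, the mollified gradients in `L³`). [cite: ConstantinETiti1994, p. 209] -/
theorem energy_balance_vecMollify (hUm : StronglyMeasurable (uncurry U))
    (hUi : Integrable (uncurry U) (volume.prod volume)) (hU2 : MemLp (uncurry U) 2 (volume.prod volume))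
    (hU3 : MemLp (uncurry U) 3 (volume.prod volume)) (hε : 0 < ε) (hε' : ε ≤ 1 / 4)
    (hU0 : ∀ t, t ∉ Ioo 0 T₀ → U t = 0) (hdiv : ∀ᵐ s, FunctionSpaces.Torus.IsWeaklyDivFree (U s))
    (hweak : ∀ ψ : ℝ → UnitAddTorus d → EuclideanSpace ℝ d, FunctionSpaces.Torus.IsSpaceTimeTestIoo T₀ ψ →
      FunctionSpaces.Torus.IsDivFreeTest ψ →
      ∫ t in Ioo 0 T₀, ∫ x, (⟪U t x, FunctionSpaces.Torus.timeDeriv ψ t x⟫_ℝ + ⟪U t x, FunctionSpaces.Torus.convect (U t) (ψ t) x⟫_ℝ) = 0)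
    (hη : ContDiff ℝ ∞ η) {a b : ℝ} (hη0 : ∀ s, s ∉ Icc a b → η s = 0) (ha : 0 < a)
    (hb : b < T₀) :
    (1 / 2) * (∫ s, deriv η s * ∫ y, ‖FunctionSpaces.Torus.vecMollify ε (U s) y‖ ^ 2) +
      ∑ i, ∑ j, ∫ q : ℝ × UnitAddTorus d, η q.1 *
        (((fun y => U q.1 y i * U q.1 y j) ⋆ FunctionSpaces.Torus.kernel ε) q.2 *
          ((fun y => U q.1 y i) ⋆ FunctionSpaces.Torus.partialDeriv j (FunctionSpaces.Torus.kernel ε)) q.2) ∂(volume.prod volume) = 0 := by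
  have hηc : Continuous η := hη.continuous
  have hη'c : Continuous (deriv η) := hη.continuous_deriv (by simp)
  have hη'0 : ∀ s, s ∉ Icc a b → deriv η s = 0 := deriv_eq_zero_of_eq_zero_off hη0
  obtain ⟨Cη, hCη⟩ := hηc.bounded_above_of_compact_support
    (HasCompactSupport.intro (isCompact_Icc (a := a) (b := b)) hη0)
  obtain ⟨Cη', hCη'⟩ := hη'c.bounded_above_of_compact_support
    (HasCompactSupport.intro (isCompact_Icc (a := a) (b := b)) hη'0)
  have hCη0 : 0 ≤ Cη' := (norm_nonneg _).trans (hCη' 0)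
  have hk := FunctionSpaces.Torus.isSmooth_kernel (d := d) hε hε'
  have hkc := FunctionSpaces.Torus.continuous_kernel (d := d) hε hε'
  have hkj : ∀ j, Continuous (FunctionSpaces.Torus.partialDeriv j (FunctionSpaces.Torus.kernel (d := d) ε)) := fun j => (hk.partialDeriv j).continuous
  -- the bumps
  set δ₀ : ℝ := min a (T₀ - b) / 2 with hδ₀
  have hδ₀p : 0 < δ₀ := by
    rw [hδ₀]; exact half_pos (lt_min ha (by linarith))
  obtain ⟨φ, hφr, hφ0⟩ := exists_contDiffBump_seq_rOut hδ₀p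
  have hφle : ∀ n, (φ n).rOut ≤ δ₀ := fun n => by
    rw [hφr]
    exact div_le_self hδ₀p.le (by linarith [(Nat.cast_nonneg n : (0 : ℝ) ≤ n)])
  have hδa : δ₀ < a := by
    rw [hδ₀]; linarith [min_le_left a (T₀ - b), lt_min ha (show 0 < T₀ - b by linarith)]
  have hδb : b + δ₀ < T₀ := by
    rw [hδ₀]; linarith [min_le_right a (T₀ - b), lt_min ha (show 0 < T₀ - b by linarith)]
  -- the balance at level `n`
  have hbal := fun n => mollified_energy_balance (φ := φ n) hUm hUi hU2 hε hε' hU0 hdiv hweak hη hη0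
    (lt_of_le_of_lt (hφle n) hδa) (by linarith [hφle n])
  -- Part 1: the energies, written as integrals over `ℝ × T^d`
  set ue : ℝ → UnitAddTorus d → EuclideanSpace ℝ d := fun s => FunctionSpaces.Torus.vecMollify ε (U s) with hue
  set w : ℕ → ℝ → UnitAddTorus d → EuclideanSpace ℝ d := fun n => FunctionSpaces.Torus.mollifiedField (φ n) ε U with hw
  have hU0' : ∀ t, t ∉ Icc 0 T₀ → U t = 0 := fun t ht => hU0 t fun h => ht (Ioo_subset_Icc_self h)
  -- measurability and square integrability of `u^ε`
  have hG : ∀ i, StronglyMeasurable (uncurry fun s x => ((fun y => U s y i) ⋆ FunctionSpaces.Torus.kernel ε) x) := fun i =>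
    stronglyMeasurable_uncurry_convolution (stronglyMeasurable_uncurry_apply hUm i) hkc
  have huem : AEStronglyMeasurable (uncurry ue) ((volume : Measure ℝ).prod volume) := by
    have hfun : uncurry ue = fun q => (PiLp.continuousLinearEquiv 2 ℝ (fun _ : d => ℝ)).symm
        (fun i => ((fun y => U q.1 y i) ⋆ FunctionSpaces.Torus.kernel ε) q.2) := by
      funext q; rfl
    rw [hfun]
    refine (PiLp.continuousLinearEquiv 2 ℝ (fun _ : d => ℝ)).symm.continuous.comp_aestronglyMeasurable ?_
    exact (measurable_pi_iff.2 fun i => (hG i).measurable).aestronglyMeasurable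
  have hue2 : MemLp (uncurry ue) 2 ((volume : Measure ℝ).prod volume) := by
    refine ⟨huem, ?_⟩
    have hb : eLpNorm (uncurry ue) 2 ((volume : Measure ℝ).prod volume) ≤
        ∑ i, eLpNorm (uncurry fun s x => ((fun y => U s y i) ⋆ FunctionSpaces.Torus.kernel ε) x) 2 (volume.prod volume) := by
      calc eLpNorm (uncurry ue) 2 ((volume : Measure ℝ).prod volume)
          ≤ eLpNorm (∑ i, fun q : ℝ × UnitAddTorus d => ‖((fun y => U q.1 y i) ⋆ FunctionSpaces.Torus.kernel ε) q.2‖) 2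
              (volume.prod volume) := by
            refine eLpNorm_mono fun q => ?_
            rw [Finset.sum_apply, Real.norm_of_nonneg (Finset.sum_nonneg fun i _ => norm_nonneg _)]
            exact (norm_le_sum_norm_apply _).trans (le_of_eq rfl)
        _ ≤ ∑ i, eLpNorm (fun q : ℝ × UnitAddTorus d => ‖((fun y => U q.1 y i) ⋆ FunctionSpaces.Torus.kernel ε) q.2‖) 2
              (volume.prod volume) :=
            eLpNorm_sum_le (fun i _ => (hG i).norm.aestronglyMeasurable) one_le_two
        _ = _ := Finset.sum_congr rfl fun i _ => eLpNorm_norm _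
    refine hb.trans_lt (ENNReal.sum_lt_top.2 fun i _ => ?_)
    refine (eLpNorm_uncurry_convolution_apply_le hUm hkc i one_le_two ENNReal.ofNat_ne_top).trans_lt ?_
    rw [FunctionSpaces.Torus.lintegral_enorm_kernel hε hε', one_mul]
    exact hU2.2
  -- energies in product form
  have hLn : ∀ n, ∫ s, deriv η s * ∫ y, ‖w n s y‖ ^ 2 =
      ∫ q : ℝ × UnitAddTorus d, deriv η q.1 * ‖uncurry (w n) q‖ ^ 2 ∂(volume.prod volume) := by
    intro n
    have hi : Integrable (fun q : ℝ × UnitAddTorus d => deriv η q.1 * ‖uncurry (w n) q‖ ^ 2)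
        ((volume : Measure ℝ).prod volume) :=
      integrable_uncurry_of_tsupport (F := fun s y => deriv η s * ‖w n s y‖ ^ 2) (a := a) (b := b)
        ((hη'c.comp continuous_fst).mul
          ((continuous_pow 2).comp (continuous_uncurry_mollifiedField hUi hε hε').norm))
        fun s hs => by funext y; simp [hη'0 s hs]
    rw [integral_prod _ hi]
    simp only [uncurry]
    simp_rw [integral_const_mul]
  have hL : ∫ s, deriv η s * ∫ y, ‖ue s y‖ ^ 2 =
      ∫ q : ℝ × UnitAddTorus d, deriv η q.1 * ‖uncurry ue q‖ ^ 2 ∂(volume.prod volume) := by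
    have hi : Integrable (fun q : ℝ × UnitAddTorus d => deriv η q.1 * ‖uncurry ue q‖ ^ 2)
        ((volume : Measure ℝ).prod volume) :=
      ((memLp_two_iff_integrable_sq_norm huem).1 hue2).bdd_mul
        ((hη'c.comp continuous_fst).aestronglyMeasurable) (Eventually.of_forall fun q => hCη' q.1)
    rw [integral_prod _ hi]
    simp only [uncurry]
    simp_rw [integral_const_mul]
  have hlimL : Tendsto (fun n => ∫ s, deriv η s * ∫ y, ‖w n s y‖ ^ 2) atTop
      (𝓝 (∫ s, deriv η s * ∫ y, ‖ue s y‖ ^ 2)) := by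
    simp_rw [hLn, hL]
    have h := FunctionSpaces.tendsto_integral_mul_norm_sq (μ := ((volume : Measure ℝ).prod volume))
      (f := fun n => uncurry (w n)) (g := uncurry ue)
      (fun n => (continuous_uncurry_mollifiedField hUi hε hε').aestronglyMeasurable) hue2
      ?_ ((hη'c.comp continuous_fst).aestronglyMeasurable) hCη0 (fun q => hCη' q.1)
    · exact h
    · have h2 := tendsto_eLpNorm_mollifiedField_sub hUm hUi hU2 hε hε' hφ0
      refine h2.congr fun n => ?_
      rfl
  -- Part 2: the fluxes
  have hρc : ∀ n, Continuous ((φ n).normed volume) := fun n => (φ n).continuous_normed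
  have hρs : ∀ n, HasCompactSupport ((φ n).normed volume) := fun n => (φ n).hasCompactSupport_normed
  have hΘ := fun i j => integrable_uncurry_mul_apply hUm hU2 i j
  have hUim : ∀ i, StronglyMeasurable (uncurry fun s y => U s y i) := fun i =>
    stronglyMeasurable_uncurry_apply hUm i
  have hUii : ∀ i, Integrable (uncurry fun s y => U s y i) ((volume : Measure ℝ).prod volume) :=
    fun i => hUi.eval_piLp i
  have hlimR : ∀ i j, Tendsto (fun n => ∫ q : ℝ × UnitAddTorus d, η q.1 *
      (((FunctionSpaces.timeAvgWith ((φ n).normed volume) (fun t y => U t y i * U t y j) q.1) ⋆ FunctionSpaces.Torus.kernel ε) q.2 *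
        FunctionSpaces.Torus.partialDeriv j (fun y => FunctionSpaces.Torus.mollifiedField (φ n) ε U q.1 y i) q.2) ∂(volume.prod volume)) atTop
      (𝓝 (∫ q : ℝ × UnitAddTorus d, η q.1 * (((fun y => U q.1 y i * U q.1 y j) ⋆ FunctionSpaces.Torus.kernel ε) q.2 *
        ((fun y => U q.1 y i) ⋆ FunctionSpaces.Torus.partialDeriv j (FunctionSpaces.Torus.kernel ε)) q.2) ∂(volume.prod volume))) := by
    intro i j
    set T : ℝ → UnitAddTorus d → ℝ := fun s => (fun y => U s y i * U s y j) ⋆ FunctionSpaces.Torus.kernel ε with hT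
    set D : ℝ → UnitAddTorus d → ℝ := fun s => (fun y => U s y i) ⋆ FunctionSpaces.Torus.partialDeriv j (FunctionSpaces.Torus.kernel ε) with hD
    have hTm : StronglyMeasurable (uncurry T) := stronglyMeasurable_uncurry_convolution (hΘ i j).1 hkc
    have hDm : StronglyMeasurable (uncurry D) := stronglyMeasurable_uncurry_convolution (hUim i) (hkj j)
    have hT32 : eLpNorm (uncurry T) (3 / 2) ((volume : Measure ℝ).prod volume) < ⊤ := by
      refine (eLpNorm_uncurry_convolution_le (hΘ i j).1 hkc FunctionSpaces.ennreal_one_le_three_halves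
        FunctionSpaces.ennreal_three_halves_ne_top).trans_lt ?_
      rw [FunctionSpaces.Torus.lintegral_enorm_kernel hε hε', one_mul]
      exact (eLpNorm_uncurry_mul_apply_le U i j).trans_lt
        (ENNReal.rpow_lt_top_of_nonneg zero_le_two hU3.2.ne)
    have hD3 : eLpNorm (uncurry D) 3 ((volume : Measure ℝ).prod volume) < ⊤ := by
      refine (eLpNorm_uncurry_convolution_apply_le hUm (hkj j) i (by norm_num) ENNReal.ofNat_ne_top).trans_lt ?_
      exact ENNReal.mul_lt_top ((hkj j).integrable_unitAddTorus).2 hU3.2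
    -- the `n`-th objects as time averages of `T`, `D`
    have hAn : ∀ n (q : ℝ × UnitAddTorus d),
        ((FunctionSpaces.timeAvgWith ((φ n).normed volume) (fun t y => U t y i * U t y j) q.1) ⋆ FunctionSpaces.Torus.kernel ε) q.2 =
          FunctionSpaces.timeAvgWith ((φ n).normed volume) T q.1 q.2 := fun n q => by
      rw [FunctionSpaces.Torus.timeAvgWith_convolution (hΘ i j).2 (hρc n) (hρs n) hkc q.1]
    have hBn : ∀ n (q : ℝ × UnitAddTorus d), FunctionSpaces.Torus.partialDeriv j (fun y => FunctionSpaces.Torus.mollifiedField (φ n) ε U q.1 y i) q.2 =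
        FunctionSpaces.timeAvgWith ((φ n).normed volume) D q.1 q.2 := fun n q => by
      have hfun : (fun y => FunctionSpaces.Torus.mollifiedField (φ n) ε U q.1 y i) =
          (FunctionSpaces.timeAvgWith ((φ n).normed volume) (fun s y => U s y i) q.1) ⋆ FunctionSpaces.Torus.kernel ε :=
        funext fun y => FunctionSpaces.Torus.mollifiedField_apply (φ n) ε U q.1 y i
      rw [hfun, FunctionSpaces.Torus.partialDeriv_convolution_timeAvgWith (hUii i) (hρc n) (hρs n) hk q.1 j]
    -- convergence in `L^{3/2}` and `L³`
    have hA : Tendsto (fun n => eLpNorm ((uncurry (FunctionSpaces.timeAvgWith ((φ n).normed volume) T)) - uncurry T)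
        (3 / 2) ((volume : Measure ℝ).prod volume)) atTop (𝓝 0) :=
      FunctionSpaces.tendsto_eLpNorm_timeConv_sub hφ0 hTm FunctionSpaces.ennreal_one_le_three_halves FunctionSpaces.ennreal_three_halves_ne_top hT32
    have hB : Tendsto (fun n => eLpNorm ((uncurry (FunctionSpaces.timeAvgWith ((φ n).normed volume) D)) - uncurry D)
        3 ((volume : Measure ℝ).prod volume)) atTop (𝓝 0) :=
      FunctionSpaces.tendsto_eLpNorm_timeConv_sub hφ0 hDm (by norm_num) ENNReal.ofNat_ne_top hD3
    have h := FunctionSpaces.tendsto_integral_mul_mul (μ := ((volume : Measure ℝ).prod volume))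
      (A := fun n => uncurry (FunctionSpaces.timeAvgWith ((φ n).normed volume) T)) (A' := uncurry T)
      (B := fun n => uncurry (FunctionSpaces.timeAvgWith ((φ n).normed volume) D)) (B' := uncurry D)
      (fun n => (FunctionSpaces.stronglyMeasurable_uncurry_timeAvgWith (φ n) hTm).aestronglyMeasurable)
      hTm.aestronglyMeasurable
      (fun n => (FunctionSpaces.stronglyMeasurable_uncurry_timeAvgWith (φ n) hDm).aestronglyMeasurable)
      hDm.aestronglyMeasurable hT32 hD3 hA hB ((hηc.comp continuous_fst).aestronglyMeasurable)
      (fun q => hCη q.1)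
    refine (h.congr fun n => integral_congr_ae (Eventually.of_forall fun q => ?_)).trans ?_
    · simp only [uncurry, hAn n q, hBn n q, comp_apply]
    · rfl
  -- conclusion: the balance is constantly `0` and tends to the claimed left-hand side
  have hS := (hlimL.const_mul (1 / 2)).add
    (tendsto_finsetSum (Finset.univ : Finset d) fun i _ =>
      tendsto_finsetSum (Finset.univ : Finset d) fun j _ => hlimR i j)
  have hconst : (fun n => (1 / 2) * (∫ s, deriv η s * ∫ y, ‖w n s y‖ ^ 2) +
      ∑ i, ∑ j, ∫ q : ℝ × UnitAddTorus d, η q.1 *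
        (((FunctionSpaces.timeAvgWith ((φ n).normed volume) (fun t y => U t y i * U t y j) q.1) ⋆ FunctionSpaces.Torus.kernel ε) q.2 *
          FunctionSpaces.Torus.partialDeriv j (fun y => FunctionSpaces.Torus.mollifiedField (φ n) ε U q.1 y i) q.2) ∂(volume.prod volume)) =
      fun _ => (0 : ℝ) := funext fun n => hbal n
  rw [hconst] at hS
  exact (tendsto_nhds_unique tendsto_const_nhds hS).symm

end Balance




end Torus

end Literature.Analysis.FluidPDE

/-! ## Part 4. The limit `ε → 0` and the assembly of `Turb.onsager_rigidity_holds`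

Part 4 works on `T^d` until the final statement (`d = Fin 3`): transfer of Besov and
`Lᵖ` data along slice-wise a.e. equality, a strongly measurable representative `U` of the
`L²_{t,x}` class `u · 1_{(0,T)}` (`Torus.exists_stronglyMeasurable_representative`) carrying the
hypotheses of `IsWeakEulerSolution`/`MemL3tBesovSup`, the `ε → 0` limit in CET (11) with the
commutator bound `O(ε^{3α-1})` and `u^ε → u` in `L²`
(`Torus.integral_deriv_mul_energy_eq_zero`: `∫ η' ∫‖U‖² = 0` for every test function `η` on
`(0,T)`), and the assembly `Turb.onsager_rigidity_holds` via a.e. constancy of functions with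
vanishing distributional derivative (`DistributionalConstancy`).
-/

namespace Literature.Analysis.FluidPDE

namespace Torus

variable {d : Type*} [Fintype d]

/-! ## Transfer along a.e. equality on the torus -/

section AE

variable {F : Type*} [NormedAddCommGroup F]

/-- The Besov sup seminorm only depends on the a.e. class (translations are quasi measure
preserving). [folklore] -/
theorem eBesovSupSeminorm_congr_ae {f g : UnitAddTorus d → F} (h : f =ᵐ[volume] g) (s : ℝ)
    (p : ℝ≥0∞) : FunctionSpaces.eBesovSupSeminorm s p f volume = FunctionSpaces.eBesovSupSeminorm s p g volume := by
  simp only [FunctionSpaces.eBesovSupSeminorm, FunctionSpaces.eDiffQuotient]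
  congr 1
  funext hh
  congr 1
  funext _
  rw [eLpNorm_congr_ae]
  filter_upwards [h, (measurePreserving_add_right volume hh).quasiMeasurePreserving.ae_eq h]
    with x hx hxh
  rw [hx]
  exact congrArg (· - g x) hxh

/-- Membership in `B^s_{p,∞}(T^d)` only depends on the a.e. class. [folklore] -/
theorem MemBesovSup.congr_ae {f g : UnitAddTorus d → F} (h : f =ᵐ[volume] g) {s : ℝ} {p : ℝ≥0∞}
    (hf : FunctionSpaces.MemBesovSup s p f volume) : FunctionSpaces.MemBesovSup s p g volume :=
  ⟨hf.1.ae_eq h, by rw [← eBesovSupSeminorm_congr_ae h]; exact hf.2⟩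

/-- The Besov sup norm only depends on the a.e. class. [folklore] -/
theorem eBesovSupNorm_congr_ae {f g : UnitAddTorus d → F} (h : f =ᵐ[volume] g) (s : ℝ)
    (p : ℝ≥0∞) : FunctionSpaces.eBesovSupNorm s p f volume = FunctionSpaces.eBesovSupNorm s p g volume := by
  rw [FunctionSpaces.eBesovSupNorm, FunctionSpaces.eBesovSupNorm, eLpNorm_congr_ae h, eBesovSupSeminorm_congr_ae h]

end AE

/-! ## Slice-level facts about `u^ε = vecMollify ε u` -/

section Slice

variable [DecidableEq d] {ε : ℝ}

omit [DecidableEq d] in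
/-- Comparison of squared `L²` integrals from comparison of `L²` norms. [folklore] -/
theorem integral_norm_sq_le_of_eLpNorm_le {X : Type*} [MeasurableSpace X] {μ : Measure X}
    {E' : Type*} [NormedAddCommGroup E'] {f g : X → E'} (hf : AEStronglyMeasurable f μ)
    (hg : MemLp g 2 μ) (h : eLpNorm f 2 μ ≤ eLpNorm g 2 μ) :
    ∫ x, ‖f x‖ ^ 2 ∂μ ≤ ∫ x, ‖g x‖ ^ 2 ∂μ := by
  have hlin : ∫⁻ x, ‖f x‖ₑ ^ (2 : ℝ) ∂μ ≤ ∫⁻ x, ‖g x‖ₑ ^ (2 : ℝ) ∂μ := by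
    rw [← FunctionSpaces.lintegral_rpow_two_eq_eLpNorm, ← FunctionSpaces.lintegral_rpow_two_eq_eLpNorm] at h
    have h2 := ENNReal.rpow_le_rpow h (zero_le_two (α := ℝ))
    rwa [← ENNReal.rpow_mul, ← ENNReal.rpow_mul, show (1 / (2 : ℝ)) * 2 = 1 by norm_num,
      ENNReal.rpow_one, ENNReal.rpow_one] at h2
  have hconv : ∀ {φ : X → E'} (hφ : AEStronglyMeasurable φ μ),
      ∫ x, ‖φ x‖ ^ 2 ∂μ = (∫⁻ x, ‖φ x‖ₑ ^ (2 : ℝ) ∂μ).toReal := by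
    intro φ hφ
    rw [integral_eq_lintegral_of_nonneg_ae (Eventually.of_forall fun x => sq_nonneg _)
      ((continuous_pow 2).comp_aestronglyMeasurable hφ.norm)]
    congr 1
    refine lintegral_congr fun x => ?_
    rw [← Real.rpow_natCast, Nat.cast_ofNat, ← ofReal_norm, ENNReal.ofReal_rpow_of_nonneg (norm_nonneg _)
      zero_le_two]
  rw [hconv hf, hconv hg.1]
  exact ENNReal.toReal_mono (lintegral_rpow_enorm_lt_top_of_eLpNorm_lt_top two_ne_zero
    ENNReal.ofNat_ne_top hg.2).ne hlin

omit [DecidableEq d] in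
/-- `∫ ‖v‖² = ∑ᵢ ∫ |vᵢ|²` for a vector field with square-integrable coordinates. [folklore] -/
theorem integral_norm_sq_eq_sum {v : UnitAddTorus d → EuclideanSpace ℝ d}
    (hv : ∀ i, Integrable (fun y => ‖v y i‖ ^ 2) volume) :
    ∫ y, ‖v y‖ ^ 2 = ∑ i, ∫ y, ‖v y i‖ ^ 2 := by
  rw [← integral_finsetSum _ fun i _ => hv i]
  refine integral_congr_ae (Eventually.of_forall fun y => ?_)
  exact EuclideanSpace.norm_sq_eq (v y)

omit [DecidableEq d] in
/-- **`∫ ‖u^ε‖² ≤ ∫ ‖u‖²`** for `u ∈ L²(T^d; ℝ^d)` and `0 < ε ≤ 1/4` (coordinatewise Young with the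
unit-mass kernel). [folklore] -/
theorem integral_norm_sq_vecMollify_le {u : UnitAddTorus d → EuclideanSpace ℝ d}
    (hu : MemLp u 2 volume) (hε : 0 < ε) (hε' : ε ≤ 1 / 4) :
    ∫ y, ‖FunctionSpaces.Torus.vecMollify ε u y‖ ^ 2 ≤ ∫ y, ‖u y‖ ^ 2 := by
  have hk := FunctionSpaces.Torus.continuous_kernel (d := d) hε hε'
  have hui : Integrable u volume := hu.integrable one_le_two
  have hci : ∀ i, Continuous ((fun z => u z i) ⋆ FunctionSpaces.Torus.kernel ε) := fun i =>
    FunctionSpaces.Torus.continuous_convolution (hui.eval_piLp i) hk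
  have hcoord : ∀ i, ∫ y, ‖((fun z => u z i) ⋆ FunctionSpaces.Torus.kernel ε) y‖ ^ 2 ≤ ∫ y, ‖u y i‖ ^ 2 := by
    intro i
    have hui2 : MemLp (fun z => u z i) 2 volume := hu.eval_piLp i
    have hY : eLpNorm ((fun z => u z i) ⋆ FunctionSpaces.Torus.kernel ε) 2 volume ≤
        (∫⁻ y, ‖FunctionSpaces.Torus.kernel (d := d) ε y‖ₑ) * eLpNorm (fun z => u z i) 2 volume :=
      FunctionSpaces.Torus.eLpNorm_convolution_le hui2.1 hk.aestronglyMeasurable one_le_two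
    rw [FunctionSpaces.Torus.lintegral_enorm_kernel hε hε', one_mul] at hY
    exact integral_norm_sq_le_of_eLpNorm_le (hci i).aestronglyMeasurable hui2 hY
  have h1 : ∀ i, Integrable (fun y => ‖FunctionSpaces.Torus.vecMollify ε u y i‖ ^ 2) volume := fun i => by
    have h : Integrable (fun y => ‖((fun z => u z i) ⋆ FunctionSpaces.Torus.kernel ε) y‖ ^ 2) volume :=
      ((continuous_pow 2).comp (hci i).norm).integrable_unitAddTorus
    exact h
  have h2 : ∀ i, Integrable (fun y => ‖u y i‖ ^ 2) volume := fun i =>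
    (memLp_two_iff_integrable_sq_norm (hu.eval_piLp i).1).1 (hu.eval_piLp i)
  rw [integral_norm_sq_eq_sum h1, integral_norm_sq_eq_sum h2]
  exact Finset.sum_le_sum fun i _ => hcoord i

/-- **`u^ε → u` in `L²(T^d)`**, in the form `∫ ‖u^{εₙ}‖² → ∫ ‖u‖²` along radii `εₙ → 0`,
`0 < εₙ ≤ 1/4`, for `u ∈ L²(T^d; ℝ^d)` (coordinatewise, the tree's
`Torus.tendsto_eLpNorm_convolution_sub_self`). [folklore] -/
theorem tendsto_integral_norm_sq_vecMollify {u : UnitAddTorus d → EuclideanSpace ℝ d}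
    (hu : MemLp u 2 volume) {εs : ℕ → ℝ} (hpos : ∀ n, 0 < εs n) (hle : ∀ n, εs n ≤ 1 / 4)
    (hlim : Tendsto εs atTop (𝓝 0)) :
    Tendsto (fun n => ∫ y, ‖FunctionSpaces.Torus.vecMollify (εs n) u y‖ ^ 2) atTop (𝓝 (∫ y, ‖u y‖ ^ 2)) := by
  have hui : Integrable u volume := hu.integrable one_le_two
  have hci : ∀ n i, Continuous ((fun z => u z i) ⋆ FunctionSpaces.Torus.kernel (εs n)) := fun n i =>
    FunctionSpaces.Torus.continuous_convolution (hui.eval_piLp i) (FunctionSpaces.Torus.continuous_kernel (hpos n) (hle n))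
  -- coordinatewise `L²` convergence
  have hcomp : ∀ i, Tendsto (fun n => eLpNorm ((fun z => u z i) ⋆ FunctionSpaces.Torus.kernel (εs n) - fun z => u z i) 2
      volume) atTop (𝓝 0) := fun i =>
    FunctionSpaces.Torus.tendsto_eLpNorm_convolution_sub_self (hu.eval_piLp i) (fun n y => FunctionSpaces.Torus.kernel_nonneg (hpos n).le y)
      (fun n => FunctionSpaces.Torus.integral_kernel (hpos n) (hle n)) (fun n => FunctionSpaces.Torus.support_kernel_subset (hpos n))
      (fun n => FunctionSpaces.Torus.continuous_kernel (hpos n) (hle n)) hlim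
  -- the vector difference is dominated by the sum of the coordinate differences
  have hvec : Tendsto (fun n => eLpNorm (FunctionSpaces.Torus.vecMollify (εs n) u - u) 2 volume) atTop (𝓝 0) := by
    have hbound : ∀ n, eLpNorm (FunctionSpaces.Torus.vecMollify (εs n) u - u) 2 volume ≤
        ∑ i, eLpNorm ((fun z => u z i) ⋆ FunctionSpaces.Torus.kernel (εs n) - fun z => u z i) 2 volume := by
      intro n
      calc eLpNorm (FunctionSpaces.Torus.vecMollify (εs n) u - u) 2 volume
          ≤ eLpNorm (∑ i, fun y => ‖((fun z => u z i) ⋆ FunctionSpaces.Torus.kernel (εs n)) y - u y i‖) 2 volume := by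
            refine eLpNorm_mono fun y => ?_
            rw [Finset.sum_apply, Real.norm_of_nonneg (Finset.sum_nonneg fun i _ => norm_nonneg _)]
            refine (norm_le_sum_norm_apply _).trans (le_of_eq (Finset.sum_congr rfl fun i _ => ?_))
            rw [Pi.sub_apply, PiLp.sub_apply, FunctionSpaces.Torus.vecMollify_apply]
        _ ≤ ∑ i, eLpNorm (fun y => ‖((fun z => u z i) ⋆ FunctionSpaces.Torus.kernel (εs n)) y - u y i‖) 2 volume :=
            eLpNorm_sum_le (fun i _ => ((hci n i).aestronglyMeasurable.sub
              (hu.eval_piLp i).1).norm) one_le_two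
        _ = _ := Finset.sum_congr rfl fun i _ => eLpNorm_norm _
    have hsum : Tendsto (fun n => ∑ i, eLpNorm ((fun z => u z i) ⋆ FunctionSpaces.Torus.kernel (εs n) - fun z => u z i) 2
        volume) atTop (𝓝 0) := by
      have h := tendsto_finsetSum (Finset.univ : Finset d) fun i _ => hcomp i
      simpa using h
    exact tendsto_of_tendsto_of_tendsto_of_le_of_le tendsto_const_nhds hsum (fun n => zero_le) hbound
  have h := FunctionSpaces.tendsto_integral_mul_norm_sq (μ := (volume : Measure (UnitAddTorus d)))
    (f := fun n => FunctionSpaces.Torus.vecMollify (εs n) u) (g := u)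
    (fun n => (FunctionSpaces.Torus.isSmooth_vecMollify hui (hpos n) (hle n)).continuous.aestronglyMeasurable) hu hvec
    (c := fun _ => (1 : ℝ)) aestronglyMeasurable_const zero_le_one (fun _ => by simp)
  simpa using h

/-- At a time where `u ∈ L¹`, the mollified gradient is the space derivative of the mollified
field: `(uᵢ ⋆ ∂ⱼk_ε)(x) = ∂ⱼ(u^ε)ᵢ(x)`. [folklore] -/
theorem convolution_partialDeriv_kernel_eq {u : UnitAddTorus d → EuclideanSpace ℝ d}
    (hu : Integrable u volume) (hε : 0 < ε) (hε' : ε ≤ 1 / 4) (i j : d) (x : UnitAddTorus d) :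
    ((fun y => u y i) ⋆ FunctionSpaces.Torus.partialDeriv j (FunctionSpaces.Torus.kernel ε)) x =
      FunctionSpaces.Torus.partialDeriv j (fun y => FunctionSpaces.Torus.vecMollify ε u y i) x := by
  have hfun : (fun y => FunctionSpaces.Torus.vecMollify ε u y i) = (fun y => u y i) ⋆ FunctionSpaces.Torus.kernel ε :=
    funext fun y => FunctionSpaces.Torus.vecMollify_apply ε u y i
  rw [hfun, FunctionSpaces.Torus.partialDeriv_convolution (hu.eval_piLp i) (FunctionSpaces.Torus.isSmooth_kernel hε hε')]

end Slice

/-! ## A strongly measurable representative of an `L²_{t,x}` class -/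

section Representative

variable {E' : Type*} [NormedAddCommGroup E']

/-- **Strongly measurable representative.** A field `u : ℝ → T^d → E'` that is a.e.-strongly
measurable on `(0,T) × T^d` admits a strongly measurable `U : ℝ → T^d → E'` vanishing identically
outside the time interval `(0, T)`, a.e. equal to `u` on `(0,T) × T^d`, and with `U t = u t` a.e.
on the torus for a.e. `t ∈ (0, T)`. [folklore] -/
theorem exists_stronglyMeasurable_representative {T : ℝ} {u : ℝ → UnitAddTorus d → E'}
    (hu : AEStronglyMeasurable (uncurry u) (volume.restrict (Ioo 0 T ×ˢ univ))) :
    ∃ U : ℝ → UnitAddTorus d → E', StronglyMeasurable (uncurry U) ∧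
      (∀ t, t ∉ Ioo 0 T → U t = 0) ∧
      uncurry U =ᵐ[volume] (Ioo 0 T ×ˢ univ).indicator (uncurry u) ∧
      (∀ᵐ t ∂(volume.restrict (Ioo 0 T)), U t =ᵐ[volume] u t) := by
  set S : Set (ℝ × UnitAddTorus d) := Ioo 0 T ×ˢ univ with hS
  have hSm : MeasurableSet S := measurableSet_Ioo.prod MeasurableSet.univ
  have hind : AEStronglyMeasurable (S.indicator (uncurry u)) volume :=
    (aestronglyMeasurable_indicator_iff hSm).2 hu
  set Ut := hind.mk _ with hUt
  have hUtm : StronglyMeasurable Ut := hind.stronglyMeasurable_mk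
  have hae : S.indicator (uncurry u) =ᵐ[volume] Ut := hind.ae_eq_mk
  refine ⟨fun t x => S.indicator Ut (t, x), ?_, fun t ht => ?_, ?_, ?_⟩
  · exact hUtm.indicator hSm
  · funext x
    exact indicator_of_notMem (fun h => ht (mem_prod.1 h).1) _
  · have h1 : (uncurry fun t x => S.indicator Ut (t, x)) = S.indicator Ut := by
      funext p; rfl
    rw [h1]
    have h2 : S.indicator Ut =ᵐ[volume] S.indicator (S.indicator (uncurry u)) :=
      hae.symm.indicator
    rw [indicator_indicator, inter_self] at h2
    exact h2
  · -- slices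
    have h1 : (uncurry fun t x => S.indicator Ut (t, x)) =ᵐ[(volume : Measure ℝ).prod volume]
        S.indicator (uncurry u) := by
      have h2 : S.indicator Ut =ᵐ[volume] S.indicator (S.indicator (uncurry u)) :=
        hae.symm.indicator
      rw [indicator_indicator, inter_self] at h2
      rw [← Measure.volume_eq_prod]
      exact h2
    have h3 := Measure.ae_ae_of_ae_prod h1
    rw [ae_restrict_iff' measurableSet_Ioo]
    filter_upwards [h3] with t ht hmem
    filter_upwards [ht] with x hx
    rw [uncurry_apply_pair] at hx
    rw [hx]
    exact indicator_of_mem (mk_mem_prod hmem (mem_univ x)) _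

end Representative

/-! ## Transporting the hypotheses to the representative -/

section Transport

variable [DecidableEq d] {T : ℝ} {u U : ℝ → UnitAddTorus d → EuclideanSpace ℝ d}

omit [DecidableEq d] in
/-- **Square integrability of the representative**: `uncurry U ∈ L²(ℝ × T^d)` from
`∫_{(0,T)} ∫ ‖u‖² < ∞`. [folklore] -/
theorem memLp_two_representative (hUm : StronglyMeasurable (uncurry U))
    (hU0 : ∀ t, t ∉ Ioo 0 T → U t = 0)
    (hUu : ∀ᵐ t ∂(volume.restrict (Ioo 0 T)), U t =ᵐ[volume] u t)
    (h2 : ∫⁻ t in Ioo 0 T, ∫⁻ x, ‖u t x‖ₑ ^ 2 < ⊤) :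
    MemLp (uncurry U) 2 ((volume : Measure ℝ).prod volume) := by
  refine ⟨hUm.aestronglyMeasurable, ?_⟩
  rw [← FunctionSpaces.lintegral_rpow_two_eq_eLpNorm]
  refine ENNReal.rpow_lt_top_of_nonneg (by norm_num) (ne_of_lt ?_)
  rw [lintegral_prod _ (hUm.measurable.enorm.pow_const _).aemeasurable]
  -- slice-wise identification with `1_{(0,T)}(t) ∫ ‖u t‖²`
  have hae : (fun t => ∫⁻ x, ‖uncurry U (t, x)‖ₑ ^ (2 : ℝ)) =ᵐ[volume]
      (Ioo 0 T).indicator fun t => ∫⁻ x, ‖u t x‖ₑ ^ 2 := by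
    filter_upwards [((ae_restrict_iff' measurableSet_Ioo).1 hUu)] with t ht
    by_cases hmem : t ∈ Ioo 0 T
    · rw [indicator_of_mem hmem]
      refine lintegral_congr_ae ?_
      filter_upwards [ht hmem] with x hx
      rw [uncurry_apply_pair, hx, ENNReal.rpow_two]
    · rw [indicator_of_notMem hmem]
      simp [uncurry_apply_pair, hU0 t hmem]
  rw [lintegral_congr_ae hae, lintegral_indicator measurableSet_Ioo]
  exact h2

omit [DecidableEq d] in
/-- **Cube integrability of the representative** from the Besov hypothesis
`u ∈ L³(0,T; B^α_{3,∞})`: `uncurry U ∈ L³(ℝ × T^d)`, since `‖u t‖_{L³} ≤ ‖u t‖_{B^α_{3,∞}}` at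
a.e. time. [folklore] -/
theorem memLp_three_representative (hUm : StronglyMeasurable (uncurry U))
    (hU0 : ∀ t, t ∉ Ioo 0 T → U t = 0)
    (hUu : ∀ᵐ t ∂(volume.restrict (Ioo 0 T)), U t =ᵐ[volume] u t) {α : ℝ}
    (hB : FunctionSpaces.MemLpBesovSup 3 α 3 u volume (Ioo 0 T)) :
    MemLp (uncurry U) 3 ((volume : Measure ℝ).prod volume) := by
  refine ⟨hUm.aestronglyMeasurable, ?_⟩
  have h3 : (3 : ℝ≥0∞) ≠ 0 := by norm_num
  rw [eLpNorm_eq_lintegral_rpow_enorm_toReal h3 ENNReal.ofNat_ne_top, ENNReal.toReal_ofNat]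
  refine ENNReal.rpow_lt_top_of_nonneg (by norm_num) (ne_of_lt ?_)
  rw [lintegral_prod _ (hUm.measurable.enorm.pow_const _).aemeasurable]
  set b : ℝ → ℝ := fun t => (FunctionSpaces.eBesovSupNorm α 3 (u t) volume).toReal with hb
  -- slice-wise bound by `1_{(0,T)}(t) ‖b t‖ₑ³`
  have hBae : ∀ᵐ t ∂(volume : Measure ℝ), t ∈ Ioo 0 T → FunctionSpaces.MemBesovSup α 3 (u t) volume :=
    (ae_restrict_iff' measurableSet_Ioo).1 hB.1
  have hae : ∀ᵐ t ∂(volume : Measure ℝ), ∫⁻ x, ‖uncurry U (t, x)‖ₑ ^ (3 : ℝ) ≤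
      (Ioo 0 T).indicator (fun t => ‖b t‖ₑ ^ (3 : ℝ)) t := by
    filter_upwards [((ae_restrict_iff' measurableSet_Ioo).1 hUu), hBae] with t ht htB
    by_cases hmem : t ∈ Ioo 0 T
    · rw [indicator_of_mem hmem]
      have hfin := (htB hmem).eBesovSupNorm_lt_top
      have hslice : ∫⁻ x, ‖uncurry U (t, x)‖ₑ ^ (3 : ℝ) = eLpNorm (u t) 3 volume ^ (3 : ℝ) := by
        rw [eLpNorm_eq_lintegral_rpow_enorm_toReal h3 ENNReal.ofNat_ne_top, ENNReal.toReal_ofNat,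
          ← ENNReal.rpow_mul, show (1 / (3 : ℝ)) * 3 = 1 by norm_num, ENNReal.rpow_one]
        refine lintegral_congr_ae ?_
        filter_upwards [ht hmem] with x hx
        rw [uncurry_apply_pair, hx]
      rw [hslice, hb]
      simp only
      rw [Real.enorm_eq_ofReal ENNReal.toReal_nonneg, ENNReal.ofReal_toReal hfin.ne]
      exact ENNReal.rpow_le_rpow (le_self_add) (by norm_num)
    · rw [indicator_of_notMem hmem]
      simp [uncurry_apply_pair, hU0 t hmem]
  refine (lintegral_mono_ae hae).trans_lt ?_
  rw [lintegral_indicator measurableSet_Ioo]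
  have h := hB.2
  rw [FunctionSpaces.eLpBesovSupNorm, eLpNorm_eq_lintegral_rpow_enorm_toReal h3 ENNReal.ofNat_ne_top,
    ENNReal.toReal_ofNat] at h
  exact lt_top_iff_ne_top.2 fun htop => by
    rw [htop, ENNReal.top_rpow_of_pos (by norm_num)] at h
    exact lt_irrefl _ h

omit [DecidableEq d] in
/-- **Integrability of the representative** (square integrable and supported in the
finite-measure strip `[0,T] × T^d`). [folklore] -/
theorem integrable_representative (hU0 : ∀ t, t ∉ Ioo 0 T → U t = 0)
    (hU2 : MemLp (uncurry U) 2 ((volume : Measure ℝ).prod volume)) :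
    Integrable (uncurry U) ((volume : Measure ℝ).prod volume) := by
  have hsupp : support (uncurry U) ⊆ Ioo 0 T ×ˢ univ := by
    intro p hp
    refine mk_mem_prod ?_ (mem_univ _)
    by_contra h
    exact hp (by simp [uncurry, hU0 p.1 h])
  rw [← integrableOn_iff_integrable_of_support_subset hsupp]
  have hfin : ((volume : Measure ℝ).prod volume) (Ioo 0 T ×ˢ (univ : Set (UnitAddTorus d))) ≠ ⊤ := by
    rw [Measure.prod_prod, Real.volume_Ioo, measure_univ, mul_one]
    exact ENNReal.ofReal_ne_top
  haveI : IsFiniteMeasure (((volume : Measure ℝ).prod volume).restrict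
      (Ioo 0 T ×ˢ (univ : Set (UnitAddTorus d)))) := isFiniteMeasure_restrict.2 hfin
  exact (hU2.restrict _).integrable one_le_two

omit [DecidableEq d] in
/-- **Weak incompressibility of the representative** at a.e. time. [folklore] -/
theorem ae_isWeaklyDivFree_representative (hU0 : ∀ t, t ∉ Ioo 0 T → U t = 0)
    (hUu : ∀ᵐ t ∂(volume.restrict (Ioo 0 T)), U t =ᵐ[volume] u t)
    (hdivu : ∀ᵐ t ∂(volume.restrict (Ioo 0 T)), FunctionSpaces.Torus.IsWeaklyDivFree (u t)) :
    ∀ᵐ t ∂(volume : Measure ℝ), FunctionSpaces.Torus.IsWeaklyDivFree (U t) := by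
  filter_upwards [((ae_restrict_iff' measurableSet_Ioo).1 hUu), (ae_restrict_iff' measurableSet_Ioo).1 hdivu] with t ht hdt
  by_cases hmem : t ∈ Ioo 0 T
  · exact (hdt hmem).congr_ae (ht hmem).symm
  · intro θ hθ
    simp [hU0 t hmem]

/-- **The weak Euler identity for the representative.** [folklore] -/
theorem weak_identity_representative
    (hUu : ∀ᵐ t ∂(volume.restrict (Ioo 0 T)), U t =ᵐ[volume] u t)
    (hwu : ∀ ψ : ℝ → UnitAddTorus d → EuclideanSpace ℝ d, FunctionSpaces.Torus.IsSpaceTimeTestIoo T ψ →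
      FunctionSpaces.Torus.IsDivFreeTest ψ →
      ∫ t in Ioo 0 T, ∫ x, (⟪u t x, FunctionSpaces.Torus.timeDeriv ψ t x⟫_ℝ + ⟪u t x, FunctionSpaces.Torus.convect (u t) (ψ t) x⟫_ℝ +
        0 * ⟪u t x, FunctionSpaces.Torus.laplacian (ψ t) x⟫_ℝ) = 0)
    (ψ : ℝ → UnitAddTorus d → EuclideanSpace ℝ d) (hψ : FunctionSpaces.Torus.IsSpaceTimeTestIoo T ψ)
    (hψd : FunctionSpaces.Torus.IsDivFreeTest ψ) :
    ∫ t in Ioo 0 T, ∫ x, (⟪U t x, FunctionSpaces.Torus.timeDeriv ψ t x⟫_ℝ + ⟪U t x, FunctionSpaces.Torus.convect (U t) (ψ t) x⟫_ℝ) = 0 := by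
  refine Eq.trans (integral_congr_ae ?_) (hwu ψ hψ hψd)
  filter_upwards [hUu] with t ht
  refine integral_congr_ae ?_
  filter_upwards [ht] with x hx
  simp only [zero_mul, add_zero, FunctionSpaces.Torus.convect, hx]

end Transport

/-! ## The limit `ε → 0`: the energy has vanishing distributional derivative -/

section EpsilonLimit

variable [DecidableEq d] {T : ℝ} {U : ℝ → UnitAddTorus d → EuclideanSpace ℝ d} {α : ℝ}

omit [DecidableEq d] in
/-- Slices of a square-integrable strongly measurable field are in `L²(T^d)` at a.e. time. [folklore] -/
theorem ae_memLp_two_slice (hUm : StronglyMeasurable (uncurry U))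
    (hU2 : MemLp (uncurry U) 2 ((volume : Measure ℝ).prod volume)) :
    ∀ᵐ s ∂(volume : Measure ℝ), MemLp (U s) 2 volume := by
  have hsq := (memLp_two_iff_integrable_sq_norm hU2.1).1 hU2
  filter_upwards [hsq.prod_right_ae] with s hs
  exact (memLp_two_iff_integrable_sq_norm
    (hUm.comp_measurable (measurable_const.prodMk measurable_id)).aestronglyMeasurable).2 hs

/-- **The flux term is `O(ε^{3α-1})`.** For a.e. time the space–time flux integrand of
`Torus.energy_balance_vecMollify` integrates over the torus to the CET flux, which is bounded by
`2 d² C₁ [U(s)]³_{B^α_{3,∞}} ε^{3α-1}` (`Torus.abs_integral_flux_vecMollify_le_of_memBesovSup`).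
[cite: ConstantinETiti1994, (11)–(12)] -/
theorem abs_sum_flux_le (hUm : StronglyMeasurable (uncurry U))
    (hUi : Integrable (uncurry U) ((volume : Measure ℝ).prod volume))
    (hU2 : MemLp (uncurry U) 2 ((volume : Measure ℝ).prod volume))
    (hU3 : MemLp (uncurry U) 3 ((volume : Measure ℝ).prod volume))
    (hBU : ∀ᵐ t ∂(volume : Measure ℝ), t ∈ Ioo 0 T → FunctionSpaces.MemBesovSup α 3 (U t) volume)
    (hdiv : ∀ᵐ s ∂(volume : Measure ℝ), FunctionSpaces.Torus.IsWeaklyDivFree (U s)) (hα : 0 < α) {ε : ℝ} (hε : 0 < ε)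
    (hε' : ε ≤ 1 / 4) {η : ℝ → ℝ} (hη : Continuous η) {Cη : ℝ} (hCη : ∀ s, ‖η s‖ ≤ Cη)
    (hηIoo : ∀ s, s ∉ Ioo 0 T → η s = 0)
    (hS3 : ∫⁻ t in Ioo 0 T, FunctionSpaces.eBesovSupSeminorm α 3 (U t) volume ^ (3 : ℝ) ≠ ⊤) :
    |∑ i, ∑ j, ∫ q : ℝ × UnitAddTorus d, η q.1 *
        (((fun y => U q.1 y i * U q.1 y j) ⋆ FunctionSpaces.Torus.kernel ε) q.2 *
          ((fun y => U q.1 y i) ⋆ FunctionSpaces.Torus.partialDeriv j (FunctionSpaces.Torus.kernel ε)) q.2) ∂(volume.prod volume)| ≤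
      (ENNReal.ofReal (Cη * ((Fintype.card d : ℝ) ^ 2 * (2 * FunctionSpaces.Torus.gradProfileMass d) * ε ^ (3 * α - 1))) *
        ∫⁻ t in Ioo 0 T, FunctionSpaces.eBesovSupSeminorm α 3 (U t) volume ^ (3 : ℝ)).toReal := by
  have hT1 := FunctionSpaces.holderTriple_threeHalves_three
  have hk := FunctionSpaces.Torus.isSmooth_kernel (d := d) hε hε'
  have hkc := FunctionSpaces.Torus.continuous_kernel (d := d) hε hε'
  have hkj : ∀ j, Continuous (FunctionSpaces.Torus.partialDeriv j (FunctionSpaces.Torus.kernel (d := d) ε)) := fun j => (hk.partialDeriv j).continuous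
  have hCη0 : 0 ≤ Cη := (norm_nonneg _).trans (hCη 0)
  set K : ℝ := (Fintype.card d : ℝ) ^ 2 * (2 * FunctionSpaces.Torus.gradProfileMass d) with hK
  have hK0 : 0 ≤ K := by rw [hK]; have := FunctionSpaces.Torus.gradProfileMass_nonneg (d := d); positivity
  -- the two families of space–time fields and their integrability
  set Tf : d → d → ℝ → UnitAddTorus d → ℝ := fun i j s => (fun y => U s y i * U s y j) ⋆ FunctionSpaces.Torus.kernel ε with hTf
  set Df : d → d → ℝ → UnitAddTorus d → ℝ := fun i j s => (fun y => U s y i) ⋆ FunctionSpaces.Torus.partialDeriv j (FunctionSpaces.Torus.kernel ε)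
    with hDf
  have hΘ := fun i j => integrable_uncurry_mul_apply hUm hU2 i j
  have hUim : ∀ i, StronglyMeasurable (uncurry fun s y => U s y i) := fun i =>
    stronglyMeasurable_uncurry_apply hUm i
  have hTm : ∀ i j, StronglyMeasurable (uncurry (Tf i j)) := fun i j =>
    stronglyMeasurable_uncurry_convolution (hΘ i j).1 hkc
  have hDm : ∀ i j, StronglyMeasurable (uncurry (Df i j)) := fun i j =>
    stronglyMeasurable_uncurry_convolution (hUim i) (hkj j)
  have hT32 : ∀ i j, MemLp (uncurry (Tf i j)) (3 / 2) ((volume : Measure ℝ).prod volume) := by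
    intro i j
    refine ⟨(hTm i j).aestronglyMeasurable, ?_⟩
    refine (eLpNorm_uncurry_convolution_le (hΘ i j).1 hkc FunctionSpaces.ennreal_one_le_three_halves
      FunctionSpaces.ennreal_three_halves_ne_top).trans_lt ?_
    rw [FunctionSpaces.Torus.lintegral_enorm_kernel hε hε', one_mul]
    exact (eLpNorm_uncurry_mul_apply_le U i j).trans_lt
      (ENNReal.rpow_lt_top_of_nonneg zero_le_two hU3.2.ne)
  have hD3 : ∀ i j, MemLp (uncurry (Df i j)) 3 ((volume : Measure ℝ).prod volume) := by
    intro i j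
    refine ⟨(hDm i j).aestronglyMeasurable, ?_⟩
    refine (eLpNorm_uncurry_convolution_apply_le hUm (hkj j) i (by norm_num) ENNReal.ofNat_ne_top).trans_lt ?_
    exact ENNReal.mul_lt_top ((hkj j).integrable_unitAddTorus).2 hU3.2
  have hI : ∀ i j, Integrable (fun q : ℝ × UnitAddTorus d => η q.1 * (Tf i j q.1 q.2 * Df i j q.1 q.2))
      ((volume : Measure ℝ).prod volume) := fun i j =>
    ((hT32 i j).integrable_mul (hD3 i j)).bdd_mul ((hη.comp continuous_fst).aestronglyMeasurable)
      (Eventually.of_forall fun q => hCη q.1)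
  -- Step 1: one iterated integral
  set Φ : ℝ → ℝ := fun s => ∫ y, ∑ i, ∑ j, Tf i j s y * Df i j s y with hΦ
  have hsum : ∑ i, ∑ j, ∫ q : ℝ × UnitAddTorus d, η q.1 * (Tf i j q.1 q.2 * Df i j q.1 q.2)
      ∂(volume.prod volume) = ∫ s, η s * Φ s := by
    have h1 : ∑ i, ∑ j, ∫ q : ℝ × UnitAddTorus d, η q.1 * (Tf i j q.1 q.2 * Df i j q.1 q.2)
        ∂(volume.prod volume) =
        ∫ q : ℝ × UnitAddTorus d, ∑ i, ∑ j, η q.1 * (Tf i j q.1 q.2 * Df i j q.1 q.2)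
          ∂(volume.prod volume) := by
      rw [integral_finsetSum _ fun i _ => integrable_finsetSum _ fun j _ => hI i j]
      refine Finset.sum_congr rfl fun i _ => ?_
      rw [integral_finsetSum _ fun j _ => hI i j]
    have hIs : Integrable (fun q : ℝ × UnitAddTorus d =>
        ∑ i, ∑ j, η q.1 * (Tf i j q.1 q.2 * Df i j q.1 q.2)) ((volume : Measure ℝ).prod volume) :=
      integrable_finsetSum _ fun i _ => integrable_finsetSum _ fun j _ => hI i j
    rw [h1, integral_prod _ hIs]
    refine integral_congr_ae (Eventually.of_forall fun s => ?_)
    simp only [hΦ]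
    rw [← integral_const_mul]
    refine integral_congr_ae (Eventually.of_forall fun y => ?_)
    simp only [Finset.mul_sum]
  rw [hsum]
  -- Step 2: the a.e. bound on `Φ`
  have hΦb : ∀ᵐ s ∂(volume : Measure ℝ), s ∈ Ioo 0 T →
      |Φ s| ≤ K * (FunctionSpaces.eBesovSupSeminorm α 3 (U s) volume).toReal ^ 3 * ε ^ (3 * α - 1) := by
    filter_upwards [hBU, hdiv, hUi.prod_right_ae] with s hB hd hint hmem
    have hint' : Integrable (U s) volume := hint
    have h := FunctionSpaces.Torus.abs_integral_flux_vecMollify_le_of_memBesovSup hα (hB hmem) hd hε hε'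
    have hΦs : Φ s = ∫ x, ∑ i, ∑ j, ((fun y => U s y i * U s y j) ⋆ FunctionSpaces.Torus.kernel ε) x *
        FunctionSpaces.Torus.partialDeriv j (fun y => FunctionSpaces.Torus.vecMollify ε (U s) y i) x := by
      simp only [hΦ, hTf, hDf]
      refine integral_congr_ae (Eventually.of_forall fun x => ?_)
      refine Finset.sum_congr rfl fun i _ => Finset.sum_congr rfl fun j _ => ?_
      rw [convolution_partialDeriv_kernel_eq hint' hε hε']
    rw [hΦs, hK]
    exact h
  -- Step 3: integrate the bound
  refine (FunctionSpaces.abs_integral_le_toReal_lintegral _).trans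
    (ENNReal.toReal_mono (ENNReal.mul_ne_top ENNReal.ofReal_ne_top hS3) ?_)
  · calc ∫⁻ s, ‖η s * Φ s‖ₑ
        ≤ ∫⁻ s, (Ioo 0 T).indicator (fun s => ENNReal.ofReal (Cη * (K * ε ^ (3 * α - 1))) *
            FunctionSpaces.eBesovSupSeminorm α 3 (U s) volume ^ (3 : ℝ)) s := by
          refine lintegral_mono_ae ?_
          filter_upwards [hΦb, hBU] with s hs hB
          by_cases hmem : s ∈ Ioo 0 T
          · rw [indicator_of_mem hmem]
            have hfin := (hB hmem).2
            have h3 : ENNReal.ofReal ((FunctionSpaces.eBesovSupSeminorm α 3 (U s) volume).toReal ^ 3) =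
                FunctionSpaces.eBesovSupSeminorm α 3 (U s) volume ^ (3 : ℝ) := by
              rw [ENNReal.ofReal_pow ENNReal.toReal_nonneg, ENNReal.ofReal_toReal hfin.ne,
                ← ENNReal.rpow_natCast]
              norm_num
            rw [← h3, ← ENNReal.ofReal_mul (by positivity), ← ofReal_norm, norm_mul]
            refine ENNReal.ofReal_le_ofReal ?_
            calc ‖η s‖ * ‖Φ s‖ ≤ Cη * (K * (FunctionSpaces.eBesovSupSeminorm α 3 (U s) volume).toReal ^ 3 *
                  ε ^ (3 * α - 1)) := by
                  rw [Real.norm_eq_abs (Φ s)]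
                  exact mul_le_mul (hCη s) (hs hmem) (abs_nonneg _) hCη0
              _ = Cη * (K * ε ^ (3 * α - 1)) * (FunctionSpaces.eBesovSupSeminorm α 3 (U s) volume).toReal ^ 3 := by
                  ring
          · rw [indicator_of_notMem hmem, hηIoo s hmem, zero_mul, enorm_zero]
      _ = ENNReal.ofReal (Cη * (K * ε ^ (3 * α - 1))) *
            ∫⁻ s in Ioo 0 T, FunctionSpaces.eBesovSupSeminorm α 3 (U s) volume ^ (3 : ℝ) := by
          rw [lintegral_indicator measurableSet_Ioo, lintegral_const_mul' _ _ ENNReal.ofReal_ne_top]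
      _ = _ := by rw [hK]

omit [DecidableEq d] in
/-- Joint strong measurability of `(s, y) ↦ u^ε(s)(y) = vecMollify ε (U s) y`. [folklore] -/
theorem aestronglyMeasurable_uncurry_vecMollify (hUm : StronglyMeasurable (uncurry U)) {ε : ℝ}
    (hε : 0 < ε) (hε' : ε ≤ 1 / 4) :
    AEStronglyMeasurable (uncurry fun s => FunctionSpaces.Torus.vecMollify ε (U s)) ((volume : Measure ℝ).prod volume) := by
  have hG : ∀ i, StronglyMeasurable (uncurry fun s x => ((fun y => U s y i) ⋆ FunctionSpaces.Torus.kernel ε) x) := fun i =>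
    stronglyMeasurable_uncurry_convolution (stronglyMeasurable_uncurry_apply hUm i)
      (FunctionSpaces.Torus.continuous_kernel hε hε')
  have hfun : (uncurry fun s => FunctionSpaces.Torus.vecMollify ε (U s)) = fun q =>
      (PiLp.continuousLinearEquiv 2 ℝ (fun _ : d => ℝ)).symm
        (fun i => ((fun y => U q.1 y i) ⋆ FunctionSpaces.Torus.kernel ε) q.2) := by
    funext q; rfl
  rw [hfun]
  refine (PiLp.continuousLinearEquiv 2 ℝ (fun _ : d => ℝ)).symm.continuous.comp_aestronglyMeasurable ?_
  exact (measurable_pi_iff.2 fun i => (hG i).measurable).aestronglyMeasurable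

/-- **Energies of `u^ε` converge** (dominated convergence in time): along radii `εₙ → 0`,
`∫ η'(s) ‖u^{εₙ}(s)‖²_{L²} ds → ∫ η'(s) ‖U(s)‖²_{L²} ds` for bounded measurable `η'`, since
`‖u^ε(s)‖₂ ≤ ‖U(s)‖₂` and `u^ε(s) → U(s)` in `L²` at a.e. time. [folklore] -/
theorem tendsto_integral_mul_energy_vecMollify (hUm : StronglyMeasurable (uncurry U))
    (hU2 : MemLp (uncurry U) 2 ((volume : Measure ℝ).prod volume)) {εs : ℕ → ℝ}
    (hpos : ∀ n, 0 < εs n) (hle : ∀ n, εs n ≤ 1 / 4) (hlim : Tendsto εs atTop (𝓝 0))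
    {c : ℝ → ℝ} (hc : AEStronglyMeasurable c volume) {C : ℝ} (hC : ∀ s, ‖c s‖ ≤ C) :
    Tendsto (fun n => ∫ s, c s * ∫ y, ‖FunctionSpaces.Torus.vecMollify (εs n) (U s) y‖ ^ 2) atTop
      (𝓝 (∫ s, c s * ∫ y, ‖U s y‖ ^ 2)) := by
  have hsq := (memLp_two_iff_integrable_sq_norm hU2.1).1 hU2
  have hE : Integrable (fun s => ∫ y, ‖U s y‖ ^ 2) volume := hsq.integral_prod_left
  have hslice := ae_memLp_two_slice hUm hU2
  refine tendsto_integral_of_dominated_convergence (fun s => C * ∫ y, ‖U s y‖ ^ 2) ?_ (hE.const_mul C)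
    ?_ ?_
  · intro n
    have hm := aestronglyMeasurable_uncurry_vecMollify hUm (hpos n) (hle n)
    have h2 : AEStronglyMeasurable (fun s => ∫ y, ‖FunctionSpaces.Torus.vecMollify (εs n) (U s) y‖ ^ 2) volume := by
      have h := ((continuous_pow 2).comp_aestronglyMeasurable hm.norm).integral_prod_right'
      exact h
    exact hc.mul h2
  · intro n
    filter_upwards [hslice] with s hs
    rw [norm_mul]
    exact mul_le_mul (hC s) (by
      rw [Real.norm_of_nonneg (integral_nonneg fun y => sq_nonneg _)]
      exact integral_norm_sq_vecMollify_le hs (hpos n) (hle n)) (norm_nonneg _)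
        ((norm_nonneg _).trans (hC s))
  · filter_upwards [hslice] with s hs
    exact (tendsto_integral_norm_sq_vecMollify hs hpos hle hlim).const_mul (c s)

/-- **The energy has vanishing distributional time derivative.** For the representative `U` of
an `L³_t B^α_{3,∞}` weak Euler solution (`α > 1/3`) and every test function `η` on `(0, T)`,
`∫ η'(s) ‖U(s)‖²_{L²} ds = 0` (the balance of `u^ε` for `ε = 1/(m+4)`, the `O(ε^{3α-1})` flux
bound and the convergence of the energies; Constantin–E–Titi 1994, p. 209, conclusion of the
proof). [cite: ConstantinETiti1994, p. 209] -/
theorem integral_deriv_mul_energy_eq_zero (hUm : StronglyMeasurable (uncurry U))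
    (hUi : Integrable (uncurry U) ((volume : Measure ℝ).prod volume))
    (hU2 : MemLp (uncurry U) 2 ((volume : Measure ℝ).prod volume))
    (hU3 : MemLp (uncurry U) 3 ((volume : Measure ℝ).prod volume))
    (hU0 : ∀ t, t ∉ Ioo 0 T → U t = 0) (hdiv : ∀ᵐ s ∂(volume : Measure ℝ), FunctionSpaces.Torus.IsWeaklyDivFree (U s))
    (hweak : ∀ ψ : ℝ → UnitAddTorus d → EuclideanSpace ℝ d, FunctionSpaces.Torus.IsSpaceTimeTestIoo T ψ →
      FunctionSpaces.Torus.IsDivFreeTest ψ →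
      ∫ t in Ioo 0 T, ∫ x, (⟪U t x, FunctionSpaces.Torus.timeDeriv ψ t x⟫_ℝ + ⟪U t x, FunctionSpaces.Torus.convect (U t) (ψ t) x⟫_ℝ) = 0)
    (hBU : ∀ᵐ t ∂(volume : Measure ℝ), t ∈ Ioo 0 T → FunctionSpaces.MemBesovSup α 3 (U t) volume)
    (hS3 : ∫⁻ t in Ioo 0 T, FunctionSpaces.eBesovSupSeminorm α 3 (U t) volume ^ (3 : ℝ) ≠ ⊤) (hα : 1 / 3 < α)
    (hT : 0 < T) {η : ℝ → ℝ} (hη : ContDiff ℝ ∞ η) (hηc : HasCompactSupport η)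
    (hηsupp : tsupport η ⊆ Ioo 0 T) :
    ∫ s, deriv η s * ∫ y, ‖U s y‖ ^ 2 = 0 := by
  have hα0 : 0 < α := lt_trans (by norm_num) hα
  have hηcont : Continuous η := hη.continuous
  have hη'c : Continuous (deriv η) := hη.continuous_deriv (by simp)
  obtain ⟨a, b, ha, -, hb, hab⟩ := FunctionSpaces.exists_Icc_subset_Ioo_of_tsupport_subset hT hηc hηsupp
  have hη0 : ∀ s, s ∉ Icc a b → η s = 0 := fun s hs => by
    by_contra h
    exact hs (hab s h)
  have hηIoo : ∀ s, s ∉ Ioo 0 T → η s = 0 := fun s hs =>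
    hη0 s fun h => hs ⟨lt_of_lt_of_le ha h.1, lt_of_le_of_lt h.2 hb⟩
  have hη'0 : ∀ s, s ∉ Icc a b → deriv η s = 0 := deriv_eq_zero_of_eq_zero_off hη0
  obtain ⟨Cη, hCη⟩ := hηcont.bounded_above_of_compact_support hηc
  obtain ⟨Cη', hCη'⟩ := hη'c.bounded_above_of_compact_support hηc.deriv
  have hCη0 : 0 ≤ Cη := (norm_nonneg _).trans (hCη 0)
  -- the radii `εₘ = 1/(m+4)`
  set εs : ℕ → ℝ := fun m => 1 / ((m : ℝ) + 4) with hεs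
  have hpos : ∀ m, 0 < εs m := fun m => by rw [hεs]; positivity
  have hle : ∀ m, εs m ≤ 1 / 4 := fun m => by
    rw [hεs]
    exact one_div_le_one_div_of_le (by norm_num) (by linarith [(Nat.cast_nonneg m : (0 : ℝ) ≤ m)])
  have hεlim : Tendsto εs atTop (𝓝 0) := by
    have h1 := tendsto_const_div_atTop_nhds_zero_nat (1 : ℝ)
    have h2 := (tendsto_add_atTop_iff_nat 4).2 h1
    refine h2.congr fun m => ?_
    simp only [hεs]
    push_cast
    ring_nf
  -- the balance at level `m`
  have hbal : ∀ m, (1 / 2) * (∫ s, deriv η s * ∫ y, ‖FunctionSpaces.Torus.vecMollify (εs m) (U s) y‖ ^ 2) +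
      ∑ i, ∑ j, ∫ q : ℝ × UnitAddTorus d, η q.1 *
        (((fun y => U q.1 y i * U q.1 y j) ⋆ FunctionSpaces.Torus.kernel (εs m)) q.2 *
          ((fun y => U q.1 y i) ⋆ FunctionSpaces.Torus.partialDeriv j (FunctionSpaces.Torus.kernel (εs m))) q.2) ∂(volume.prod volume) = 0 :=
    fun m => energy_balance_vecMollify hUm hUi hU2 hU3 (hpos m) (hle m) hU0 hdiv hweak hη hη0 ha hb
  -- the flux tends to `0`
  set K : ℝ := (Fintype.card d : ℝ) ^ 2 * (2 * FunctionSpaces.Torus.gradProfileMass d) with hK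
  have hflux : Tendsto (fun m => ∑ i, ∑ j, ∫ q : ℝ × UnitAddTorus d, η q.1 *
      (((fun y => U q.1 y i * U q.1 y j) ⋆ FunctionSpaces.Torus.kernel (εs m)) q.2 *
        ((fun y => U q.1 y i) ⋆ FunctionSpaces.Torus.partialDeriv j (FunctionSpaces.Torus.kernel (εs m))) q.2) ∂(volume.prod volume))
      atTop (𝓝 0) := by
    have hbound : ∀ m, |∑ i, ∑ j, ∫ q : ℝ × UnitAddTorus d, η q.1 *
        (((fun y => U q.1 y i * U q.1 y j) ⋆ FunctionSpaces.Torus.kernel (εs m)) q.2 *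
          ((fun y => U q.1 y i) ⋆ FunctionSpaces.Torus.partialDeriv j (FunctionSpaces.Torus.kernel (εs m))) q.2) ∂(volume.prod volume)| ≤
        (ENNReal.ofReal (Cη * (K * εs m ^ (3 * α - 1))) *
          ∫⁻ t in Ioo 0 T, FunctionSpaces.eBesovSupSeminorm α 3 (U t) volume ^ (3 : ℝ)).toReal := fun m => by
      have h := abs_sum_flux_le hUm hUi hU2 hU3 hBU hdiv hα0 (hpos m) (hle m) hηcont hCη hηIoo hS3
      rw [hK]
      convert h using 4
    have hto : Tendsto (fun m => (ENNReal.ofReal (Cη * (K * εs m ^ (3 * α - 1))) *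
        ∫⁻ t in Ioo 0 T, FunctionSpaces.eBesovSupSeminorm α 3 (U t) volume ^ (3 : ℝ)).toReal) atTop (𝓝 0) := by
      simp_rw [ENNReal.toReal_mul]
      have h1 : Tendsto (fun m => εs m ^ (3 * α - 1)) atTop (𝓝 0) := by
        have h := hεlim.rpow_const (p := 3 * α - 1) (Or.inr (by linarith))
        rwa [Real.zero_rpow (by linarith)] at h
      have h2 : Tendsto (fun m => (ENNReal.ofReal (Cη * (K * εs m ^ (3 * α - 1)))).toReal) atTop
          (𝓝 0) := by
        have hK0 : 0 ≤ K := by rw [hK]; have := FunctionSpaces.Torus.gradProfileMass_nonneg (d := d); positivity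
        have h3 : Tendsto (fun m => Cη * (K * εs m ^ (3 * α - 1))) atTop (𝓝 0) := by
          have := (h1.const_mul K).const_mul Cη
          simpa using this
        have h4 : ∀ m, (ENNReal.ofReal (Cη * (K * εs m ^ (3 * α - 1)))).toReal =
            Cη * (K * εs m ^ (3 * α - 1)) := fun m =>
          ENNReal.toReal_ofReal (mul_nonneg hCη0 (mul_nonneg hK0
            (Real.rpow_nonneg (hpos m).le _)))
        simp_rw [h4]
        exact h3
      simpa using h2.mul_const ((∫⁻ t in Ioo 0 T, FunctionSpaces.eBesovSupSeminorm α 3 (U t) volume ^ (3 : ℝ)).toReal)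
    exact squeeze_zero_norm (fun m => by rw [Real.norm_eq_abs]; exact hbound m) hto
  -- the energies converge
  have henergy := tendsto_integral_mul_energy_vecMollify hUm hU2 hpos hle hεlim
    hη'c.aestronglyMeasurable hCη'
  -- conclude
  have hS := (henergy.const_mul (1 / 2)).add hflux
  have hconst : (fun m => (1 / 2) * (∫ s, deriv η s * ∫ y, ‖FunctionSpaces.Torus.vecMollify (εs m) (U s) y‖ ^ 2) +
      ∑ i, ∑ j, ∫ q : ℝ × UnitAddTorus d, η q.1 *
        (((fun y => U q.1 y i * U q.1 y j) ⋆ FunctionSpaces.Torus.kernel (εs m)) q.2 *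
          ((fun y => U q.1 y i) ⋆ FunctionSpaces.Torus.partialDeriv j (FunctionSpaces.Torus.kernel (εs m))) q.2) ∂(volume.prod volume)) =
      fun _ => (0 : ℝ) := funext hbal
  rw [hconst] at hS
  have h := tendsto_nhds_unique tendsto_const_nhds hS
  linarith

end EpsilonLimit






end Torus

/-! ## Onsager rigidity -/

section Turb

/-- **Discharge of `Turb.onsager_rigidity` (Constantin–E–Titi 1994, Theorem, p. 207).** A weak
solution of incompressible Euler on `T³ × (0,T)` in `L³(0,T; B^α_{3,∞}(T³))`, `α > 1/3`, conserves
kinetic energy: `E(u(s)) = E(u(t))` for a.e. `s, t ∈ (0,T)`. Proof: see the module docstring —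
strongly measurable representative, the mollified energy balance (11) in distributional-in-time
form, the commutator estimate `O(ε^{3α-1})`, `ε → 0`, and a.e. constancy of functions with
vanishing distributional derivative. [cite: ConstantinETiti1994, Theorem p. 207] -/
theorem onsager_rigidity_holds : onsager_rigidity := by
  intro T α hα u hu hB
  change ConservesEnergyAEOn T u
  rcases le_or_gt T 0 with hT | hT
  · simp only [ConservesEnergyAEOn, Ioo_eq_empty_of_le hT, Measure.restrict_empty, ae_zero]
    exact eventually_bot
  rw [conservesEnergyAEOn_iff_exists_ae_eq_const hT]
  have hα0 : 0 < α := lt_trans (by norm_num) hα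
  -- Step 1: the representative and its properties
  obtain ⟨U, hUm, hU0, -, hUu⟩ := Torus.exists_stronglyMeasurable_representative
    (FunctionSpaces.Torus.aestronglyMeasurable_uncurry_of_stLift_restrict hu.1)
  have hU2 := Torus.memLp_two_representative hUm hU0 hUu hu.2.1
  have hU3 := Torus.memLp_three_representative hUm hU0 hUu hB
  have hUi := Torus.integrable_representative hU0 hU2
  have hdiv := Torus.ae_isWeaklyDivFree_representative hU0 hUu hu.2.2.1
  have hweak : ∀ ψ : ℝ → UnitAddTorus (Fin 3) → EuclideanSpace ℝ (Fin 3),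
      FunctionSpaces.Torus.IsSpaceTimeTestIoo T ψ → FunctionSpaces.Torus.IsDivFreeTest ψ →
      ∫ t in Ioo 0 T, ∫ x, (⟪U t x, FunctionSpaces.Torus.timeDeriv ψ t x⟫_ℝ +
        ⟪U t x, FunctionSpaces.Torus.convect (U t) (ψ t) x⟫_ℝ) = 0 := fun ψ hψ hψd =>
    Torus.weak_identity_representative hUu hu.2.2.2 ψ hψ hψd
  -- Besov data of the representative
  have hBae : ∀ᵐ t ∂(volume : Measure ℝ), t ∈ Ioo 0 T → FunctionSpaces.MemBesovSup α 3 (u t) volume :=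
    (ae_restrict_iff' measurableSet_Ioo).1 hB.1
  have hBU : ∀ᵐ t ∂(volume : Measure ℝ), t ∈ Ioo 0 T → FunctionSpaces.MemBesovSup α 3 (U t) volume := by
    filter_upwards [((ae_restrict_iff' measurableSet_Ioo).1 hUu), hBae] with t ht htB hmem
    exact Torus.MemBesovSup.congr_ae (ht hmem).symm (htB hmem)
  have hS3 : ∫⁻ t in Ioo 0 T, FunctionSpaces.eBesovSupSeminorm α 3 (U t) volume ^ (3 : ℝ) ≠ ⊤ := by
    have h3 : (3 : ℝ≥0∞) ≠ 0 := by norm_num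
    have hle : ∀ᵐ t ∂(volume.restrict (Ioo 0 T)), FunctionSpaces.eBesovSupSeminorm α 3 (U t) volume ^ (3 : ℝ) ≤
        ‖(FunctionSpaces.eBesovSupNorm α 3 (u t) volume).toReal‖ₑ ^ (3 : ℝ) := by
      filter_upwards [hUu, hB.1] with t ht htB
      rw [Torus.eBesovSupSeminorm_congr_ae ht, Real.enorm_eq_ofReal ENNReal.toReal_nonneg,
        ENNReal.ofReal_toReal htB.eBesovSupNorm_lt_top.ne]
      exact ENNReal.rpow_le_rpow le_add_self (by norm_num)
    refine ne_of_lt ((lintegral_mono_ae hle).trans_lt ?_)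
    have h := hB.2
    rw [FunctionSpaces.eLpBesovSupNorm, eLpNorm_eq_lintegral_rpow_enorm_toReal h3 ENNReal.ofNat_ne_top,
      ENNReal.toReal_ofNat] at h
    exact lt_top_iff_ne_top.2 fun htop => by
      rw [htop, ENNReal.top_rpow_of_pos (by norm_num)] at h
      exact lt_irrefl _ h
  -- Step 2: the energy profile is integrable on `(0,T)` and has vanishing distributional derivative
  have hsq := (memLp_two_iff_integrable_sq_norm hU2.1).1 hU2
  have hEU : Integrable (fun s => ∫ y, ‖U s y‖ ^ 2) volume := hsq.integral_prod_left
  have hEae : (energyProfile u) =ᵐ[volume.restrict (Ioo 0 T)] fun t => 2⁻¹ * ∫ y, ‖U t y‖ ^ 2 := by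
    filter_upwards [hUu] with t ht
    simp only [energyProfile, FunctionSpaces.Torus.kineticEnergy]
    congr 1
    refine integral_congr_ae ?_
    filter_upwards [ht] with y hy
    rw [hy]
  have hEint : IntegrableOn (energyProfile u) (Ioo 0 T) volume :=
    Integrable.congr ((hEU.const_mul 2⁻¹).integrableOn) hEae.symm
  have hzero : ∀ η : ℝ → ℝ, ContDiff ℝ ∞ η → HasCompactSupport η → tsupport η ⊆ Ioo 0 T →
      ∫ t in Ioo 0 T, deriv η t * energyProfile u t = 0 := by
    intro η hη hηc hηs
    have h := Torus.integral_deriv_mul_energy_eq_zero hUm hUi hU2 hU3 hU0 hdiv hweak hBU hS3 hα hT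
      hη hηc hηs
    have hderiv0 : ∀ t, t ∉ Ioo 0 T → deriv η t = 0 := fun t ht => by
      have h' : t ∉ tsupport η := fun h'' => ht (hηs h'')
      rw [notMem_tsupport_iff_eventuallyEq] at h'
      rw [h'.deriv_eq, deriv_zero, Pi.zero_apply]
    calc ∫ t in Ioo 0 T, deriv η t * energyProfile u t
        = ∫ t in Ioo 0 T, deriv η t * (2⁻¹ * ∫ y, ‖U t y‖ ^ 2) := by
          refine integral_congr_ae ?_
          filter_upwards [hEae] with t ht
          rw [ht]
      _ = ∫ t, deriv η t * (2⁻¹ * ∫ y, ‖U t y‖ ^ 2) :=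
          setIntegral_eq_integral_of_forall_compl_eq_zero fun t ht => by simp [hderiv0 t ht]
      _ = 2⁻¹ * ∫ t, deriv η t * ∫ y, ‖U t y‖ ^ 2 := by
          rw [← integral_const_mul]
          refine integral_congr_ae (Eventually.of_forall fun t => ?_)
          ring
      _ = 0 := by rw [h, mul_zero]
  -- Step 3: a.e. constancy
  exact FunctionSpaces.ae_eq_const_of_forall_setIntegral_deriv_mul_eq_zero hEint hzero

end Turb

end Literature.Analysis.FluidPDE
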